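import Literature.NumberTheory.Irrationality.Zudilin2004.WellPoisedAuxDefinitions
import Literature.NumberTheory.Irrationality.Zudilin2004.BarnesSorokinIntegrals
import Literature.NumberTheory.Irrationality.Zudilin2004.VeryWellPoisedIntegralToolkit
import Literature.Combinatorics.Enumerative.DougallSummation
import Literature.Analysis.Complex.CarlsonTheorem
import Literature.NumberTheory.LFunctions.RiemannXiOrderProofs
import Literature.NumberTheory.Irrationality.BrownZudilin2022.BarnesDoubleProofs
import HarnessLib

/-!
# Zudilin 2004 §4 (Bailey's transformation for `ζ(3)`), 4/4 — Dougall's theorem, the very-well-poised induction and `baileyTransform`, `baileyTransformClosed` HOLD (re-homed proofs)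

**Zudilin 2004, §4 (Bailey's transformation and the Rhin–Viola group for `ζ(3)`) — the named facts `Literature.NumberTheory.Irrationality.Zudilin2004.baileyTransform`
(the quantity (4.4) `F̃₅(B)/Π(B)` is unchanged by the generator `𝔞₁₂` of the group `𝔊`, for admissible integer parameters) and `…baileyTransformClosed`
(the same on the closed parameter box), `GroupStructureZeta3.lean` / `GroupStructureZeta3Closed.lean`, HOLD — EXACT names `…_holds`** ([Zudilin2004] W. Zudilin,
*Arithmetic of linear forms involving odd zeta values*, J. Théor. Nombres Bordeaux **16** (2004), §4, Lemma 7, Prop. 2 with (4.4)–(4.6); the analytic inputs are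
Bailey's 1935 tract [Bailey1935] (Dougall's ₇F₆ summation, Whipple's transformation), the Barnes–Mellin representation of very-well-poised series
[Zudilin2002CatalanRemarks], [Zudilin2002Zeta5], and Sorokin-type multiple integrals as treated in [Lai2024BallRivoal]).  Contents: (1, definitions
file) the rising factorial `rf`, the factorial weight `facQ` / `lamOf` of the level descent, the elementary symmetric functions `eS1 … eS5` of six
parameters; (2) Sorokin integrands and their bounds / convergence, Barnes–Mellin integrals with complex powers, the Barnes–Euler integral, its
continuation and cut-off, kernel bounds, Sorokin's first / last variable and Lemma 3; (3) uniform Gamma-ratio bounds, the very-well-poised Barnes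
kernel and inner integral, the step of the induction, the Sorokin parameter line and holomorphy, the analytic side conditions of Dougall's theorem,
holomorphy and continuation in `h₀`, the reflection `Bailey ⇐ Sorokin`; (4) Dougall's theorem (terminating and non-terminating, Zudilin's form, full
range, complex parameters), the very-well-poised induction, `vwp = integral` for positive parameters, and the two discharges.
RE-HOMED into `Literature/` by the Hodge foundations lane (`lit-hodgefound`, seat p20, generation 40): verbatim DECLARATION-LEVEL ports (the 229
declarations needed, in dependency order; each Part is a slice of one Summits module) of 50 theorem modules `Summits/KontsevichZagierPeriods/Zeta5Search/*.lean`
(Barnes*, Sorokin*, Dougall*, VWP*, HypergeometricWhipple, GammaRatioUniform, WedgeDictionary*, BaileyFromSorokinReflection); the namespace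
`Summit.KontsevichZagierPeriods.Zeta5Search` is re-rooted at `Literature.NumberTheory.Irrationality.Zudilin2004` (module sub-namespaces kept); the nine Barnes–Mellin / Barnes-cube
lemmas the tree already has (`Literature.NumberTheory.Irrationality.BrownZudilin2022.BarnesMellin/BarnesCube`, `BarnesDoubleProofs.lean`) are used, not re-declared; the two `_holds`
theorems carry the EXACT names.  No new named fact (D-0026); imports Mathlib/Literature only; every declaration carries the citation of the printed statement it
formalises or serves.  The Summits originals stay in place (transitional duplication).  WHAT THIS IS NOT: nothing here bears on the period conjecture or on the
irrationality of `ζ(5)`; it is the classical hypergeometric analysis behind Zudilin's group structure, re-proved in the tree's vocabulary.  (This is file 4 of 4; it carries `baileyTransform_holds` and `baileyTransformClosed_holds`.)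
-/

noncomputable section

/-!
## Part 1 — port of `Summits/KontsevichZagierPeriods/Zeta5Search/HypergeometricWhipple.lean` (4 declarations kept)

# HypergeometricWhipple — Whipple's terminating nearly-poised `₄F₃(1)` ↔ Saalschützian `₅F₄(1)` transformation

Declarations of this Part (verbatim port; each keeps its own docstring and citation): `rf_zero`, `rf_succ`, `rf_add`, `rf_eq_ascPochhammer_eval`.

Reference keys (see `references.bib` and the declarations' citations): [Zudilin2004].
-/

section Part1

namespace Literature.NumberTheory.Irrationality.Zudilin2004.HypergeometricWhipple

open _root_.Finset

variable {R : Type*} [CommRing R]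

/-- `(z)_0 = 1`. [cite: Zudilin2004, §4 (supporting lemma)] -/
theorem rf_zero (z : R) : rf z 0 = 1 := by simp [rf]

/-- `(z)_{m+1} = (z)_m (z+m)`. [cite: Zudilin2004, §4 (supporting lemma)] -/
theorem rf_succ (z : R) (m : ℕ) : rf z (m + 1) = rf z m * (z + m) := by
  simp [rf, prod_range_succ]

/-- `(z)_{m+n} = (z)_m (z+m)_n`. [cite: Zudilin2004, §4 (supporting lemma)] -/
theorem rf_add (z : R) (m n : ℕ) : rf z (m + n) = rf z m * rf (z + m) n := by
  unfold rf
  rw [prod_range_add]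
  congr 1
  refine prod_congr rfl fun i _ => ?_
  push_cast; ring

/-- (W) with Mathlib's `ascPochhammer` (`(ascPochhammer R m).eval z = (z)_m`).
[cite: Zudilin2004, §4 (supporting lemma)] -/
theorem rf_eq_ascPochhammer_eval (z : R) (m : ℕ) : rf z m = (ascPochhammer R m).eval z := by
  induction m with
  | zero => simp [rf]
  | succ m ih => rw [rf_succ, ih, ascPochhammer_succ_eval]

end Literature.NumberTheory.Irrationality.Zudilin2004.HypergeometricWhipple

end Part1

/-!
## Part 2 — port of `Summits/KontsevichZagierPeriods/Zeta5Search/DougallTerminatingGamma.lean` (5 declarations kept)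

# Dougall's terminating very-well-poised `₅F₄` sum in Gamma form over `ℂ`

Declarations of this Part (verbatim port; each keeps its own docstring and citation): `rf_ne_zero`, `Gamma_add_nat_eq_mul_rf`, `mul_rf_succ_eq`, `vwp_factor`, `dougall_terminating_gamma`.

Reference keys (see `references.bib` and the declarations' citations): [AndrewsAskeyRoy1999], [Bailey1935].
-/

section Part2

namespace Literature.NumberTheory.Irrationality.Zudilin2004.DougallTerminatingGamma

open _root_.Finset
open Literature.NumberTheory.Irrationality.Zudilin2004.HypergeometricWhipple (rf rf_zero rf_succ rf_add rf_eq_ascPochhammer_eval)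

/-- Off the poles, the rising factorial `(x)_r` does not vanish. [cite: AndrewsAskeyRoy1999, §3.5, Cor. 3.5.2] -/
theorem rf_ne_zero {x : ℂ} (hx : ∀ n : ℕ, x ≠ -(n : ℂ)) (r : ℕ) : rf x r ≠ 0 := by
  unfold rf
  exact Finset.prod_ne_zero_iff.2 fun i _ => add_nat_ne_zero hx i

/-- **`Γ(x+r) = Γ(x)·(x)_r`** for `x` off the poles of `Γ`. [cite: AndrewsAskeyRoy1999, §3.5, Cor. 3.5.2] -/
theorem Gamma_add_nat_eq_mul_rf {x : ℂ} (hx : ∀ n : ℕ, x ≠ -(n : ℂ)) (r : ℕ) :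
    Complex.Gamma (x + r) = Complex.Gamma x * rf x r := by
  induction r with
  | zero => simp [rf_zero]
  | succ r ih =>
    rw [Nat.cast_succ, ← add_assoc, Complex.Gamma_add_one _ (add_nat_ne_zero hx r), ih, rf_succ]
    ring

/-- `x · (x+1)_r = (x)_r · (x+r)`. [cite: AndrewsAskeyRoy1999, §3.5, Cor. 3.5.2] -/
theorem mul_rf_succ_eq (x : ℂ) (r : ℕ) : x * rf (x + 1) r = rf x r * (x + r) := by
  have h1 : rf x (1 + r) = rf x 1 * rf (x + (1 : ℕ)) r := rf_add x 1 r
  have h2 : rf x 1 = x := by simp [rf]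
  rw [Nat.cast_one, h2] at h1
  rw [← h1, add_comm 1 r, rf_succ]

/-- The very-well-poised factor: `(h₀ + 2r)·(h₀/2)_r = h₀·(h₀/2+1)_r`.
[cite: AndrewsAskeyRoy1999, §3.5, Cor. 3.5.2] -/
theorem vwp_factor (h₀ : ℂ) (r : ℕ) : (h₀ + 2 * r) * rf (h₀ / 2) r = h₀ * rf (h₀ / 2 + 1) r := by
  have h := mul_rf_succ_eq (h₀ / 2) r
  linear_combination (-2 : ℂ) * h

/-- **Dougall's terminating very-well-poised `₅F₄` summation in Gamma form** (Zudilin math/0206177 (9) at `h₃ = −v`;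
[cite: AndrewsAskeyRoy1999, §3.5, Cor. 3.5.2] [cite: Bailey1935, §4.4 (1)] with a negative-integer parameter): for
`h₀, h₁, h₂` off the poles and `v ∈ ℕ`,
`Σ_{r ≤ v} (h₀+2r)·Γ(h₀+r)Γ(h₁+r)Γ(h₂+r)/(Γ(r+1)Γ(h₀−h₁+1+r)Γ(h₀−h₂+1+r))·(−v)_r/(h₀+v+1)_r
 = Γ(h₁)Γ(h₂)Γ(h₀+1+v)Γ(h₀−h₁−h₂+1+v)/(Γ(h₀−h₁−h₂+1)Γ(h₀−h₁+1+v)Γ(h₀−h₂+1+v))`. -/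
theorem dougall_terminating_gamma (h₀ h₁ h₂ : ℂ) (v : ℕ)
    (H0 : ∀ n : ℕ, h₀ ≠ -(n : ℂ)) (H0' : ∀ n : ℕ, h₀ / 2 ≠ -(n : ℂ)) (H1 : ∀ n : ℕ, h₁ ≠ -(n : ℂ))
    (H2 : ∀ n : ℕ, h₂ ≠ -(n : ℂ)) (H01 : ∀ n : ℕ, h₀ - h₁ + 1 ≠ -(n : ℂ)) (H02 : ∀ n : ℕ, h₀ - h₂ + 1 ≠ -(n : ℂ))
    (H012 : ∀ n : ℕ, h₀ - h₁ - h₂ + 1 ≠ -(n : ℂ)) :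
    ∑ r ∈ range (v + 1), (h₀ + 2 * r) *
        (Complex.Gamma (h₀ + r) * Complex.Gamma (h₁ + r) * Complex.Gamma (h₂ + r)) /
          (Complex.Gamma ((r : ℂ) + 1) * Complex.Gamma (h₀ - h₁ + 1 + r) * Complex.Gamma (h₀ - h₂ + 1 + r)) *
        (rf (-(v : ℂ)) r / rf (h₀ + v + 1) r) =
      Complex.Gamma h₁ * Complex.Gamma h₂ * Complex.Gamma (h₀ + 1 + v) * Complex.Gamma (h₀ - h₁ - h₂ + 1 + v) /
        (Complex.Gamma (h₀ - h₁ - h₂ + 1) * Complex.Gamma (h₀ - h₁ + 1 + v) * Complex.Gamma (h₀ - h₂ + 1 + v)) := by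
  -- the pole bookkeeping
  have H0p1 : ∀ n : ℕ, h₀ + 1 ≠ -(n : ℂ) := fun n h => H0 (n + 1) (by push_cast; linear_combination h)
  have Hv : ∀ n : ℕ, h₀ + v + 1 ≠ -(n : ℂ) := fun n h => H0 (v + n + 1) (by push_cast; linear_combination h)
  have hΓA : Complex.Gamma (h₀ - h₁ + 1) ≠ 0 := Complex.Gamma_ne_zero fun n => H01 n
  have hΓB : Complex.Gamma (h₀ - h₂ + 1) ≠ 0 := Complex.Gamma_ne_zero fun n => H02 n
  have hΓC : Complex.Gamma (h₀ - h₁ - h₂ + 1) ≠ 0 := Complex.Gamma_ne_zero fun n => H012 n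
  have h0ne : h₀ ≠ 0 := by simpa using H0 0
  -- Dougall's terminating sum over `ℂ`, in `rf` form
  have key := Literature.Combinatorics.Enumerative.dougall5F4_hypergeometric (K := ℂ) h₀ h₁ h₂ v
    (fun r _ => by rw [← rf_eq_ascPochhammer_eval]; exact rf_ne_zero H0' r)
    (fun r _ => by rw [← rf_eq_ascPochhammer_eval]; exact rf_ne_zero H01 r)
    (fun r _ => by rw [← rf_eq_ascPochhammer_eval]; exact rf_ne_zero H02 r)
    (fun r _ => by rw [← rf_eq_ascPochhammer_eval]; exact rf_ne_zero Hv r)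
  simp only [← rf_eq_ascPochhammer_eval] at key
  -- the constant `T₀ = h₀ Γ(h₀)Γ(h₁)Γ(h₂)/(Γ(h₀−h₁+1)Γ(h₀−h₂+1))`
  set T₀ : ℂ := h₀ * Complex.Gamma h₀ * Complex.Gamma h₁ * Complex.Gamma h₂ /
    (Complex.Gamma (h₀ - h₁ + 1) * Complex.Gamma (h₀ - h₂ + 1)) with hT₀
  -- termwise
  have hterm : ∀ r ∈ range (v + 1), (h₀ + 2 * r) *
        (Complex.Gamma (h₀ + r) * Complex.Gamma (h₁ + r) * Complex.Gamma (h₂ + r)) /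
          (Complex.Gamma ((r : ℂ) + 1) * Complex.Gamma (h₀ - h₁ + 1 + r) * Complex.Gamma (h₀ - h₂ + 1 + r)) *
        (rf (-(v : ℂ)) r / rf (h₀ + v + 1) r) =
      T₀ * (rf h₀ r * rf (h₀ / 2 + 1) r * rf h₁ r * rf h₂ r * rf (-(v : ℂ)) r /
        ((r.factorial : ℂ) * rf (h₀ / 2) r * rf (h₀ - h₁ + 1) r * rf (h₀ - h₂ + 1) r * rf (h₀ + v + 1) r)) := by
    intro r _
    have hr : (Complex.Gamma ((r : ℂ) + 1)) = (r.factorial : ℂ) := Complex.Gamma_nat_eq_factorial r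
    rw [Gamma_add_nat_eq_mul_rf H0 r, Gamma_add_nat_eq_mul_rf H1 r, Gamma_add_nat_eq_mul_rf H2 r,
      Gamma_add_nat_eq_mul_rf H01 r, Gamma_add_nat_eq_mul_rf H02 r, hr, hT₀]
    have hfac : (r.factorial : ℂ) ≠ 0 := by exact_mod_cast r.factorial_ne_zero
    have h1 := rf_ne_zero H0' r
    have h2 := rf_ne_zero H01 r
    have h3 := rf_ne_zero H02 r
    have h4 := rf_ne_zero Hv r
    have hv := vwp_factor h₀ r
    set P : ℂ := rf (h₀ / 2 + 1) r with hP
    set Q : ℂ := rf (h₀ / 2) r with hQ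
    field_simp
    linear_combination (Complex.Gamma h₀ * rf h₀ r * Complex.Gamma h₁ * rf h₁ r * Complex.Gamma h₂ * rf h₂ r *
      rf (-(v : ℂ)) r) * hv
  rw [Finset.sum_congr rfl hterm, ← Finset.mul_sum, key, hT₀,
    Gamma_add_nat_eq_mul_rf H0p1 v, Gamma_add_nat_eq_mul_rf H012 v, Gamma_add_nat_eq_mul_rf H01 v,
    Gamma_add_nat_eq_mul_rf H02 v, Complex.Gamma_add_one _ h0ne]
  have h5 := rf_ne_zero H01 v
  have h6 := rf_ne_zero H02 v
  field_simp

end Literature.NumberTheory.Irrationality.Zudilin2004.DougallTerminatingGamma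

end Part2

/-!
## Part 3 — port of `Summits/KontsevichZagierPeriods/Zeta5Search/DougallCarlsonSides.lean` (5 declarations kept)

# The two sides of the Carlson function for Dougall's `₅F₄` sum, at the integers

Declarations of this Part (verbatim port; each keeps its own docstring and citation): `rf_neg_nat_eq_zero`, `series_side_nat`, `differentiable_rf_add`, `differentiable_rf_neg`, `differentiableAt_series_term`.

Reference keys (see `references.bib` and the declarations' citations): [Zudilin2004].
-/

section Part3

namespace Literature.NumberTheory.Irrationality.Zudilin2004.DougallCarlsonSides

open _root_.Finset
open Literature.NumberTheory.Irrationality.Zudilin2004.HypergeometricWhipple (rf rf_zero rf_succ)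
open Literature.NumberTheory.Irrationality.Zudilin2004.DougallTerminatingGamma

/-- `(−v)_μ = 0` for naturals `v < μ` (the block passes through `0`). [cite: Zudilin2004, §4 (supporting lemma)] -/
theorem rf_neg_nat_eq_zero {v μ : ℕ} (h : v < μ) : rf (-(v : ℂ)) μ = 0 := by
  unfold rf
  exact Finset.prod_eq_zero (mem_range.2 h) (by simp)

/-- **B5b — the series side at `z = v ∈ ℕ`.**  The very-well-poised series with last parameter pair in Pochhammer form
terminates at `z = v` and equals the Gamma side there (Dougall's terminating sum, `dougall_terminating_gamma`).
[cite: Zudilin2004, §4 (supporting lemma)] -/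
theorem series_side_nat (h₀ h₁ h₂ : ℂ) (v : ℕ)
    (H0 : ∀ n : ℕ, h₀ ≠ -(n : ℂ)) (H0' : ∀ n : ℕ, h₀ / 2 ≠ -(n : ℂ)) (H1 : ∀ n : ℕ, h₁ ≠ -(n : ℂ))
    (H2 : ∀ n : ℕ, h₂ ≠ -(n : ℂ)) (H01 : ∀ n : ℕ, h₀ - h₁ + 1 ≠ -(n : ℂ)) (H02 : ∀ n : ℕ, h₀ - h₂ + 1 ≠ -(n : ℂ))
    (H012 : ∀ n : ℕ, h₀ - h₁ - h₂ + 1 ≠ -(n : ℂ)) :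
    ∑' μ : ℕ, (h₀ + 2 * μ) *
        (Complex.Gamma (h₀ + μ) * Complex.Gamma (h₁ + μ) * Complex.Gamma (h₂ + μ)) /
          (Complex.Gamma ((μ : ℂ) + 1) * Complex.Gamma (h₀ - h₁ + 1 + μ) * Complex.Gamma (h₀ - h₂ + 1 + μ)) *
        (rf (-(v : ℂ)) μ / rf (h₀ + v + 1) μ) =
      Complex.Gamma h₁ * Complex.Gamma h₂ * Complex.Gamma (h₀ + 1 + v) * Complex.Gamma (h₀ - h₁ - h₂ + 1 + v) /
        (Complex.Gamma (h₀ - h₁ - h₂ + 1) * Complex.Gamma (h₀ - h₁ + 1 + v) * Complex.Gamma (h₀ - h₂ + 1 + v)) := by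
  rw [tsum_eq_sum (s := range (v + 1))
    (fun μ hμ => by rw [rf_neg_nat_eq_zero (by simpa using hμ), zero_div, mul_zero])]
  exact dougall_terminating_gamma h₀ h₁ h₂ v H0 H0' H1 H2 H01 H02 H012

/-- `z ↦ (x + z)_μ` is a polynomial map, hence holomorphic. [cite: Zudilin2004, §4 (supporting lemma)] -/
theorem differentiable_rf_add (x : ℂ) (μ : ℕ) : Differentiable ℂ fun z : ℂ => rf (x + z) μ := by
  induction μ with
  | zero => simp [rf_zero]
  | succ μ ih =>
    simp only [rf_succ]
    exact ih.mul (by fun_prop)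

/-- `z ↦ (−z)_μ` is holomorphic. [cite: Zudilin2004, §4 (supporting lemma)] -/
theorem differentiable_rf_neg (μ : ℕ) : Differentiable ℂ fun z : ℂ => rf (-z) μ := by
  induction μ with
  | zero => simp [rf_zero]
  | succ μ ih =>
    simp only [rf_succ]
    exact ih.mul (by fun_prop)

/-- **The series term's `z`-factor `(−z)_μ/(h₀+1+z)_μ` is holomorphic wherever the denominator block does not vanish**
(e.g. on `Re z > −Re(h₀+1)`). [cite: Zudilin2004, §4 (supporting lemma)] -/
theorem differentiableAt_series_term (h₀ : ℂ) (μ : ℕ) {z : ℂ} (hz : rf (h₀ + 1 + z) μ ≠ 0) :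
    DifferentiableAt ℂ (fun z : ℂ => rf (-z) μ / rf (h₀ + 1 + z) μ) z :=
  ((differentiable_rf_neg μ).differentiableAt).div ((differentiable_rf_add (h₀ + 1) μ).differentiableAt) hz

end Literature.NumberTheory.Irrationality.Zudilin2004.DougallCarlsonSides

end Part3

/-!
## Part 4 — port of `Summits/KontsevichZagierPeriods/Zeta5Search/DougallSeriesSide.lean` (5 declarations kept)

# The series side of Dougall's Carlson function: termwise bound, holomorphy, boundedness

Declarations of this Part (verbatim port; each keeps its own docstring and citation): `norm_rf_neg_le_norm_rf`, `rf_shift_ne_zero`, `norm_ratio_le_one`, `differentiableOn_series`, `norm_series_le`.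

Reference keys (see `references.bib` and the declarations' citations): [Zudilin2004].
-/

section Part4

namespace Literature.NumberTheory.Irrationality.Zudilin2004.DougallSeriesSide

open _root_.Finset _root_.Filter
open Literature.NumberTheory.Irrationality.Zudilin2004.HypergeometricWhipple (rf rf_zero rf_succ)
open Literature.NumberTheory.Irrationality.Zudilin2004.DougallTerminatingGamma (rf_ne_zero)
open Literature.NumberTheory.Irrationality.Zudilin2004.DougallCarlsonSides (differentiableAt_series_term)

variable {h₀ : ℝ} {z : ℂ}

/-- `‖(−z)_μ‖ ≤ ‖(h₀+1+z)_μ‖` on the half-plane `Re z > −(1+h₀)/2`. [cite: Zudilin2004, §4 (supporting lemma)] -/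
theorem norm_rf_neg_le_norm_rf (hh : -1 < h₀) (hz : -(1 + h₀) / 2 < z.re) (μ : ℕ) :
    ‖rf (-z) μ‖ ≤ ‖rf ((h₀ : ℂ) + 1 + z) μ‖ := by
  induction μ with
  | zero => simp [rf_zero]
  | succ μ ih =>
    rw [rf_succ, rf_succ, norm_mul, norm_mul]
    exact mul_le_mul ih (norm_neg_add_nat_le hh hz μ) (norm_nonneg _) (norm_nonneg _)

/-- No zero of the denominator block on the half-plane `Re z > −(1+h₀)/2` (indeed on `Re z > −(1+h₀)`).
[cite: Zudilin2004, §4 (supporting lemma)] -/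
theorem rf_shift_ne_zero (hh : -1 < h₀) (hz : -(1 + h₀) / 2 < z.re) (μ : ℕ) : rf ((h₀ : ℂ) + 1 + z) μ ≠ 0 := by
  refine rf_ne_zero (fun n h => ?_) μ
  have := congrArg Complex.re h
  simp at this
  linarith [n.cast_nonneg (α := ℝ)]

/-- **Termwise bound**: `‖(−z)_μ/(h₀+1+z)_μ‖ ≤ 1` for `h₀ > −1`, `Re z > −(1+h₀)/2`.
[cite: Zudilin2004, §4 (supporting lemma)] -/
theorem norm_ratio_le_one (hh : -1 < h₀) (hz : -(1 + h₀) / 2 < z.re) (μ : ℕ) :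
    ‖rf (-z) μ / rf ((h₀ : ℂ) + 1 + z) μ‖ ≤ 1 := by
  rw [norm_div, div_le_one (norm_pos_iff.2 (rf_shift_ne_zero hh hz μ))]
  exact norm_rf_neg_le_norm_rf hh hz μ

/-- **Holomorphy of the series side** (Weierstrass M-test): for `h₀ > −1` and absolutely summable coefficients `c`,
`z ↦ Σ_μ c_μ·(−z)_μ/(h₀+1+z)_μ` is holomorphic on `{Re z > −(1+h₀)/2}`. [cite: Zudilin2004, §4 (supporting lemma)] -/
theorem differentiableOn_series (hh : -1 < h₀) {c : ℕ → ℂ} (hc : Summable fun μ => ‖c μ‖) :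
    DifferentiableOn ℂ (fun z : ℂ => ∑' μ : ℕ, c μ * (rf (-z) μ / rf ((h₀ : ℂ) + 1 + z) μ))
      {z : ℂ | -(1 + h₀) / 2 < z.re} := by
  refine Complex.differentiableOn_tsum_of_summable_norm hc (fun μ => ?_)
    (isOpen_lt continuous_const Complex.continuous_re) (fun μ w hw => ?_)
  · intro w hw
    exact ((differentiableAt_series_term (h₀ : ℂ) μ (rf_shift_ne_zero hh hw μ)).const_mul (c μ)).differentiableWithinAt
  · rw [norm_mul]
    exact mul_le_of_le_one_right (norm_nonneg _) (norm_ratio_le_one hh hw μ)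

/-- **Boundedness of the series side**: `‖Σ_μ c_μ·(−z)_μ/(h₀+1+z)_μ‖ ≤ Σ_μ ‖c_μ‖` on `{Re z > −(1+h₀)/2}`.
[cite: Zudilin2004, §4 (supporting lemma)] -/
theorem norm_series_le (hh : -1 < h₀) {c : ℕ → ℂ} (hc : Summable fun μ => ‖c μ‖) (hz : -(1 + h₀) / 2 < z.re) :
    ‖∑' μ : ℕ, c μ * (rf (-z) μ / rf ((h₀ : ℂ) + 1 + z) μ)‖ ≤ ∑' μ : ℕ, ‖c μ‖ := by
  refine tsum_of_norm_bounded hc.hasSum fun μ => ?_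
  rw [norm_mul]
  exact mul_le_of_le_one_right (norm_nonneg _) (norm_ratio_le_one hh hz μ)

end Literature.NumberTheory.Irrationality.Zudilin2004.DougallSeriesSide

end Part4

/-!
## Part 5 — port of `Summits/KontsevichZagierPeriods/Zeta5Search/DougallGammaSideBound.lean` (2 declarations kept)

# Polynomial growth of the Gamma side of Dougall's Carlson function

Declarations of this Part (verbatim port; each keeps its own docstring and citation): `norm_rf_le`, `gamma_side_polynomial_bound`.

Reference keys (see `references.bib` and the declarations' citations): [Zudilin2004].
-/

section Part5

namespace Literature.NumberTheory.Irrationality.Zudilin2004.DougallGammaSideBound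

open _root_.MeasureTheory _root_.Set _root_.Filter
open Literature.NumberTheory.Irrationality.Zudilin2004.HypergeometricWhipple (rf rf_zero rf_succ)
open Literature.NumberTheory.Irrationality.Zudilin2004.DougallTerminatingGamma (Gamma_add_nat_eq_mul_rf)

/-- The block `(w)_n` grows at most like `(‖w‖+n)^n`. [cite: Zudilin2004, §4 (supporting lemma)] -/
theorem norm_rf_le (w : ℂ) (n : ℕ) : ‖rf w n‖ ≤ (‖w‖ + n) ^ n := by
  induction n with
  | zero => simp [rf_zero]
  | succ n ih =>
    rw [rf_succ, norm_mul, pow_succ, Nat.cast_succ]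
    have h1 : ‖w + (n : ℂ)‖ ≤ ‖w‖ + (n + 1) := by
      calc ‖w + (n : ℂ)‖ ≤ ‖w‖ + ‖(n : ℂ)‖ := norm_add_le _ _
        _ = ‖w‖ + n := by rw [Complex.norm_natCast]
        _ ≤ ‖w‖ + (n + 1) := by linarith
    have h2 : (‖w‖ + n) ^ n ≤ (‖w‖ + (n + 1)) ^ n := by
      gcongr; linarith
    calc ‖rf w n‖ * ‖w + (n : ℂ)‖ ≤ (‖w‖ + n) ^ n * (‖w‖ + (n + 1)) :=
          mul_le_mul ih h1 (norm_nonneg _) (by positivity)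
      _ ≤ (‖w‖ + (n + 1)) ^ n * (‖w‖ + (n + 1)) := by gcongr

/-- **B5d — polynomial bound for the Gamma side.**  For real `h₁, h₂ > 0` with `h₁ + h₂ < 1 + h₀` there is `C` with
`‖Γ(1+h₀+z)Γ(1+h₀−h₁−h₂+z)/(Γ(1+h₀−h₁+z)Γ(1+h₀−h₂+z))‖ ≤ C·(1+‖z‖)^{⌊h₂⌋₊+1}` for every `z` with `Re z ≥ 0`
(write `h₂ = n + θ`: the growing ratio `Γ(q+h₂+z)/Γ(q+z)`, `q = 1+h₀−h₂`, is the block `(q+θ+z)_n` times the fractional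
ratio of `norm_Gamma_add_div_Gamma_le`; the decaying ratio `Γ(p+z)/Γ(p+h₂+z)`, `p = 1+h₀−h₁−h₂`, is bounded by
`norm_Gamma_div_Gamma_add_le`). [cite: Zudilin2004, §4 (supporting lemma)] -/
theorem gamma_side_polynomial_bound (h₀ h₁ h₂ : ℝ) (hh₁ : 0 < h₁) (hh₂ : 0 < h₂) (hsum : h₁ + h₂ < 1 + h₀) :
    ∃ C : ℝ, ∀ z : ℂ, 0 ≤ z.re →
      ‖Complex.Gamma (1 + h₀ + z) * Complex.Gamma (1 + h₀ - h₁ - h₂ + z) /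
          (Complex.Gamma (1 + h₀ - h₁ + z) * Complex.Gamma (1 + h₀ - h₂ + z))‖ ≤
        C * (1 + ‖z‖) ^ (⌊h₂⌋₊ + 1) := by
  set n : ℕ := ⌊h₂⌋₊ with hn
  set θ : ℝ := h₂ - n with hθ
  have hθ0 : 0 ≤ θ := by rw [hθ]; linarith [Nat.floor_le hh₂.le]
  have hθ1 : θ < 1 := by rw [hθ]; linarith [Nat.lt_floor_add_one h₂]
  set q : ℝ := 1 + h₀ - h₂ with hq
  set p : ℝ := 1 + h₀ - h₁ - h₂ with hp
  have hq0 : 0 < q := by rw [hq]; linarith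
  have hp0 : 0 < p := by rw [hp]; linarith
  set K₂ : ℝ := (∫ t in Ioo (0 : ℝ) 1, t ^ (p - 1) * (1 - t) ^ (h₂ - 1)) / Real.Gamma h₂ with hK₂
  set K₃ : ℝ := (∫ t in Ioo (0 : ℝ) 1, t ^ (q + θ - 1) * (1 - t) ^ ((1 - θ) - 1)) / Real.Gamma (1 - θ) with hK₃
  have hK₂0 : 0 ≤ K₂ := div_nonneg (real_betaIntegral_nonneg _ _) (Real.Gamma_pos_of_pos hh₂).le
  have hK₃0 : 0 ≤ K₃ := div_nonneg (real_betaIntegral_nonneg _ _) (Real.Gamma_pos_of_pos (by linarith)).le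
  refine ⟨(q + h₂ + 1) ^ n * ((q + 1) * K₃) * K₂, fun z hz => ?_⟩
  -- the two shifted variables
  set s₁ : ℂ := (q : ℂ) + z with hs₁
  set s₂ : ℂ := (p : ℂ) + z with hs₂
  have hs₁re : q ≤ s₁.re := by simp [hs₁]; linarith
  have hs₂re : p ≤ s₂.re := by simp [hs₂]; linarith
  have hpole : ∀ m : ℕ, s₁ + θ ≠ -(m : ℂ) := by
    intro m h
    have := congrArg Complex.re h
    simp [hs₁] at this
    linarith [m.cast_nonneg (α := ℝ)]
  -- rewrite the four Gamma arguments
  have E1 : Complex.Gamma (1 + h₀ + z) = Complex.Gamma (s₁ + θ) * rf (s₁ + θ) n := by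
    rw [← Gamma_add_nat_eq_mul_rf hpole n]
    congr 1
    rw [hs₁, hθ, hq]; push_cast; ring
  have E2 : Complex.Gamma (1 + h₀ - h₁ + z) = Complex.Gamma (s₂ + h₂) := by
    congr 1; rw [hs₂, hp]; push_cast; ring
  have E3 : Complex.Gamma (1 + h₀ - h₂ + z) = Complex.Gamma s₁ := by
    congr 1; rw [hs₁, hq]; push_cast; ring
  have E4 : Complex.Gamma (1 + h₀ - h₁ - h₂ + z) = Complex.Gamma s₂ := by
    congr 1; rw [hs₂, hp]; push_cast; ring
  rw [E1, E2, E3, E4,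
    show Complex.Gamma (s₁ + θ) * rf (s₁ + θ) n * Complex.Gamma s₂ / (Complex.Gamma (s₂ + h₂) * Complex.Gamma s₁) =
      rf (s₁ + θ) n * (Complex.Gamma (s₁ + θ) / Complex.Gamma s₁) * (Complex.Gamma s₂ / Complex.Gamma (s₂ + h₂)) by ring,
    norm_mul, norm_mul]
  -- the three bounds
  have hz1 : 0 ≤ ‖z‖ := norm_nonneg z
  have b1 : ‖rf (s₁ + θ) n‖ ≤ (q + h₂ + 1) ^ n * (1 + ‖z‖) ^ n := by
    rw [← mul_pow]
    refine (norm_rf_le _ n).trans (pow_le_pow_left₀ (by positivity) ?_ n)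
    have hsθ : s₁ + θ = (((q + θ : ℝ)) : ℂ) + z := by rw [hs₁]; push_cast; ring
    have hs : ‖s₁ + θ‖ ≤ (q + θ) + ‖z‖ := by
      calc ‖s₁ + θ‖ = ‖(((q + θ : ℝ)) : ℂ) + z‖ := by rw [hsθ]
        _ ≤ ‖(((q + θ : ℝ)) : ℂ)‖ + ‖z‖ := norm_add_le _ _
        _ = (q + θ) + ‖z‖ := by rw [Complex.norm_real, Real.norm_of_nonneg (by linarith)]
    have hnθ : (n : ℝ) + θ = h₂ := by rw [hθ]; ring
    nlinarith
  have b2 : ‖Complex.Gamma (s₁ + θ) / Complex.Gamma s₁‖ ≤ ((q + 1) * (1 + ‖z‖)) * K₃ := by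
    refine (norm_Gamma_add_div_Gamma_le hq0 hs₁re hθ0 hθ1).trans ?_
    rw [← hK₃]
    refine mul_le_mul_of_nonneg_right ?_ hK₃0
    calc ‖s₁‖ ≤ ‖(q : ℂ)‖ + ‖z‖ := norm_add_le _ _
      _ = q + ‖z‖ := by rw [Complex.norm_real, Real.norm_of_nonneg hq0.le]
      _ ≤ (q + 1) * (1 + ‖z‖) := by nlinarith
  have b3 : ‖Complex.Gamma s₂ / Complex.Gamma (s₂ + h₂)‖ ≤ K₂ := by
    rw [hK₂]; exact norm_Gamma_div_Gamma_add_le hp0 hs₂re hh₂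
  calc ‖rf (s₁ + ↑θ) n‖ * ‖Complex.Gamma (s₁ + ↑θ) / Complex.Gamma s₁‖ * ‖Complex.Gamma s₂ / Complex.Gamma (s₂ + ↑h₂)‖
      ≤ ((q + h₂ + 1) ^ n * (1 + ‖z‖) ^ n) * (((q + 1) * (1 + ‖z‖)) * K₃) * K₂ :=
        mul_le_mul (mul_le_mul b1 b2 (norm_nonneg _) (by positivity)) b3 (norm_nonneg _) (by positivity)
    _ = (q + h₂ + 1) ^ n * ((q + 1) * K₃) * K₂ * (1 + ‖z‖) ^ (n + 1) := by ring

end Literature.NumberTheory.Irrationality.Zudilin2004.DougallGammaSideBound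

end Part5

/-!
## Part 6 — port of `Summits/KontsevichZagierPeriods/Zeta5Search/DougallNonterminating.lean` (1 declarations kept)

# Dougall's non-terminating `₅F₄` sum (real parameters, Carlson range)

Declarations of this Part (verbatim port; each keeps its own docstring and citation): `dougall_nonterminating`.

Reference keys (see `references.bib` and the declarations' citations): [Bailey1935], [AndrewsAskeyRoy1999].
-/

section Part6

namespace Literature.NumberTheory.Irrationality.Zudilin2004.DougallNonterminating

open _root_.Filter _root_.Set
open scoped _root_.Topology
open Literature.NumberTheory.Irrationality.Zudilin2004.HypergeometricWhipple (rf)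
open Literature.NumberTheory.Irrationality.Zudilin2004.DougallCarlsonSides (series_side_nat differentiableOn_gamma_side)
open Literature.NumberTheory.Irrationality.Zudilin2004.DougallSeriesSide (differentiableOn_series norm_series_le)
open Literature.NumberTheory.Irrationality.Zudilin2004.DougallGammaSideBound (gamma_side_polynomial_bound)
open Literature.NumberTheory.Irrationality.Zudilin2004.DougallCoefficientBounds (summable_norm_dougallCoeff_complex)

/-- **Dougall's non-terminating `₅F₄` summation, real parameters, on the Carlson half-plane.**  For real
`h₀, h₁, h₂ > 0` with `2(h₁+h₂) < 1+h₀` and `Re z > −(1+h₀)/2`: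
`Σ_μ (h₀+2μ)Γ(h₀+μ)Γ(h₁+μ)Γ(h₂+μ)/(Γ(μ+1)Γ(h₀−h₁+1+μ)Γ(h₀−h₂+1+μ))·(−z)_μ/(h₀+1+z)_μ
 = Γ(h₁)Γ(h₂)Γ(h₀+1+z)Γ(h₀−h₁−h₂+1+z)/(Γ(h₀−h₁−h₂+1)Γ(h₀−h₁+1+z)Γ(h₀−h₂+1+z))`.
[cite: Bailey1935, §4.4 (1)] [cite: AndrewsAskeyRoy1999, §3.5, Cor. 3.5.2] -/
theorem dougall_nonterminating (h₀ h₁ h₂ : ℝ) (hh₀ : 0 < h₀) (hh₁ : 0 < h₁) (hh₂ : 0 < h₂)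
    (hsum : 2 * (h₁ + h₂) < 1 + h₀) {z : ℂ} (hz : -(1 + h₀) / 2 < z.re) :
    ∑' μ : ℕ, ((h₀ : ℂ) + 2 * μ) *
        (Complex.Gamma ((h₀ : ℂ) + μ) * Complex.Gamma ((h₁ : ℂ) + μ) * Complex.Gamma ((h₂ : ℂ) + μ)) /
          (Complex.Gamma ((μ : ℂ) + 1) * Complex.Gamma ((h₀ : ℂ) - h₁ + 1 + μ) * Complex.Gamma ((h₀ : ℂ) - h₂ + 1 + μ)) *
        (rf (-z) μ / rf ((h₀ : ℂ) + 1 + z) μ) =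
      Complex.Gamma h₁ * Complex.Gamma h₂ * Complex.Gamma ((h₀ : ℂ) + 1 + z) *
        Complex.Gamma ((h₀ : ℂ) - h₁ - h₂ + 1 + z) /
        (Complex.Gamma ((h₀ : ℂ) - h₁ - h₂ + 1) * Complex.Gamma ((h₀ : ℂ) - h₁ + 1 + z) *
          Complex.Gamma ((h₀ : ℂ) - h₂ + 1 + z)) := by
  -- the two sides as functions
  set c : ℕ → ℂ := fun μ => ((h₀ : ℂ) + 2 * μ) *
        (Complex.Gamma ((h₀ : ℂ) + μ) * Complex.Gamma ((h₁ : ℂ) + μ) * Complex.Gamma ((h₂ : ℂ) + μ)) /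
          (Complex.Gamma ((μ : ℂ) + 1) * Complex.Gamma ((h₀ : ℂ) - h₁ + 1 + μ) * Complex.Gamma ((h₀ : ℂ) - h₂ + 1 + μ))
    with hc
  set S : ℂ → ℂ := fun w => ∑' μ : ℕ, c μ * (rf (-w) μ / rf ((h₀ : ℂ) + 1 + w) μ) with hS
  set G : ℂ → ℂ := fun w => Complex.Gamma h₁ * Complex.Gamma h₂ * Complex.Gamma ((h₀ : ℂ) + 1 + w) *
        Complex.Gamma ((h₀ : ℂ) - h₁ - h₂ + 1 + w) /
        (Complex.Gamma ((h₀ : ℂ) - h₁ - h₂ + 1) * Complex.Gamma ((h₀ : ℂ) - h₁ + 1 + w) *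
          Complex.Gamma ((h₀ : ℂ) - h₂ + 1 + w)) with hG
  change S z = G z
  set U : Set ℂ := {w : ℂ | -(1 + h₀) / 2 < w.re} with hU
  have hUo : IsOpen U := isOpen_lt continuous_const Complex.continuous_re
  have hh : (-1 : ℝ) < h₀ := by linarith
  have hcs := summable_norm_dougallCoeff_complex h₀ h₁ h₂ hh₀ hh₁ hh₂ hsum
  -- holomorphy on `U`
  have hSU : DifferentiableOn ℂ S U := differentiableOn_series hh (c := c) hcs
  have hGU : DifferentiableOn ℂ G U :=
    differentiableOn_gamma_side (h₀ : ℂ) (h₁ : ℂ) (h₂ : ℂ) (c := -(1 + h₀) / 2) (by simp; linarith) (by simp; linarith)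
  -- agreement at the naturals
  have hnat : ∀ n : ℕ, S n = G n := by
    intro n
    have key := series_side_nat (h₀ : ℂ) h₁ h₂ n
      (fun m h => by have := congrArg Complex.re h; simp at this; linarith [m.cast_nonneg (α := ℝ)])
      (fun m h => by have := congrArg Complex.re h; simp at this; linarith [m.cast_nonneg (α := ℝ)])
      (fun m h => by have := congrArg Complex.re h; simp at this; linarith [m.cast_nonneg (α := ℝ)])
      (fun m h => by have := congrArg Complex.re h; simp at this; linarith [m.cast_nonneg (α := ℝ)])
      (fun m h => by have := congrArg Complex.re h; simp at this; linarith [m.cast_nonneg (α := ℝ)])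
      (fun m h => by have := congrArg Complex.re h; simp at this; linarith [m.cast_nonneg (α := ℝ)])
      (fun m h => by have := congrArg Complex.re h; simp at this; linarith [m.cast_nonneg (α := ℝ)])
    rw [show ((h₀ : ℂ) + n + 1) = (h₀ : ℂ) + 1 + n by ring] at key
    simpa [hS, hG, hc] using key
  -- the bounds on `{Re z ≥ 0}`
  obtain ⟨C, hC⟩ := gamma_side_polynomial_bound h₀ h₁ h₂ hh₁ hh₂ (by linarith)
  set N : ℕ := ⌊h₂⌋₊ + 1 with hN
  have hA0 : 0 < 1 + h₀ := by linarith
  set M : ℝ := ∑' μ : ℕ, ‖c μ‖ with hM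
  have hS_le : ∀ w : ℂ, 0 ≤ w.re → ‖S w‖ ≤ M := fun w hw =>
    norm_series_le hh hcs (by linarith)
  have hG_le : ∀ w : ℂ, 0 ≤ w.re → ‖G w‖ ≤
      ‖Complex.Gamma (h₁ : ℂ) * Complex.Gamma (h₂ : ℂ) / Complex.Gamma ((h₀ : ℂ) - h₁ - h₂ + 1)‖ * (C * (1 + ‖w‖) ^ N) := by
    intro w hw
    have h := hC w hw
    have e : G w = (Complex.Gamma (h₁ : ℂ) * Complex.Gamma (h₂ : ℂ) / Complex.Gamma ((h₀ : ℂ) - h₁ - h₂ + 1)) *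
        (Complex.Gamma (1 + h₀ + w) * Complex.Gamma (1 + h₀ - h₁ - h₂ + w) /
          (Complex.Gamma (1 + h₀ - h₁ + w) * Complex.Gamma (1 + h₀ - h₂ + w))) := by
      rw [hG]
      simp only []
      rw [show (h₀ : ℂ) + 1 + w = 1 + h₀ + w by ring, show (h₀ : ℂ) - h₁ - h₂ + 1 + w = 1 + h₀ - h₁ - h₂ + w by ring,
        show (h₀ : ℂ) - h₁ + 1 + w = 1 + h₀ - h₁ + w by ring, show (h₀ : ℂ) - h₂ + 1 + w = 1 + h₀ - h₂ + w by ring]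
      ring
    rw [e, norm_mul]
    exact mul_le_mul_of_nonneg_left h (norm_nonneg _)
  -- the Carlson function `g = (S − G)/(w + A)^N`
  set g : ℂ → ℂ := fun w => (S w - G w) / (w + ((1 + h₀ : ℝ) : ℂ)) ^ N with hg
  have hne : ∀ w ∈ U, (w : ℂ) + ((1 + h₀ : ℝ) : ℂ) ≠ 0 := by
    intro w hw h
    have := congrArg Complex.re h
    simp only [Complex.add_re, Complex.ofReal_re, Complex.zero_re] at this
    have hw' : -(1 + h₀) / 2 < w.re := hw
    linarith
  have hgU : DifferentiableOn ℂ g U := by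
    refine (hSU.sub hGU).div (by fun_prop) fun w hw => pow_ne_zero _ (hne w hw)
  have hsub : {w : ℂ | 0 ≤ w.re} ⊆ U := fun w hw => by
    have hw' : 0 ≤ w.re := hw
    show -(1 + h₀) / 2 < w.re
    linarith
  -- boundedness of `g` on the closed right half-plane
  set K₀ : ℝ := ‖Complex.Gamma (h₁ : ℂ) * Complex.Gamma (h₂ : ℂ) / Complex.Gamma ((h₀ : ℂ) - h₁ - h₂ + 1)‖ with hK₀
  have hbound : ∃ B : ℝ, ∀ w : ℂ, 0 ≤ w.re → ‖g w‖ ≤ B := by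
    refine ⟨(M + K₀ * |C|) * (2 / min 1 (1 + h₀)) ^ N, fun w hw => ?_⟩
    have hwA : (‖w‖ + (1 + h₀)) / 2 ≤ ‖w + ((1 + h₀ : ℝ) : ℂ)‖ := norm_add_pos_ge hA0 hw
    have hwA0 : 0 < ‖w + ((1 + h₀ : ℝ) : ℂ)‖ := lt_of_lt_of_le (by positivity) hwA
    have h1w : 1 ≤ 1 + ‖w‖ := by linarith [norm_nonneg w]
    have hM0 : 0 ≤ M := by rw [hM]; exact tsum_nonneg fun μ => norm_nonneg _
    rw [hg]
    simp only []
    rw [norm_div, norm_pow, div_le_iff₀ (by positivity)]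
    have hnum : ‖S w - G w‖ ≤ M + K₀ * |C| * (1 + ‖w‖) ^ N := by
      calc ‖S w - G w‖ ≤ ‖S w‖ + ‖G w‖ := norm_sub_le _ _
        _ ≤ M + K₀ * (C * (1 + ‖w‖) ^ N) := add_le_add (hS_le w hw) (hG_le w hw)
        _ ≤ M + K₀ * |C| * (1 + ‖w‖) ^ N := by
            have : C * (1 + ‖w‖) ^ N ≤ |C| * (1 + ‖w‖) ^ N :=
              mul_le_mul_of_nonneg_right (le_abs_self C) (by positivity)
            nlinarith [norm_nonneg (Complex.Gamma (h₁ : ℂ) * Complex.Gamma (h₂ : ℂ) /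
              Complex.Gamma ((h₀ : ℂ) - h₁ - h₂ + 1)), mul_le_mul_of_nonneg_left this (norm_nonneg
              (Complex.Gamma (h₁ : ℂ) * Complex.Gamma (h₂ : ℂ) / Complex.Gamma ((h₀ : ℂ) - h₁ - h₂ + 1)))]
    -- `(1 + ‖w‖) ≤ (2/m)‖w + A‖` with `m = min 1 A`
    set m : ℝ := min 1 (1 + h₀) with hm
    have hm0 : 0 < m := lt_min one_pos hA0
    have hm1 : m ≤ 1 := min_le_left _ _
    have hmA : m ≤ 1 + h₀ := min_le_right _ _
    have hκ : m * (1 + ‖w‖) ≤ 2 * ‖w + ((1 + h₀ : ℝ) : ℂ)‖ := by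
      nlinarith [mul_nonneg (sub_nonneg.2 hm1) (norm_nonneg w)]
    have hle1 : 1 + ‖w‖ ≤ 2 / m * ‖w + ((1 + h₀ : ℝ) : ℂ)‖ := by
      rw [div_mul_eq_mul_div, le_div_iff₀ hm0]; linarith
    have hpowle : (1 + ‖w‖) ^ N ≤ (2 / m) ^ N * ‖w + ((1 + h₀ : ℝ) : ℂ)‖ ^ N := by
      rw [← mul_pow]; exact pow_le_pow_left₀ (by positivity) hle1 N
    have hK0 : 0 ≤ K₀ * |C| := by positivity
    have h1N : (1 : ℝ) ≤ (1 + ‖w‖) ^ N := one_le_pow₀ h1w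
    calc ‖S w - G w‖ ≤ M + K₀ * |C| * (1 + ‖w‖) ^ N := hnum
      _ ≤ (M + K₀ * |C|) * (1 + ‖w‖) ^ N := by nlinarith
      _ ≤ (M + K₀ * |C|) * ((2 / m) ^ N * ‖w + ((1 + h₀ : ℝ) : ℂ)‖ ^ N) :=
          mul_le_mul_of_nonneg_left hpowle (by positivity)
      _ = (M + K₀ * |C|) * (2 / m) ^ N * ‖w + ((1 + h₀ : ℝ) : ℂ)‖ ^ N := by ring
  -- Carlson's theorem: `g = 0` on the closed right half-plane
  have hCarlson := Literature.Analysis.Complex.AndrewsAskeyRoy1999_thm_2_8_1_holds g ⟨U, hUo, hsub, hgU⟩ hbound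
    (fun n => by
      have h := hnat n
      simp only [hg, h, sub_self, zero_div])
  have hSG : ∀ w : ℂ, 0 ≤ w.re → S w = G w := by
    intro w hw
    have h0 := hCarlson w hw
    rw [hg] at h0
    simp only [div_eq_zero_iff, pow_eq_zero_iff', ne_eq] at h0
    rcases h0 with h0 | ⟨h0, -⟩
    · exact sub_eq_zero.1 h0
    · exact absurd h0 (hne w (hsub hw))
  -- the identity theorem on the convex half-plane `U`
  have hpre : IsPreconnected U := (convex_halfSpace_re_gt (-(1 + h₀) / 2)).isPreconnected
  have h1U : (1 : ℂ) ∈ U := by simp [hU]; linarith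
  have hev : S =ᶠ[𝓝 (1 : ℂ)] G := by
    have hopen : IsOpen {w : ℂ | 0 < w.re} := isOpen_lt continuous_const Complex.continuous_re
    exact Filter.eventually_of_mem (hopen.mem_nhds (by simp)) fun w hw => hSG w (le_of_lt hw)
  exact (hSU.analyticOnNhd hUo).eqOn_of_preconnected_of_eventuallyEq (hGU.analyticOnNhd hUo) hpre h1U hev hz

end Literature.NumberTheory.Irrationality.Zudilin2004.DougallNonterminating

end Part6

/-!
## Part 7 — port of `Summits/KontsevichZagierPeriods/Zeta5Search/DougallZudilinForm.lean` (1 declarations kept)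

# Zudilin's (9): the closed form of the very-well-poised `F₃` (Carlson range)

Declarations of this Part (verbatim port; each keeps its own docstring and citation): `zudilin_nine`.

Reference keys (see `references.bib` and the declarations' citations): [Bailey1935].
-/

section Part7

namespace Literature.NumberTheory.Irrationality.Zudilin2004.DougallZudilinForm

open _root_.Finset _root_.Filter
open Literature.NumberTheory.Irrationality.Zudilin2004.HypergeometricWhipple (rf)
open Literature.NumberTheory.Irrationality.Zudilin2004.DougallTerminatingGamma (Gamma_add_nat_eq_mul_rf rf_ne_zero)
open Literature.NumberTheory.Irrationality.Zudilin2004.DougallNonterminating (dougall_nonterminating)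

/-- **Zudilin's (9) in the Carlson range** (Dougall's non-terminating `₅F₄` sum in Gamma form): for real
`h₀, h₁, h₂, h₃ > 0` with `2(h₁+h₂) < 1+h₀` and `2h₃ < 1+h₀`,
`Σ_μ (h₀+2μ)Γ(h₀+μ)Γ(h₁+μ)Γ(h₂+μ)Γ(h₃+μ)/(Γ(μ+1)Γ(h₀−h₁+1+μ)Γ(h₀−h₂+1+μ)Γ(h₀−h₃+1+μ))
 = Γ(h₁)Γ(h₂)Γ(h₃)Γ(h₀−h₁−h₂−h₃+1)/(Γ(h₀−h₁−h₂+1)Γ(h₀−h₁−h₃+1)Γ(h₀−h₂−h₃+1))`. [cite: Bailey1935, §4.4 (1)] -/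
theorem zudilin_nine (h₀ h₁ h₂ h₃ : ℝ) (hh₀ : 0 < h₀) (hh₁ : 0 < h₁) (hh₂ : 0 < h₂) (hh₃ : 0 < h₃)
    (hsum : 2 * (h₁ + h₂) < 1 + h₀) (h3lt : 2 * h₃ < 1 + h₀) :
    ∑' μ : ℕ, ((h₀ : ℂ) + 2 * μ) *
        (Complex.Gamma ((h₀ : ℂ) + μ) * Complex.Gamma ((h₁ : ℂ) + μ) * Complex.Gamma ((h₂ : ℂ) + μ) *
          Complex.Gamma ((h₃ : ℂ) + μ)) /
        (Complex.Gamma ((μ : ℂ) + 1) * Complex.Gamma ((h₀ : ℂ) - h₁ + 1 + μ) * Complex.Gamma ((h₀ : ℂ) - h₂ + 1 + μ) *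
          Complex.Gamma ((h₀ : ℂ) - h₃ + 1 + μ)) =
      Complex.Gamma h₁ * Complex.Gamma h₂ * Complex.Gamma h₃ * Complex.Gamma ((h₀ : ℂ) - h₁ - h₂ - h₃ + 1) /
        (Complex.Gamma ((h₀ : ℂ) - h₁ - h₂ + 1) * Complex.Gamma ((h₀ : ℂ) - h₁ - h₃ + 1) *
          Complex.Gamma ((h₀ : ℂ) - h₂ - h₃ + 1)) := by
  have key := dougall_nonterminating h₀ h₁ h₂ hh₀ hh₁ hh₂ hsum (z := -(h₃ : ℂ)) (by simp; linarith)
  simp only [neg_neg] at key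
  rw [show (h₀ : ℂ) + 1 + -(h₃ : ℂ) = ((h₀ - h₃ + 1 : ℝ) : ℂ) by push_cast; ring] at key
  -- pole bookkeeping
  have H3 := ne_neg_nat_of_pos hh₃
  have HD : ∀ n : ℕ, (((h₀ - h₃ + 1 : ℝ)) : ℂ) ≠ -(n : ℂ) := ne_neg_nat_of_pos (by linarith)
  have hΓD : Complex.Gamma (((h₀ - h₃ + 1 : ℝ)) : ℂ) ≠ 0 := Complex.Gamma_ne_zero HD
  have hΓ3 : Complex.Gamma (h₃ : ℂ) ≠ 0 := Complex.Gamma_ne_zero H3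
  -- termwise: `c_μ (h₃)_μ/(h₀−h₃+1)_μ · Γ(h₃)/Γ(h₀−h₃+1) = c_μ Γ(h₃+μ)/Γ(h₀−h₃+1+μ)`
  have hterm : ∀ μ : ℕ, ((h₀ : ℂ) + 2 * μ) *
        (Complex.Gamma ((h₀ : ℂ) + μ) * Complex.Gamma ((h₁ : ℂ) + μ) * Complex.Gamma ((h₂ : ℂ) + μ) *
          Complex.Gamma ((h₃ : ℂ) + μ)) /
        (Complex.Gamma ((μ : ℂ) + 1) * Complex.Gamma ((h₀ : ℂ) - h₁ + 1 + μ) * Complex.Gamma ((h₀ : ℂ) - h₂ + 1 + μ) *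
          Complex.Gamma ((h₀ : ℂ) - h₃ + 1 + μ)) =
      (((h₀ : ℂ) + 2 * μ) *
        (Complex.Gamma ((h₀ : ℂ) + μ) * Complex.Gamma ((h₁ : ℂ) + μ) * Complex.Gamma ((h₂ : ℂ) + μ)) /
          (Complex.Gamma ((μ : ℂ) + 1) * Complex.Gamma ((h₀ : ℂ) - h₁ + 1 + μ) * Complex.Gamma ((h₀ : ℂ) - h₂ + 1 + μ)) *
        (rf (h₃ : ℂ) μ / rf (((h₀ - h₃ + 1 : ℝ)) : ℂ) μ)) *
        (Complex.Gamma (h₃ : ℂ) / Complex.Gamma (((h₀ - h₃ + 1 : ℝ)) : ℂ)) := by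
    intro μ
    have e3 : Complex.Gamma ((h₃ : ℂ) + μ) = Complex.Gamma (h₃ : ℂ) * rf (h₃ : ℂ) μ := Gamma_add_nat_eq_mul_rf H3 μ
    have eD : Complex.Gamma ((h₀ : ℂ) - h₃ + 1 + μ) = Complex.Gamma (((h₀ - h₃ + 1 : ℝ)) : ℂ) * rf (((h₀ - h₃ + 1 : ℝ)) : ℂ) μ := by
      rw [show (h₀ : ℂ) - h₃ + 1 + μ = (((h₀ - h₃ + 1 : ℝ)) : ℂ) + μ by push_cast; ring]
      exact Gamma_add_nat_eq_mul_rf HD μ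
    have hr : rf (((h₀ - h₃ + 1 : ℝ)) : ℂ) μ ≠ 0 := rf_ne_zero HD μ
    rw [e3, eD]
    field_simp
  rw [tsum_congr hterm, tsum_mul_right, key]
  have e2 : Complex.Gamma ((h₀ : ℂ) - h₁ - h₂ + 1 + -(h₃ : ℂ)) = Complex.Gamma ((h₀ : ℂ) - h₁ - h₂ - h₃ + 1) := by
    congr 1; ring
  have e4 : Complex.Gamma ((h₀ : ℂ) - h₁ + 1 + -(h₃ : ℂ)) = Complex.Gamma ((h₀ : ℂ) - h₁ - h₃ + 1) := by
    congr 1; ring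
  have e5 : Complex.Gamma ((h₀ : ℂ) - h₂ + 1 + -(h₃ : ℂ)) = Complex.Gamma ((h₀ : ℂ) - h₂ - h₃ + 1) := by
    congr 1; ring
  rw [e2, e4, e5]
  field_simp

end Literature.NumberTheory.Irrationality.Zudilin2004.DougallZudilinForm

end Part7

/-!
## Part 8 — port of `Summits/KontsevichZagierPeriods/Zeta5Search/DougallParameterHolomorphy.lean` (3 declarations kept)

# The series of Zudilin's (9) is holomorphic in the parameter `h₁`

Declarations of this Part (verbatim port; each keeps its own docstring and citation): `prod_re_le_norm_rf`, `norm_inv_Gamma_sub_add_nat_le`, `differentiableOn_series`.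

Reference keys (see `references.bib` and the declarations' citations): [Zudilin2004].
-/

section Part8

namespace Literature.NumberTheory.Irrationality.Zudilin2004.DougallParameterHolomorphy

open _root_.Finset _root_.Filter _root_.Set _root_.Metric
open Literature.NumberTheory.Irrationality.Zudilin2004.HypergeometricWhipple (rf rf_zero rf_succ)
open Literature.NumberTheory.Irrationality.Zudilin2004.DougallTerminatingGamma (Gamma_add_nat_eq_mul_rf rf_ne_zero)
open Literature.NumberTheory.Irrationality.Zudilin2004.DougallCoefficientBounds (Gamma_add_nat_eq Gamma_ratio_le
  dougallCoeff_le dougallCoeff_complex)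

/-- `∏_{i<μ} (Re z + i) ≤ ‖(z)_μ‖` for `Re z ≥ 0`. [cite: Zudilin2004, §4 (supporting lemma)] -/
theorem prod_re_le_norm_rf (z : ℂ) (hz : 0 ≤ z.re) (μ : ℕ) : ∏ i ∈ range μ, (z.re + i) ≤ ‖rf z μ‖ := by
  unfold rf
  rw [norm_prod]
  refine Finset.prod_le_prod (fun i _ => by positivity) fun i _ => ?_
  calc z.re + i = (z + i).re := by simp
    _ ≤ |(z + i).re| := le_abs_self _
    _ ≤ ‖z + (i : ℂ)‖ := Complex.abs_re_le_norm _

/-- `‖Γ(h₀+1−w+μ)⁻¹‖ ≤ ‖Γ(h₀+1−w)⁻¹‖ / ∏_{i<μ} (h₀+1−Re w+i)` for `Re w < h₀+1`.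
[cite: Zudilin2004, §4 (supporting lemma)] -/
theorem norm_inv_Gamma_sub_add_nat_le (h₀ : ℝ) {w : ℂ} (hw : w.re < h₀ + 1) (μ : ℕ) :
    ‖(Complex.Gamma ((h₀ : ℂ) - w + 1 + μ))⁻¹‖ ≤
      ‖(Complex.Gamma ((h₀ : ℂ) - w + 1))⁻¹‖ / ∏ i ∈ range μ, (h₀ - w.re + 1 + i) := by
  have hre : 0 < ((h₀ : ℂ) - w + 1).re := by simp; linarith
  have hne : ∀ n : ℕ, ((h₀ : ℂ) - w + 1) ≠ -(n : ℂ) := by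
    intro n h
    have := congrArg Complex.re h
    simp at this
    linarith [n.cast_nonneg (α := ℝ)]
  have hprod : ∏ i ∈ range μ, (h₀ - w.re + 1 + i) ≤ ‖rf ((h₀ : ℂ) - w + 1) μ‖ := by
    have := prod_re_le_norm_rf ((h₀ : ℂ) - w + 1) hre.le μ
    simpa using this
  have hpos : 0 < ∏ i ∈ range μ, (h₀ - w.re + 1 + i) :=
    Finset.prod_pos fun i _ => by linarith [i.cast_nonneg (α := ℝ)]
  rw [Gamma_add_nat_eq_mul_rf hne μ, mul_inv, norm_mul, norm_inv (rf _ _), ← div_eq_mul_inv]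
  exact div_le_div_of_nonneg_left (norm_nonneg _) hpos hprod

/-- **The series of (9) is holomorphic in `w = h₁`** on `D = {0 < Re w < 1+h₀−h₂−h₃}` (real `h₀, h₂, h₃ > 0`):
locally uniform convergence by the Weierstrass M-test against the real four-Gamma term
(`summable_fourGamma`), using `‖Γ(w+μ)‖ ≤ Γ(Re w+μ)` and `‖(h₀+1−w)_μ‖ ≥ (h₀+1−Re w)_μ`.
[cite: Zudilin2004, §4 (supporting lemma)] -/
theorem differentiableOn_series (h₀ h₂ h₃ : ℝ) (hh₀ : 0 < h₀) (hh₂ : 0 < h₂) (hh₃ : 0 < h₃) :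
    DifferentiableOn ℂ (fun w : ℂ => ∑' μ : ℕ, ((h₀ : ℂ) + 2 * μ) *
        (Complex.Gamma ((h₀ : ℂ) + μ) * Complex.Gamma (w + μ) * Complex.Gamma ((h₂ : ℂ) + μ) *
          Complex.Gamma ((h₃ : ℂ) + μ)) /
        (Complex.Gamma ((μ : ℂ) + 1) * Complex.Gamma ((h₀ : ℂ) - w + 1 + μ) * Complex.Gamma ((h₀ : ℂ) - h₂ + 1 + μ) *
          Complex.Gamma ((h₀ : ℂ) - h₃ + 1 + μ)))
      {w : ℂ | 0 < w.re ∧ w.re < 1 + h₀ - h₂ - h₃} := by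
  intro w₀ hw₀
  obtain ⟨hx₀, hx₀'⟩ := hw₀
  -- a ball around `w₀` whose real parts stay in `[xl, xu] ⊂ (0, 1+h₀−h₂−h₃)`
  set δ : ℝ := min (w₀.re / 2) ((1 + h₀ - h₂ - h₃ - w₀.re) / 2) with hδ
  have hδpos : 0 < δ := lt_min (by linarith) (by linarith)
  have hδ1 : δ ≤ w₀.re / 2 := min_le_left _ _
  have hδ2 : δ ≤ (1 + h₀ - h₂ - h₃ - w₀.re) / 2 := min_le_right _ _
  set xl : ℝ := w₀.re - δ with hxl
  set xu : ℝ := w₀.re + δ with hxu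
  have hxl0 : 0 < xl := by rw [hxl]; linarith
  have hxu1 : xu + h₂ + h₃ < 1 + h₀ := by rw [hxu]; linarith
  have hre : ∀ w ∈ ball w₀ δ, xl < w.re ∧ w.re < xu := by
    intro w hw
    rw [mem_ball, dist_eq_norm] at hw
    have h1 := Complex.abs_re_le_norm (w - w₀)
    simp only [Complex.sub_re] at h1
    have h2 := abs_lt.1 (lt_of_le_of_lt h1 hw)
    constructor
    · rw [hxl]; linarith [h2.1]
    · rw [hxu]; linarith [h2.2]
  -- `MΓ` bounds `Γ` on `[xl, xu]`; `Mw` bounds `‖Γ(h₀+1−w)⁻¹‖` on the closed ball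
  obtain ⟨MΓ, hMΓ⟩ : ∃ M : ℝ, ∀ x ∈ Icc xl xu, Real.Gamma x ≤ M := by
    have hc : ContinuousOn Real.Gamma (Icc xl xu) := fun x hx =>
      (Real.differentiableAt_Gamma fun m => by
        have : 0 < x := lt_of_lt_of_le hxl0 hx.1
        intro h; rw [h] at this
        have := m.cast_nonneg (α := ℝ); linarith).continuousAt.continuousWithinAt
    obtain ⟨M, hM⟩ := isCompact_Icc.exists_bound_of_continuousOn hc
    exact ⟨M, fun x hx => (le_abs_self _).trans (by simpa [Real.norm_eq_abs] using hM x hx)⟩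
  have hMΓ0 : 0 ≤ MΓ :=
    (Real.Gamma_pos_of_pos (show 0 < w₀.re from hx₀)).le.trans (hMΓ w₀.re ⟨by rw [hxl]; linarith, by rw [hxu]; linarith⟩)
  obtain ⟨Mw, hMw⟩ : ∃ M : ℝ, ∀ w ∈ closedBall w₀ δ, ‖(Complex.Gamma ((h₀ : ℂ) - w + 1))⁻¹‖ ≤ M := by
    have hd : Differentiable ℂ fun w : ℂ => (h₀ : ℂ) - w + 1 := by fun_prop
    have hc : Continuous fun w : ℂ => (Complex.Gamma ((h₀ : ℂ) - w + 1))⁻¹ :=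
      (Complex.differentiable_one_div_Gamma.comp hd).continuous
    obtain ⟨M, hM⟩ := (isCompact_closedBall w₀ δ).exists_bound_of_continuousOn hc.continuousOn
    exact ⟨M, hM⟩
  have hMw0 : 0 ≤ Mw := (norm_nonneg _).trans (hMw w₀ (mem_closedBall_self hδpos.le))
  -- the majorant
  set A : ℕ → ℝ := fun μ => (h₀ + 2 * μ) * (Real.Gamma (h₀ + μ) * Real.Gamma (h₂ + μ) * Real.Gamma (h₃ + μ)) /
      (Real.Gamma ((μ : ℝ) + 1) * Real.Gamma (h₀ - h₂ + 1 + μ) * Real.Gamma (h₀ - h₃ + 1 + μ)) with hA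
  have hAnn : ∀ μ : ℕ, 0 ≤ A μ := by
    intro μ
    have := Real.Gamma_pos_of_pos (show 0 < h₀ - h₂ + 1 + μ by linarith [μ.cast_nonneg (α := ℝ)])
    have := Real.Gamma_pos_of_pos (show 0 < h₀ - h₃ + 1 + μ by linarith [μ.cast_nonneg (α := ℝ)])
    rw [hA]
    exact div_nonneg (by positivity) (by positivity)
  set u : ℕ → ℝ := fun μ => A μ * ((MΓ * ∏ i ∈ range μ, (xu + i)) *
      (Mw / ∏ i ∈ range μ, (h₀ - xu + 1 + i))) with hu
  have hsum : Summable u := by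
    have h4 := (summable_fourGamma h₀ xu h₂ h₃ hh₀ (by linarith) hh₂ hh₃ (by linarith)).mul_left
      (MΓ * Mw * Real.Gamma (h₀ - xu + 1) / Real.Gamma xu)
    refine h4.congr fun μ => ?_
    have hΓxu : Real.Gamma xu ≠ 0 := (Real.Gamma_pos_of_pos (by linarith)).ne'
    have hΓxu' : Real.Gamma (h₀ - xu + 1) ≠ 0 := (Real.Gamma_pos_of_pos (by linarith)).ne'
    have hP : ∏ i ∈ range μ, (h₀ - xu + 1 + i) ≠ 0 :=
      (Finset.prod_pos fun i _ => by linarith [i.cast_nonneg (α := ℝ)]).ne'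
    rw [hu, hA]
    simp only
    rw [Gamma_add_nat_eq xu (by linarith) μ, Gamma_add_nat_eq (h₀ - xu + 1) (by linarith) μ]
    field_simp
  -- the M-test on the ball
  have hdiff : DifferentiableOn ℂ (fun w : ℂ => ∑' μ : ℕ, ((h₀ : ℂ) + 2 * μ) *
        (Complex.Gamma ((h₀ : ℂ) + μ) * Complex.Gamma (w + μ) * Complex.Gamma ((h₂ : ℂ) + μ) *
          Complex.Gamma ((h₃ : ℂ) + μ)) /
        (Complex.Gamma ((μ : ℂ) + 1) * Complex.Gamma ((h₀ : ℂ) - w + 1 + μ) * Complex.Gamma ((h₀ : ℂ) - h₂ + 1 + μ) *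
          Complex.Gamma ((h₀ : ℂ) - h₃ + 1 + μ))) (ball w₀ δ) := by
    refine Complex.differentiableOn_tsum_of_summable_norm hsum (fun μ w hw => ?_) isOpen_ball (fun μ w hw => ?_)
    · obtain ⟨h1, h2⟩ := hre w hw
      exact (differentiableAt_term h₀ h₂ h₃ (by linarith) (by linarith) μ (by linarith)
        (by linarith)).differentiableWithinAt
    · obtain ⟨h1, h2⟩ := hre w hw
      have hwpos : 0 < w.re := by linarith
      have G2' := Real.Gamma_pos_of_pos (show 0 < h₀ - h₂ + 1 + μ by linarith [μ.cast_nonneg (α := ℝ)])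
      have G3' := Real.Gamma_pos_of_pos (show 0 < h₀ - h₃ + 1 + μ by linarith [μ.cast_nonneg (α := ℝ)])
      -- split off the real coefficient
      have eT : ((h₀ : ℂ) + 2 * μ) *
          (Complex.Gamma ((h₀ : ℂ) + μ) * Complex.Gamma (w + μ) * Complex.Gamma ((h₂ : ℂ) + μ) *
            Complex.Gamma ((h₃ : ℂ) + μ)) /
          (Complex.Gamma ((μ : ℂ) + 1) * Complex.Gamma ((h₀ : ℂ) - w + 1 + μ) * Complex.Gamma ((h₀ : ℂ) - h₂ + 1 + μ) *
            Complex.Gamma ((h₀ : ℂ) - h₃ + 1 + μ)) =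
        (((h₀ : ℂ) + 2 * μ) * (Complex.Gamma ((h₀ : ℂ) + μ) * Complex.Gamma ((h₂ : ℂ) + μ) * Complex.Gamma ((h₃ : ℂ) + μ)) /
          (Complex.Gamma ((μ : ℂ) + 1) * Complex.Gamma ((h₀ : ℂ) - h₂ + 1 + μ) * Complex.Gamma ((h₀ : ℂ) - h₃ + 1 + μ))) *
          (Complex.Gamma (w + μ) * (Complex.Gamma ((h₀ : ℂ) - w + 1 + μ))⁻¹) := by
        rw [div_eq_mul_inv, div_eq_mul_inv]
        ring
      rw [eT, dougallCoeff_complex h₀ h₂ h₃ μ, norm_mul, Complex.norm_real, Real.norm_of_nonneg (hAnn μ), norm_mul]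
      -- the two complex factors
      have b1 : ‖Complex.Gamma (w + μ)‖ ≤ MΓ * ∏ i ∈ range μ, (xu + i) := by
        refine (norm_Gamma_add_nat_le hwpos μ).trans ?_
        refine mul_le_mul (hMΓ w.re ⟨h1.le, h2.le⟩) (Finset.prod_le_prod (fun i _ => by positivity)
          fun i _ => by linarith) (Finset.prod_nonneg fun i _ => by positivity) hMΓ0
      have hPu : 0 < ∏ i ∈ range μ, (h₀ - xu + 1 + i) :=
        Finset.prod_pos fun i _ => by linarith [i.cast_nonneg (α := ℝ)]
      have b2 : ‖(Complex.Gamma ((h₀ : ℂ) - w + 1 + μ))⁻¹‖ ≤ Mw / ∏ i ∈ range μ, (h₀ - xu + 1 + i) := by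
        refine (norm_inv_Gamma_sub_add_nat_le h₀ (by linarith) μ).trans ?_
        exact div_le_div₀ hMw0 (hMw w (ball_subset_closedBall hw)) hPu
          (Finset.prod_le_prod (fun i _ => by linarith [i.cast_nonneg (α := ℝ)]) fun i _ => by linarith)
      rw [hu]
      exact mul_le_mul_of_nonneg_left (mul_le_mul b1 b2 (norm_nonneg _)
        (mul_nonneg hMΓ0 (Finset.prod_nonneg fun i _ => by positivity))) (hAnn μ)
  exact (hdiff.differentiableAt (isOpen_ball.mem_nhds (mem_ball_self hδpos))).differentiableWithinAt

end Literature.NumberTheory.Irrationality.Zudilin2004.DougallParameterHolomorphy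

end Part8

/-!
## Part 9 — port of `Summits/KontsevichZagierPeriods/Zeta5Search/DougallFullRange.lean` (2 declarations kept)

# Zudilin's (9) and the case `k = 1` of his theorem on the full positive range

Declarations of this Part (verbatim port; each keeps its own docstring and citation): `zudilin_nine_of_lt`, `zudilin_nine'`.

Reference keys (see `references.bib` and the declarations' citations): [Zudilin2004].
-/

section Part9

namespace Literature.NumberTheory.Irrationality.Zudilin2004.DougallFullRange

open _root_.Finset _root_.Filter _root_.Set _root_.Metric
open Literature.NumberTheory.Irrationality.Zudilin2004.DougallZudilinForm (zudilin_nine)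
open Literature.NumberTheory.Irrationality.Zudilin2004.DougallParameterHolomorphy (differentiableOn_series)
open Literature.NumberTheory.Irrationality.Zudilin2002 (vwpSeries sorokinIntegral)

/-- **(9) beyond the Carlson range by continuation in `h₁`**: for real `h₀, h₂, h₃ > 0` with `2h₂ < 1+h₀`, `2h₃ < 1+h₀`
and every real `h₁ > 0` with `h₁+h₂+h₃ < 1+h₀`, Zudilin's (9) holds.  Both sides are holomorphic in `w = h₁` on the convex
domain `D = {0 < Re w < 1+h₀−h₂−h₃}` and agree at the real points `0 < w < min(1+h₀−h₂−h₃, (1+h₀)/2−h₂)` by `zudilin_nine`.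
[cite: Zudilin2004, §4 (supporting lemma)] -/
theorem zudilin_nine_of_lt (h₀ h₂ h₃ : ℝ) (hh₀ : 0 < h₀) (hh₂ : 0 < h₂) (hh₃ : 0 < h₃) (h2lt : 2 * h₂ < 1 + h₀)
    (h3lt : 2 * h₃ < 1 + h₀) (h₁ : ℝ) (hh₁ : 0 < h₁) (hs : h₁ + h₂ + h₃ < 1 + h₀) :
    ∑' μ : ℕ, ((h₀ : ℂ) + 2 * μ) *
        (Complex.Gamma ((h₀ : ℂ) + μ) * Complex.Gamma ((h₁ : ℂ) + μ) * Complex.Gamma ((h₂ : ℂ) + μ) *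
          Complex.Gamma ((h₃ : ℂ) + μ)) /
        (Complex.Gamma ((μ : ℂ) + 1) * Complex.Gamma ((h₀ : ℂ) - h₁ + 1 + μ) * Complex.Gamma ((h₀ : ℂ) - h₂ + 1 + μ) *
          Complex.Gamma ((h₀ : ℂ) - h₃ + 1 + μ)) =
      Complex.Gamma h₁ * Complex.Gamma h₂ * Complex.Gamma h₃ * Complex.Gamma ((h₀ : ℂ) - h₁ - h₂ - h₃ + 1) /
        (Complex.Gamma ((h₀ : ℂ) - h₁ - h₂ + 1) * Complex.Gamma ((h₀ : ℂ) - h₁ - h₃ + 1) *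
          Complex.Gamma ((h₀ : ℂ) - h₂ - h₃ + 1)) := by
  set S : ℂ → ℂ := fun w : ℂ => ∑' μ : ℕ, ((h₀ : ℂ) + 2 * μ) *
        (Complex.Gamma ((h₀ : ℂ) + μ) * Complex.Gamma (w + μ) * Complex.Gamma ((h₂ : ℂ) + μ) *
          Complex.Gamma ((h₃ : ℂ) + μ)) /
        (Complex.Gamma ((μ : ℂ) + 1) * Complex.Gamma ((h₀ : ℂ) - w + 1 + μ) * Complex.Gamma ((h₀ : ℂ) - h₂ + 1 + μ) *
          Complex.Gamma ((h₀ : ℂ) - h₃ + 1 + μ)) with hS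
  set G : ℂ → ℂ := fun w : ℂ => Complex.Gamma w * Complex.Gamma h₂ * Complex.Gamma h₃ *
        Complex.Gamma ((h₀ : ℂ) - w - h₂ - h₃ + 1) /
        (Complex.Gamma ((h₀ : ℂ) - w - h₂ + 1) * Complex.Gamma ((h₀ : ℂ) - w - h₃ + 1) *
          Complex.Gamma ((h₀ : ℂ) - h₂ - h₃ + 1)) with hG
  set D : Set ℂ := {w : ℂ | 0 < w.re ∧ w.re < 1 + h₀ - h₂ - h₃} with hD
  set c' : ℝ := min (1 + h₀ - h₂ - h₃) ((1 + h₀) / 2 - h₂) with hc'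
  have hc'pos : 0 < c' := lt_min (by linarith) (by linarith)
  have hc'1 : c' ≤ 1 + h₀ - h₂ - h₃ := min_le_left _ _
  have hc'2 : c' ≤ (1 + h₀) / 2 - h₂ := min_le_right _ _
  set D' : Set ℂ := {w : ℂ | 0 < w.re ∧ w.re < c'} with hD'
  have hSD : DifferentiableOn ℂ S D := differentiableOn_series h₀ h₂ h₃ hh₀ hh₂ hh₃
  have hGD : DifferentiableOn ℂ G D := differentiableOn_gammaSide h₀ h₂ h₃ hh₂ hh₃
  have hsub : D' ⊆ D := fun w hw => ⟨hw.1, lt_of_lt_of_le hw.2 hc'1⟩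
  have hDo : IsOpen D :=
    (isOpen_lt continuous_const Complex.continuous_re).inter (isOpen_lt Complex.continuous_re continuous_const)
  have hD'o : IsOpen D' :=
    (isOpen_lt continuous_const Complex.continuous_re).inter (isOpen_lt Complex.continuous_re continuous_const)
  have hDc : IsPreconnected D := ((convex_halfSpace_re_gt 0).inter (convex_halfSpace_re_lt _)).isPreconnected
  have hD'c : IsPreconnected D' := ((convex_halfSpace_re_gt 0).inter (convex_halfSpace_re_lt _)).isPreconnected
  have hx₀' : ((c' / 2 : ℝ) : ℂ) ∈ D' := ⟨by simp; linarith, by simp; linarith⟩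
  -- agreement on `D'` from the real points (Carlson range)
  have hEq' : EqOn S G D' := by
    refine Literature.Analysis.Complex.eqOn_of_isPreconnected_of_eq_ofReal hD'o hD'c hx₀' (hSD.mono hsub)
      (hGD.mono hsub) fun t ht => ?_
    obtain ⟨ht0, ht1⟩ := ht
    simp only [Complex.ofReal_re] at ht0 ht1
    exact zudilin_nine h₀ t h₂ h₃ hh₀ ht0 hh₂ hh₃ (by linarith) h3lt
  -- continuation to `D`
  have hEq : EqOn S G D :=
    (hSD.analyticOnNhd hDo).eqOn_of_preconnected_of_eventuallyEq (hGD.analyticOnNhd hDo) hDc (hsub hx₀')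
      (Filter.eventuallyEq_of_mem (hD'o.mem_nhds hx₀') hEq')
  exact hEq (show ((h₁ : ℝ) : ℂ) ∈ D from ⟨by simp; linarith, by simp; linarith⟩)

/-- **Zudilin's (9) = Dougall's `₅F₄` sum in Gamma form on the full positive range**: for real
`h₀, h₁, h₂, h₃ > 0` with `h₁+h₂+h₃ < 1+h₀`,
`Σ_μ (h₀+2μ)Γ(h₀+μ)Γ(h₁+μ)Γ(h₂+μ)Γ(h₃+μ)/(Γ(μ+1)Γ(h₀−h₁+1+μ)Γ(h₀−h₂+1+μ)Γ(h₀−h₃+1+μ))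
 = Γ(h₁)Γ(h₂)Γ(h₃)Γ(h₀−h₁−h₂−h₃+1)/(Γ(h₀−h₁−h₂+1)Γ(h₀−h₁−h₃+1)Γ(h₀−h₂−h₃+1))`
(at most one of `h₁, h₂, h₃` reaches `(1+h₀)/2`; continue in that slot). [cite: Bailey1935, §4.4 (1)] -/
theorem zudilin_nine' (h₀ h₁ h₂ h₃ : ℝ) (hh₀ : 0 < h₀) (hh₁ : 0 < h₁) (hh₂ : 0 < h₂) (hh₃ : 0 < h₃)
    (hs : h₁ + h₂ + h₃ < 1 + h₀) :
    ∑' μ : ℕ, ((h₀ : ℂ) + 2 * μ) *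
        (Complex.Gamma ((h₀ : ℂ) + μ) * Complex.Gamma ((h₁ : ℂ) + μ) * Complex.Gamma ((h₂ : ℂ) + μ) *
          Complex.Gamma ((h₃ : ℂ) + μ)) /
        (Complex.Gamma ((μ : ℂ) + 1) * Complex.Gamma ((h₀ : ℂ) - h₁ + 1 + μ) * Complex.Gamma ((h₀ : ℂ) - h₂ + 1 + μ) *
          Complex.Gamma ((h₀ : ℂ) - h₃ + 1 + μ)) =
      Complex.Gamma h₁ * Complex.Gamma h₂ * Complex.Gamma h₃ * Complex.Gamma ((h₀ : ℂ) - h₁ - h₂ - h₃ + 1) /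
        (Complex.Gamma ((h₀ : ℂ) - h₁ - h₂ + 1) * Complex.Gamma ((h₀ : ℂ) - h₁ - h₃ + 1) *
          Complex.Gamma ((h₀ : ℂ) - h₂ - h₃ + 1)) := by
  by_cases H2 : 2 * h₂ < 1 + h₀
  · by_cases H3 : 2 * h₃ < 1 + h₀
    · exact zudilin_nine_of_lt h₀ h₂ h₃ hh₀ hh₂ hh₃ H2 H3 h₁ hh₁ hs
    · rw [not_lt] at H3
      have H1 : 2 * h₁ < 1 + h₀ := by linarith
      have key := zudilin_nine_of_lt h₀ h₂ h₁ hh₀ hh₂ hh₁ H2 H1 h₃ hh₃ (by linarith)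
      convert key using 1
      · exact tsum_congr fun μ => by ring
      · ring_nf
  · rw [not_lt] at H2
    have H1 : 2 * h₁ < 1 + h₀ := by linarith
    have H3 : 2 * h₃ < 1 + h₀ := by linarith
    have key := zudilin_nine_of_lt h₀ h₁ h₃ hh₀ hh₁ hh₃ H1 H3 h₂ hh₂ (by linarith)
    convert key using 1
    · exact tsum_congr fun μ => by ring
    · ring_nf

end Literature.NumberTheory.Irrationality.Zudilin2004.DougallFullRange

end Part9

/-!
## Part 10 — port of `Summits/KontsevichZagierPeriods/Zeta5Search/DougallComplexParameters.lean` (3 declarations kept)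

# The series of Zudilin's (9) with complex co-parameters: estimates and holomorphy in one slot

Declarations of this Part (verbatim port; each keeps its own docstring and citation): `norm_inv_Gamma_add_nat_le`, `norm_coeff_le`, `differentiableOn_series_cparam`.

Reference keys (see `references.bib` and the declarations' citations): [Zudilin2004].
-/

section Part10

namespace Literature.NumberTheory.Irrationality.Zudilin2004.DougallComplexParameters

open _root_.Finset _root_.Filter _root_.Set _root_.Metric
open Literature.NumberTheory.Irrationality.Zudilin2004.HypergeometricWhipple (rf rf_zero rf_succ)
open Literature.NumberTheory.Irrationality.Zudilin2004.DougallTerminatingGamma (Gamma_add_nat_eq_mul_rf rf_ne_zero)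
open Literature.NumberTheory.Irrationality.Zudilin2004.DougallCoefficientBounds (Gamma_add_nat_eq)
open Literature.NumberTheory.Irrationality.Zudilin2004.DougallParameterHolomorphy (summable_fourGamma prod_re_le_norm_rf
  norm_Gamma_add_nat_le)
open Literature.NumberTheory.Irrationality.BrownZudilin2022.BarnesMellin (ne_neg_nat_of_re_pos)
open Literature.NumberTheory.LFunctions (norm_Gamma_le_Gamma_re)

/-- `‖Γ(ζ+μ)⁻¹‖ ≤ ‖Γ(ζ)⁻¹‖ / ∏_{i<μ} (Re ζ + i)` for `Re ζ > 0`. [cite: Zudilin2004, §4 (supporting lemma)] -/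
theorem norm_inv_Gamma_add_nat_le {ζ : ℂ} (hζ : 0 < ζ.re) (μ : ℕ) :
    ‖(Complex.Gamma (ζ + μ))⁻¹‖ ≤ ‖(Complex.Gamma ζ)⁻¹‖ / ∏ i ∈ range μ, (ζ.re + i) := by
  have hpos : 0 < ∏ i ∈ range μ, (ζ.re + i) := Finset.prod_pos fun i _ => by positivity
  rw [Gamma_add_nat_eq_mul_rf (ne_neg_nat_of_re_pos hζ) μ, mul_inv, norm_mul, norm_inv (rf _ _), ← div_eq_mul_inv]
  exact div_le_div_of_nonneg_left (norm_nonneg _) hpos (prod_re_le_norm_rf ζ hζ.le μ)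

/-- **The three-Gamma coefficient at complex parameters against the real one**: for `Re h₀, Re h₂, Re h₃ > 0` and
`Re h₂, Re h₃ < Re h₀ + 1`,
`‖(h₀+2μ)Γ(h₀+μ)Γ(h₂+μ)Γ(h₃+μ)/(Γ(μ+1)Γ(h₀−h₂+1+μ)Γ(h₀−h₃+1+μ))‖
 ≤ K(x₀+2μ)Γ(x₀+μ)Γ(x₂+μ)Γ(x₃+μ)/(Γ(μ+1)·‖Γ(h₀−h₂+1)‖(x₀−x₂+1)_μ·‖Γ(h₀−h₃+1)‖(x₀−x₃+1)_μ)`, `x = Re h`, `K = max(1,‖h₀‖/x₀)`.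
[cite: Zudilin2004, §4 (supporting lemma)] -/
theorem norm_coeff_le (h₀ h₂ h₃ : ℂ) (hx₀ : 0 < h₀.re) (hx₂ : 0 < h₂.re) (hx₃ : 0 < h₃.re)
    (h2' : h₂.re < h₀.re + 1) (h3' : h₃.re < h₀.re + 1) (μ : ℕ) :
    ‖(h₀ + 2 * μ) * (Complex.Gamma (h₀ + μ) * Complex.Gamma (h₂ + μ) * Complex.Gamma (h₃ + μ)) /
        (Complex.Gamma ((μ : ℂ) + 1) * Complex.Gamma (h₀ - h₂ + 1 + μ) * Complex.Gamma (h₀ - h₃ + 1 + μ))‖ ≤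
      (max 1 (‖h₀‖ / h₀.re) * (h₀.re + 2 * μ) *
          (Real.Gamma (h₀.re + μ) * Real.Gamma (h₂.re + μ) * Real.Gamma (h₃.re + μ))) /
        (Real.Gamma ((μ : ℝ) + 1) * (‖Complex.Gamma (h₀ - h₂ + 1)‖ * ∏ i ∈ range μ, (h₀.re - h₂.re + 1 + i)) *
          (‖Complex.Gamma (h₀ - h₃ + 1)‖ * ∏ i ∈ range μ, (h₀.re - h₃.re + 1 + i))) := by
  have hζ₂ : 0 < (h₀ - h₂ + 1).re := by simp; linarith
  have hζ₃ : 0 < (h₀ - h₃ + 1).re := by simp; linarith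
  -- numerator
  have e0 : ‖Complex.Gamma (h₀ + μ)‖ ≤ Real.Gamma (h₀.re + μ) := by
    simpa using norm_Gamma_le_Gamma_re (s := h₀ + μ) (by simp; positivity)
  have e2 : ‖Complex.Gamma (h₂ + μ)‖ ≤ Real.Gamma (h₂.re + μ) := by
    simpa using norm_Gamma_le_Gamma_re (s := h₂ + μ) (by simp; positivity)
  have e3 : ‖Complex.Gamma (h₃ + μ)‖ ≤ Real.Gamma (h₃.re + μ) := by
    simpa using norm_Gamma_le_Gamma_re (s := h₃ + μ) (by simp; positivity)
  have G0 := Real.Gamma_pos_of_pos (show 0 < h₀.re + μ by positivity)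
  have G2 := Real.Gamma_pos_of_pos (show 0 < h₂.re + μ by positivity)
  have hN : ‖(h₀ + 2 * μ) * (Complex.Gamma (h₀ + μ) * Complex.Gamma (h₂ + μ) * Complex.Gamma (h₃ + μ))‖ ≤
      max 1 (‖h₀‖ / h₀.re) * (h₀.re + 2 * μ) *
        (Real.Gamma (h₀.re + μ) * Real.Gamma (h₂.re + μ) * Real.Gamma (h₃.re + μ)) := by
    rw [norm_mul, norm_mul, norm_mul]
    refine mul_le_mul (norm_add_two_mul_le h₀ hx₀ μ) ?_ (by positivity) (by positivity)
    exact mul_le_mul (mul_le_mul e0 e2 (norm_nonneg _) G0.le) e3 (norm_nonneg _) (by positivity)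
  -- denominator
  have d1 : ‖Complex.Gamma ((μ : ℂ) + 1)‖ = Real.Gamma ((μ : ℝ) + 1) := by
    rw [Complex.Gamma_nat_eq_factorial, Real.Gamma_nat_eq_factorial, Complex.norm_natCast]
  have dζ : ∀ {ζ : ℂ}, 0 < ζ.re →
      ‖Complex.Gamma ζ‖ * ∏ i ∈ range μ, (ζ.re + i) ≤ ‖Complex.Gamma (ζ + μ)‖ := by
    intro ζ hζ
    rw [Gamma_add_nat_eq_mul_rf (ne_neg_nat_of_re_pos hζ) μ, norm_mul]
    exact mul_le_mul_of_nonneg_left (prod_re_le_norm_rf ζ hζ.le μ) (norm_nonneg _)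
  have d2 := dζ hζ₂
  have d3 := dζ hζ₃
  simp only [Complex.add_re, Complex.sub_re, Complex.one_re] at d2 d3
  have P2 : 0 < ∏ i ∈ range μ, (h₀.re - h₂.re + 1 + i) := Finset.prod_pos fun i _ => by linarith [i.cast_nonneg (α := ℝ)]
  have P3 : 0 < ∏ i ∈ range μ, (h₀.re - h₃.re + 1 + i) := Finset.prod_pos fun i _ => by linarith [i.cast_nonneg (α := ℝ)]
  have nζ₂ : 0 < ‖Complex.Gamma (h₀ - h₂ + 1)‖ := norm_pos_iff.2 (Complex.Gamma_ne_zero (ne_neg_nat_of_re_pos hζ₂))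
  have nζ₃ : 0 < ‖Complex.Gamma (h₀ - h₃ + 1)‖ := norm_pos_iff.2 (Complex.Gamma_ne_zero (ne_neg_nat_of_re_pos hζ₃))
  have G1 := Real.Gamma_pos_of_pos (show 0 < (μ : ℝ) + 1 by positivity)
  have hD : Real.Gamma ((μ : ℝ) + 1) * (‖Complex.Gamma (h₀ - h₂ + 1)‖ * ∏ i ∈ range μ, (h₀.re - h₂.re + 1 + i)) *
      (‖Complex.Gamma (h₀ - h₃ + 1)‖ * ∏ i ∈ range μ, (h₀.re - h₃.re + 1 + i)) ≤
      ‖Complex.Gamma ((μ : ℂ) + 1) * Complex.Gamma (h₀ - h₂ + 1 + μ) * Complex.Gamma (h₀ - h₃ + 1 + μ)‖ := by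
    rw [norm_mul, norm_mul, d1]
    exact mul_le_mul (mul_le_mul_of_nonneg_left d2 G1.le) d3 (by positivity) (by positivity)
  rw [norm_div]
  exact div_le_div₀ (by positivity) hN (by positivity) hD

/-- **Holomorphy of the series of (9) in `w = h₁` with complex co-parameters** `h₀, h₂, h₃` (`Re > 0`) on
`D = {0 < Re w < 1 + Re h₀ − Re h₂ − Re h₃}`: Weierstrass M-test on small balls against the real four-Gamma term at the real
parts (`summable_fourGamma`), via `norm_coeff_le`, `‖Γ(w+μ)‖ ≤ Γ(Re w)(Re w)_μ` and `‖Γ(h₀+1−w+μ)⁻¹‖ ≤ ‖Γ(h₀+1−w)⁻¹‖/(Re h₀+1−Re w)_μ`.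
[cite: Zudilin2004, §4 (supporting lemma)] -/
theorem differentiableOn_series_cparam (h₀ h₂ h₃ : ℂ) (hx₀ : 0 < h₀.re) (hx₂ : 0 < h₂.re) (hx₃ : 0 < h₃.re) :
    DifferentiableOn ℂ (fun w : ℂ => ∑' μ : ℕ, (h₀ + 2 * μ) *
        (Complex.Gamma (h₀ + μ) * Complex.Gamma (w + μ) * Complex.Gamma (h₂ + μ) * Complex.Gamma (h₃ + μ)) /
        (Complex.Gamma ((μ : ℂ) + 1) * Complex.Gamma (h₀ - w + 1 + μ) * Complex.Gamma (h₀ - h₂ + 1 + μ) *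
          Complex.Gamma (h₀ - h₃ + 1 + μ)))
      {w : ℂ | 0 < w.re ∧ w.re < 1 + h₀.re - h₂.re - h₃.re} := by
  intro w₀ hw₀
  obtain ⟨hw₀, hw₀'⟩ := hw₀
  have h2' : h₂.re < h₀.re + 1 := by linarith
  have h3' : h₃.re < h₀.re + 1 := by linarith
  set δ : ℝ := min (w₀.re / 2) ((1 + h₀.re - h₂.re - h₃.re - w₀.re) / 2) with hδ
  have hδpos : 0 < δ := lt_min (by linarith) (by linarith)
  have hδ1 : δ ≤ w₀.re / 2 := min_le_left _ _
  have hδ2 : δ ≤ (1 + h₀.re - h₂.re - h₃.re - w₀.re) / 2 := min_le_right _ _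
  set xl : ℝ := w₀.re - δ with hxl
  set xu : ℝ := w₀.re + δ with hxu
  have hxl0 : 0 < xl := by rw [hxl]; linarith
  have hxu1 : xu + h₂.re + h₃.re < 1 + h₀.re := by rw [hxu]; linarith
  have hre : ∀ w ∈ ball w₀ δ, xl < w.re ∧ w.re < xu := by
    intro w hw
    rw [mem_ball, dist_eq_norm] at hw
    have h1 := Complex.abs_re_le_norm (w - w₀)
    simp only [Complex.sub_re] at h1
    have h2 := abs_lt.1 (lt_of_le_of_lt h1 hw)
    constructor
    · rw [hxl]; linarith [h2.1]
    · rw [hxu]; linarith [h2.2]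
  obtain ⟨MΓ, hMΓ⟩ : ∃ M : ℝ, ∀ x ∈ Icc xl xu, Real.Gamma x ≤ M := by
    have hc : ContinuousOn Real.Gamma (Icc xl xu) := fun x hx =>
      (Real.differentiableAt_Gamma fun m => by
        have : 0 < x := lt_of_lt_of_le hxl0 hx.1
        intro h; rw [h] at this
        have := m.cast_nonneg (α := ℝ); linarith).continuousAt.continuousWithinAt
    obtain ⟨M, hM⟩ := isCompact_Icc.exists_bound_of_continuousOn hc
    exact ⟨M, fun x hx => (le_abs_self _).trans (by simpa [Real.norm_eq_abs] using hM x hx)⟩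
  have hMΓ0 : 0 ≤ MΓ :=
    (Real.Gamma_pos_of_pos hw₀).le.trans (hMΓ w₀.re ⟨by rw [hxl]; linarith, by rw [hxu]; linarith⟩)
  obtain ⟨Mw, hMw⟩ : ∃ M : ℝ, ∀ w ∈ closedBall w₀ δ, ‖(Complex.Gamma (h₀ - w + 1))⁻¹‖ ≤ M := by
    have hd : Differentiable ℂ fun w : ℂ => h₀ - w + 1 := by fun_prop
    have hc : Continuous fun w : ℂ => (Complex.Gamma (h₀ - w + 1))⁻¹ :=
      (Complex.differentiable_one_div_Gamma.comp hd).continuous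
    obtain ⟨M, hM⟩ := (isCompact_closedBall w₀ δ).exists_bound_of_continuousOn hc.continuousOn
    exact ⟨M, hM⟩
  have hMw0 : 0 ≤ Mw := (norm_nonneg _).trans (hMw w₀ (mem_closedBall_self hδpos.le))
  -- the majorant: (bound of `norm_coeff_le`) · MΓ (xu)_μ · Mw / (x₀−xu+1)_μ
  set K : ℝ := max 1 (‖h₀‖ / h₀.re) with hK
  set CF : ℕ → ℝ := fun μ => (K * (h₀.re + 2 * μ) *
      (Real.Gamma (h₀.re + μ) * Real.Gamma (h₂.re + μ) * Real.Gamma (h₃.re + μ))) /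
    (Real.Gamma ((μ : ℝ) + 1) * (‖Complex.Gamma (h₀ - h₂ + 1)‖ * ∏ i ∈ range μ, (h₀.re - h₂.re + 1 + i)) *
      (‖Complex.Gamma (h₀ - h₃ + 1)‖ * ∏ i ∈ range μ, (h₀.re - h₃.re + 1 + i))) with hCF
  have nζ₂ : 0 < ‖Complex.Gamma (h₀ - h₂ + 1)‖ :=
    norm_pos_iff.2 (Complex.Gamma_ne_zero (ne_neg_nat_of_re_pos (by simp; linarith)))
  have nζ₃ : 0 < ‖Complex.Gamma (h₀ - h₃ + 1)‖ :=
    norm_pos_iff.2 (Complex.Gamma_ne_zero (ne_neg_nat_of_re_pos (by simp; linarith)))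
  have hCFnn : ∀ μ : ℕ, 0 ≤ CF μ := by
    intro μ
    have P2 : 0 < ∏ i ∈ range μ, (h₀.re - h₂.re + 1 + i) :=
      Finset.prod_pos fun i _ => by linarith [i.cast_nonneg (α := ℝ)]
    have P3 : 0 < ∏ i ∈ range μ, (h₀.re - h₃.re + 1 + i) :=
      Finset.prod_pos fun i _ => by linarith [i.cast_nonneg (α := ℝ)]
    rw [hCF]
    positivity
  set u : ℕ → ℝ := fun μ => CF μ * ((MΓ * ∏ i ∈ range μ, (xu + i)) *
      (Mw / ∏ i ∈ range μ, (h₀.re - xu + 1 + i))) with hu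
  have hsum : Summable u := by
    have h4 := (summable_fourGamma h₀.re xu h₂.re h₃.re hx₀ (by linarith) hx₂ hx₃ (by linarith)).mul_left
      (K * MΓ * Mw * Real.Gamma (h₀.re - xu + 1) * Real.Gamma (h₀.re - h₂.re + 1) * Real.Gamma (h₀.re - h₃.re + 1) /
        (Real.Gamma xu * ‖Complex.Gamma (h₀ - h₂ + 1)‖ * ‖Complex.Gamma (h₀ - h₃ + 1)‖))
    refine h4.congr fun μ => ?_
    have hΓxu : Real.Gamma xu ≠ 0 := (Real.Gamma_pos_of_pos (by linarith)).ne'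
    have hΓ1 : Real.Gamma (h₀.re - xu + 1) ≠ 0 := (Real.Gamma_pos_of_pos (by linarith)).ne'
    have hΓ2 : Real.Gamma (h₀.re - h₂.re + 1) ≠ 0 := (Real.Gamma_pos_of_pos (by linarith)).ne'
    have hΓ3 : Real.Gamma (h₀.re - h₃.re + 1) ≠ 0 := (Real.Gamma_pos_of_pos (by linarith)).ne'
    have P1 : ∏ i ∈ range μ, (h₀.re - xu + 1 + i) ≠ 0 :=
      (Finset.prod_pos fun i _ => by linarith [i.cast_nonneg (α := ℝ)]).ne'
    have P2 : ∏ i ∈ range μ, (h₀.re - h₂.re + 1 + i) ≠ 0 :=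
      (Finset.prod_pos fun i _ => by linarith [i.cast_nonneg (α := ℝ)]).ne'
    have P3 : ∏ i ∈ range μ, (h₀.re - h₃.re + 1 + i) ≠ 0 :=
      (Finset.prod_pos fun i _ => by linarith [i.cast_nonneg (α := ℝ)]).ne'
    rw [hu, hCF]
    simp only
    rw [Gamma_add_nat_eq xu (by linarith) μ, Gamma_add_nat_eq (h₀.re - xu + 1) (by linarith) μ,
      Gamma_add_nat_eq (h₀.re - h₂.re + 1) (by linarith) μ, Gamma_add_nat_eq (h₀.re - h₃.re + 1) (by linarith) μ]
    field_simp
  have hdiff : DifferentiableOn ℂ (fun w : ℂ => ∑' μ : ℕ, (h₀ + 2 * μ) *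
        (Complex.Gamma (h₀ + μ) * Complex.Gamma (w + μ) * Complex.Gamma (h₂ + μ) * Complex.Gamma (h₃ + μ)) /
        (Complex.Gamma ((μ : ℂ) + 1) * Complex.Gamma (h₀ - w + 1 + μ) * Complex.Gamma (h₀ - h₂ + 1 + μ) *
          Complex.Gamma (h₀ - h₃ + 1 + μ))) (ball w₀ δ) := by
    refine Complex.differentiableOn_tsum_of_summable_norm hsum (fun μ w hw => ?_) isOpen_ball (fun μ w hw => ?_)
    · obtain ⟨h1, h2⟩ := hre w hw
      exact (differentiableAt_term_cparam h₀ h₂ h₃ h2' h3' μ (by linarith) (by linarith)).differentiableWithinAt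
    · obtain ⟨h1, h2⟩ := hre w hw
      have hwpos : 0 < w.re := by linarith
      have eT : (h₀ + 2 * μ) *
          (Complex.Gamma (h₀ + μ) * Complex.Gamma (w + μ) * Complex.Gamma (h₂ + μ) * Complex.Gamma (h₃ + μ)) /
          (Complex.Gamma ((μ : ℂ) + 1) * Complex.Gamma (h₀ - w + 1 + μ) * Complex.Gamma (h₀ - h₂ + 1 + μ) *
            Complex.Gamma (h₀ - h₃ + 1 + μ)) =
        ((h₀ + 2 * μ) * (Complex.Gamma (h₀ + μ) * Complex.Gamma (h₂ + μ) * Complex.Gamma (h₃ + μ)) /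
          (Complex.Gamma ((μ : ℂ) + 1) * Complex.Gamma (h₀ - h₂ + 1 + μ) * Complex.Gamma (h₀ - h₃ + 1 + μ))) *
          (Complex.Gamma (w + μ) * (Complex.Gamma (h₀ - w + 1 + μ))⁻¹) := by
        rw [div_eq_mul_inv, div_eq_mul_inv]
        ring
      rw [eT, norm_mul, norm_mul]
      have b0 := norm_coeff_le h₀ h₂ h₃ hx₀ hx₂ hx₃ h2' h3' μ
      have b1 : ‖Complex.Gamma (w + μ)‖ ≤ MΓ * ∏ i ∈ range μ, (xu + i) := by
        refine (norm_Gamma_add_nat_le hwpos μ).trans ?_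
        refine mul_le_mul (hMΓ w.re ⟨h1.le, h2.le⟩) (Finset.prod_le_prod (fun i _ => by positivity)
          fun i _ => by linarith) (Finset.prod_nonneg fun i _ => by positivity) hMΓ0
      have hPu : 0 < ∏ i ∈ range μ, (h₀.re - xu + 1 + i) :=
        Finset.prod_pos fun i _ => by linarith [i.cast_nonneg (α := ℝ)]
      have b2 : ‖(Complex.Gamma (h₀ - w + 1 + μ))⁻¹‖ ≤ Mw / ∏ i ∈ range μ, (h₀.re - xu + 1 + i) := by
        have hζ : 0 < (h₀ - w + 1).re := by simp; linarith
        refine (norm_inv_Gamma_add_nat_le hζ μ).trans ?_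
        simp only [Complex.add_re, Complex.sub_re, Complex.one_re]
        exact div_le_div₀ hMw0 (hMw w (ball_subset_closedBall hw)) hPu
          (Finset.prod_le_prod (fun i _ => by linarith [i.cast_nonneg (α := ℝ)]) fun i _ => by linarith)
      rw [hu]
      exact mul_le_mul b0 (mul_le_mul b1 b2 (norm_nonneg _)
        (mul_nonneg hMΓ0 (Finset.prod_nonneg fun i _ => by positivity))) (by positivity) (hCFnn μ)
  exact (hdiff.differentiableAt (isOpen_ball.mem_nhds (mem_ball_self hδpos))).differentiableWithinAt

end Literature.NumberTheory.Irrationality.Zudilin2004.DougallComplexParameters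

end Part10

/-!
## Part 11 — port of `Summits/KontsevichZagierPeriods/Zeta5Search/VWPSeriesSummable.lean` (2 declarations kept)

# Absolute convergence of Zudilin's very-well-poised series `F_m` at complex parameters

Declarations of this Part (verbatim port; each keeps its own docstring and citation): `norm_Gamma_ratio_le`, `norm_prod_Gamma_ratio_le`.

Reference keys (see `references.bib` and the declarations' citations): [Zudilin2004].
-/

section Part11

namespace Literature.NumberTheory.Irrationality.Zudilin2004.VWPSeriesSummable

open _root_.Finset
open Literature.NumberTheory.Irrationality.Zudilin2004

/-- **One Gamma ratio**: for `Re ζ > 0`, `Re ξ > 0`, `μ ≥ 1`, `μ ≥ Re ζ`: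
`‖Γ(ζ+μ)/Γ(ξ+μ)‖ ≤ (‖Γ(ξ)⁻¹‖ Γ(Re ξ) 2^{1+Re ζ}) · μ^{Re ζ − Re ξ}`. [cite: Zudilin2004, §4 (supporting lemma)] -/
theorem norm_Gamma_ratio_le {ζ ξ : ℂ} (hζ : 0 < ζ.re) (hξ : 0 < ξ.re) {μ : ℕ} (hμ1 : 1 ≤ (μ : ℝ)) (hμζ : ζ.re ≤ (μ : ℝ)) :
    ‖Complex.Gamma (ζ + μ) / Complex.Gamma (ξ + μ)‖ ≤
      (‖(Complex.Gamma ξ)⁻¹‖ * Real.Gamma ξ.re * (2 : ℝ) ^ (1 + ζ.re)) * (μ : ℝ) ^ (ζ.re - ξ.re) := by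
  have h1 := DougallParameterHolomorphy.norm_Gamma_add_nat_le hζ μ
  have h2 := DougallComplexParameters.norm_inv_Gamma_add_nat_le hξ μ
  rw [← DougallCoefficientBounds.Gamma_add_nat_eq ζ.re hζ μ] at h1
  have hprod : 0 < ∏ i ∈ range μ, (ξ.re + i) := prod_pos fun i _ => by positivity
  have hΓξμ : Real.Gamma (ξ.re + μ) = Real.Gamma ξ.re * ∏ i ∈ range μ, (ξ.re + i) :=
    DougallCoefficientBounds.Gamma_add_nat_eq ξ.re hξ μ
  have hratio := DougallCoefficientBounds.Gamma_ratio_le (x := (μ : ℝ)) (a := ζ.re) (b := ξ.re) hμ1 hμζ hζ.le hξ.le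
  have hΓpos : 0 < Real.Gamma (ξ.re + μ) := Real.Gamma_pos_of_pos (by positivity)
  have hΓξ : 0 < Real.Gamma ξ.re := Real.Gamma_pos_of_pos hξ
  rw [norm_div, div_eq_mul_inv, ← norm_inv]
  calc ‖Complex.Gamma (ζ + μ)‖ * ‖(Complex.Gamma (ξ + μ))⁻¹‖
      ≤ Real.Gamma (ζ.re + μ) * (‖(Complex.Gamma ξ)⁻¹‖ / ∏ i ∈ range μ, (ξ.re + i)) :=
        mul_le_mul h1 h2 (norm_nonneg _) (Real.Gamma_pos_of_pos (by positivity)).le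
    _ = ‖(Complex.Gamma ξ)⁻¹‖ * Real.Gamma ξ.re * (Real.Gamma ((μ : ℝ) + ζ.re) / Real.Gamma ((μ : ℝ) + ξ.re)) := by
        rw [add_comm (μ : ℝ) ζ.re, add_comm (μ : ℝ) ξ.re, hΓξμ]
        field_simp
    _ ≤ ‖(Complex.Gamma ξ)⁻¹‖ * Real.Gamma ξ.re * ((2 : ℝ) ^ (1 + ζ.re) * (μ : ℝ) ^ (ζ.re - ξ.re)) :=
        mul_le_mul_of_nonneg_left hratio (by positivity)
    _ = _ := by ring

/-- **The product of ratios**: for a finite set `S` of indices with `Re ζ_j, Re ξ_j > 0`, there is `C > 0` with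
`∏_{j∈S} ‖Γ(ζ_j+μ)/Γ(ξ_j+μ)‖ ≤ C μ^{Σ_{j∈S}(Re ζ_j − Re ξ_j)}` whenever `μ ≥ 1` and `μ ≥ Re ζ_j` for all `j ∈ S`.
[cite: Zudilin2004, §4 (supporting lemma)] -/
theorem norm_prod_Gamma_ratio_le (S : Finset ℕ) (ζ ξ : ℕ → ℂ) (hζ : ∀ j ∈ S, 0 < (ζ j).re) (hξ : ∀ j ∈ S, 0 < (ξ j).re) :
    ∃ C : ℝ, 0 < C ∧ ∀ μ : ℕ, 1 ≤ (μ : ℝ) → (∀ j ∈ S, (ζ j).re ≤ (μ : ℝ)) →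
      ∏ j ∈ S, ‖Complex.Gamma (ζ j + μ) / Complex.Gamma (ξ j + μ)‖ ≤ C * (μ : ℝ) ^ (∑ j ∈ S, ((ζ j).re - (ξ j).re)) := by
  classical
  induction S using Finset.induction_on with
  | empty => exact ⟨1, one_pos, fun μ _ _ => by simp⟩
  | insert a S ha ih =>
    obtain ⟨C₁, hC₁, h₁⟩ := ih (fun j hj => hζ j (mem_insert_of_mem hj)) (fun j hj => hξ j (mem_insert_of_mem hj))
    have hζa := hζ a (mem_insert_self a S)
    have hξa := hξ a (mem_insert_self a S)
    have hΓ : Complex.Gamma (ξ a) ≠ 0 := Complex.Gamma_ne_zero_of_re_pos hξa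
    refine ⟨(‖(Complex.Gamma (ξ a))⁻¹‖ * Real.Gamma (ξ a).re * (2 : ℝ) ^ (1 + (ζ a).re)) * C₁,
      mul_pos (mul_pos (mul_pos (norm_pos_iff.2 (inv_ne_zero hΓ)) (Real.Gamma_pos_of_pos hξa)) (by positivity)) hC₁,
      fun μ hμ1 hμ => ?_⟩
    have hμ0 : 0 < (μ : ℝ) := by linarith
    rw [prod_insert ha, sum_insert ha, Real.rpow_add hμ0]
    calc ‖Complex.Gamma (ζ a + μ) / Complex.Gamma (ξ a + μ)‖ * ∏ j ∈ S, ‖Complex.Gamma (ζ j + μ) / Complex.Gamma (ξ j + μ)‖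
        ≤ ((‖(Complex.Gamma (ξ a))⁻¹‖ * Real.Gamma (ξ a).re * (2 : ℝ) ^ (1 + (ζ a).re)) * (μ : ℝ) ^ ((ζ a).re - (ξ a).re)) *
          (C₁ * (μ : ℝ) ^ (∑ j ∈ S, ((ζ j).re - (ξ j).re))) :=
          mul_le_mul (norm_Gamma_ratio_le hζa hξa hμ1 (hμ a (mem_insert_self a S)))
            (h₁ μ hμ1 fun j hj => hμ j (mem_insert_of_mem hj)) (prod_nonneg fun _ _ => norm_nonneg _) (by positivity)
      _ = _ := by ring

end Literature.NumberTheory.Irrationality.Zudilin2004.VWPSeriesSummable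

end Part11

/-!
## Part 12 — port of `Summits/KontsevichZagierPeriods/Zeta5Search/VWPSeriesHolomorphyH0.lean` (2 declarations kept)

# Holomorphy of Zudilin's very-well-poised series `F_m` in the parameter `h₀`

Declarations of this Part (verbatim port; each keeps its own docstring and citation): `norm_term_le`, `differentiableAt_series_h0`.

Reference keys (see `references.bib` and the declarations' citations): [Zudilin2004].
-/

section Part12

namespace Literature.NumberTheory.Irrationality.Zudilin2004.VWPSeriesHolomorphyH0

open _root_.Metric
open Literature.Analysis.SpecialFunctions.GammaVert (norm_Gamma_le_Gamma_re)
open Literature.NumberTheory.Irrationality.BrownZudilin2022.BarnesMellin (ne_neg_nat_of_re_pos)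
open Literature.NumberTheory.Irrationality.Zudilin2004.DougallCoefficientBounds (Gamma_add_nat_eq)
open Literature.NumberTheory.Irrationality.Zudilin2004.DougallParameterHolomorphy (norm_Gamma_add_nat_le)
open Literature.NumberTheory.Irrationality.Zudilin2004.DougallComplexParameters (norm_inv_Gamma_add_nat_le)
open Literature.NumberTheory.Irrationality.Zudilin2004.VWPSeriesSummable (norm_prod_Gamma_ratio_le)

/-- **Termwise bound**: for `Re v > 0`, `Re(1+v−h_i) > 0` (`i ∈ Icc 1 m`),
`‖(v+2μ)(Γ(v+μ)/Γ(1+μ))∏_i Γ(h_i+μ)/Γ(1+v−h_i+μ)(−1)^{(m+1)μ}‖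
  ≤ (‖v‖+2μ)·(Γ(Re v)∏_{j<μ}(Re v+j)/μ!)·∏_i [Γ(Re h_i)∏_{j<μ}(Re h_i+j)·(‖Γ(1+v−h_i)⁻¹‖/∏_{j<μ}(Re(1+v−h_i)+j))]`.
[cite: Zudilin2004, §4 (supporting lemma)] -/
theorem norm_term_le (m : ℕ) (h : ℕ → ℂ) (hpos : ∀ i ∈ Finset.Icc 1 m, 0 < (h i).re) {v : ℂ} (hv : 0 < v.re)
    (hb : ∀ i ∈ Finset.Icc 1 m, 0 < (1 + v - h i).re) (μ : ℕ) :
    ‖(v + 2 * μ) * (Complex.Gamma (v + μ) / Complex.Gamma (1 + μ) *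
        ∏ i ∈ Finset.Icc 1 m, Complex.Gamma (h i + μ) / Complex.Gamma (1 + v - h i + μ)) * (-1 : ℂ) ^ ((m + 1) * μ)‖ ≤
      (‖v‖ + 2 * μ) * (Real.Gamma v.re * (∏ j ∈ Finset.range μ, (v.re + j)) / μ.factorial) *
        ∏ i ∈ Finset.Icc 1 m, (Real.Gamma (h i).re * (∏ j ∈ Finset.range μ, ((h i).re + j)) *
          (‖(Complex.Gamma (1 + v - h i))⁻¹‖ / ∏ j ∈ Finset.range μ, ((1 + v - h i).re + j))) := by
  have n1 : ‖v + 2 * μ‖ ≤ ‖v‖ + 2 * μ := by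
    calc ‖v + 2 * μ‖ ≤ ‖v‖ + ‖(2 * μ : ℂ)‖ := norm_add_le _ _
      _ = ‖v‖ + 2 * μ := by
          rw [show (2 * μ : ℂ) = ((2 * μ : ℝ) : ℂ) by push_cast; ring, Complex.norm_real, Real.norm_of_nonneg (by positivity)]
  have n2 : ‖Complex.Gamma (v + μ) / Complex.Gamma (1 + μ)‖ ≤ Real.Gamma v.re * (∏ j ∈ Finset.range μ, (v.re + j)) / μ.factorial := by
    rw [norm_div, show (1 : ℂ) + μ = (μ : ℂ) + 1 by ring, Complex.Gamma_nat_eq_factorial, Complex.norm_natCast]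
    exact div_le_div_of_nonneg_right (norm_Gamma_add_nat_le hv μ) (by positivity)
  have n3 : ∀ i ∈ Finset.Icc 1 m, ‖Complex.Gamma (h i + μ) / Complex.Gamma (1 + v - h i + μ)‖ ≤
      Real.Gamma (h i).re * (∏ j ∈ Finset.range μ, ((h i).re + j)) *
        (‖(Complex.Gamma (1 + v - h i))⁻¹‖ / ∏ j ∈ Finset.range μ, ((1 + v - h i).re + j)) := by
    intro i hi
    rw [norm_div, div_eq_mul_inv, ← norm_inv]
    exact mul_le_mul (norm_Gamma_add_nat_le (hpos i hi) μ) (norm_inv_Gamma_add_nat_le (hb i hi) μ) (norm_nonneg _)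
      (mul_nonneg (Real.Gamma_pos_of_pos (hpos i hi)).le (Finset.prod_nonneg fun j _ => by linarith [hpos i hi, j.cast_nonneg (α := ℝ)]))
  rw [norm_mul, norm_mul, norm_mul, norm_pow, norm_neg, norm_one, one_pow, mul_one, norm_prod]
  have hB : 0 ≤ Real.Gamma v.re * (∏ j ∈ Finset.range μ, (v.re + j)) / μ.factorial := by
    have := Real.Gamma_pos_of_pos hv; positivity
  calc ‖v + 2 * μ‖ * (‖Complex.Gamma (v + μ) / Complex.Gamma (1 + μ)‖ *
        ∏ i ∈ Finset.Icc 1 m, ‖Complex.Gamma (h i + μ) / Complex.Gamma (1 + v - h i + μ)‖)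
      ≤ (‖v‖ + 2 * μ) * ((Real.Gamma v.re * (∏ j ∈ Finset.range μ, (v.re + j)) / μ.factorial) *
        ∏ i ∈ Finset.Icc 1 m, (Real.Gamma (h i).re * (∏ j ∈ Finset.range μ, ((h i).re + j)) *
          (‖(Complex.Gamma (1 + v - h i))⁻¹‖ / ∏ j ∈ Finset.range μ, ((1 + v - h i).re + j)))) :=
        mul_le_mul n1 (mul_le_mul n2 (Finset.prod_le_prod (fun _ _ => norm_nonneg _) n3)
          (Finset.prod_nonneg fun _ _ => norm_nonneg _) hB) (by positivity) (by positivity)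
    _ = _ := by ring

set_option maxHeartbeats 400000 in
/-- **`F_m` is holomorphic in `h₀`**: for complex `h₁, …, h_m` with `Re h_i > 0` and `v₀` with `Re v₀ > 0`, `Re h_i < 1 + Re v₀` and
`2 Σ_{i=1}^m Re h_i < (m−1)(1 + Re v₀)` (Zudilin's (5) at `h₀ = v₀`), the very-well-poised series
`v ↦ Σ_μ (v+2μ)·[Γ(v+μ)/Γ(1+μ)]·∏_{i=1}^m Γ(h_i+μ)/Γ(1+v−h_i+μ)·(−1)^{(m+1)μ}` is complex-differentiable at `v₀`.
[cite: Zudilin2004, §4 (supporting lemma)] -/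
theorem differentiableAt_series_h0 (m : ℕ) (h : ℕ → ℂ) (hpos : ∀ i ∈ Finset.Icc 1 m, 0 < (h i).re) {v₀ : ℂ} (hv₀ : 0 < v₀.re)
    (hden : ∀ i ∈ Finset.Icc 1 m, (h i).re < 1 + v₀.re)
    (h5 : 2 * (∑ i ∈ Finset.Icc 1 m, (h i).re) < ((m : ℝ) - 1) * (1 + v₀.re)) :
    DifferentiableAt ℂ (fun v : ℂ => ∑' μ : ℕ, (v + 2 * μ) * (Complex.Gamma (v + μ) / Complex.Gamma (1 + μ) *
        ∏ i ∈ Finset.Icc 1 m, Complex.Gamma (h i + μ) / Complex.Gamma (1 + v - h i + μ)) * (-1 : ℂ) ^ ((m + 1) * μ)) v₀ := by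
  -- the room `δ`
  have hdpos : ∀ i ∈ Finset.Icc 1 m, 0 < 1 + v₀.re - (h i).re := fun i hi => by linarith [hden i hi]
  set G : ℝ := ((m : ℝ) - 1) * (1 + v₀.re) - 2 * ∑ i ∈ Finset.Icc 1 m, (h i).re with hG
  have hG0 : 0 < G := by rw [hG]; linarith
  set δ : ℝ := min (min (v₀.re / 2) (G / (2 * (m + 2)))) (2 * (1 + ∑ i ∈ Finset.Icc 1 m, (1 + v₀.re - (h i).re)⁻¹))⁻¹ with hδ
  have hδpos : 0 < δ := by
    rw [hδ]
    refine lt_min (lt_min (by linarith) (by positivity)) ?_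
    have : 0 ≤ ∑ i ∈ Finset.Icc 1 m, (1 + v₀.re - (h i).re)⁻¹ := Finset.sum_nonneg fun i hi => (inv_pos.2 (hdpos i hi)).le
    positivity
  have hδ1 : δ ≤ v₀.re / 2 := le_trans (min_le_left _ _) (min_le_left _ _)
  have hδ2 : δ ≤ G / (2 * (m + 2)) := le_trans (min_le_left _ _) (min_le_right _ _)
  have hδ3 : ∀ i ∈ Finset.Icc 1 m, δ ≤ (1 + v₀.re - (h i).re) / 2 := by
    intro i hi
    have hs : (1 + v₀.re - (h i).re)⁻¹ ≤ ∑ j ∈ Finset.Icc 1 m, (1 + v₀.re - (h j).re)⁻¹ :=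
      Finset.single_le_sum (f := fun j => (1 + v₀.re - (h j).re)⁻¹) (fun j hj => (inv_pos.2 (hdpos j hj)).le) hi
    have hd := hdpos i hi
    calc δ ≤ (2 * (1 + ∑ j ∈ Finset.Icc 1 m, (1 + v₀.re - (h j).re)⁻¹))⁻¹ := min_le_right _ _
      _ ≤ (2 * (1 + v₀.re - (h i).re)⁻¹)⁻¹ := by
          apply inv_anti₀ (by positivity)
          linarith
      _ = (1 + v₀.re - (h i).re) / 2 := by rw [mul_inv, inv_inv]; ring
  set xl : ℝ := v₀.re - δ with hxl
  set xu : ℝ := v₀.re + δ with hxu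
  have hxl0 : 0 < xl := by rw [hxl]; linarith
  set bl : ℕ → ℝ := fun i => 1 + xl - (h i).re with hbl
  have hbl0 : ∀ i ∈ Finset.Icc 1 m, 0 < bl i := fun i hi => by simp only [hbl, hxl]; linarith [hδ3 i hi, hdpos i hi]
  -- points of the ball
  have hre : ∀ v ∈ ball v₀ δ, xl < v.re ∧ v.re < xu := by
    intro v hv
    rw [mem_ball, dist_eq_norm] at hv
    have h1 := Complex.abs_re_le_norm (v - v₀)
    simp only [Complex.sub_re] at h1
    have h2 := abs_lt.1 (lt_of_le_of_lt h1 hv)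
    exact ⟨by rw [hxl]; linarith [h2.1], by rw [hxu]; linarith [h2.2]⟩
  set R : ℝ := ‖v₀‖ + δ with hR
  have hnorm : ∀ v ∈ ball v₀ δ, ‖v‖ ≤ R := by
    intro v hv
    rw [mem_ball, dist_eq_norm] at hv
    have := norm_le_norm_add_norm_sub' v v₀
    rw [hR]; linarith
  -- `Γ` on `[xl, xu]`
  obtain ⟨MΓ, hMΓ⟩ : ∃ M : ℝ, ∀ x ∈ Set.Icc xl xu, Real.Gamma x ≤ M := by
    have hc : ContinuousOn Real.Gamma (Set.Icc xl xu) := fun x hx =>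
      (Real.differentiableAt_Gamma fun n => by
        have : 0 < x := lt_of_lt_of_le hxl0 hx.1
        intro h0; rw [h0] at this
        have := n.cast_nonneg (α := ℝ); linarith).continuousAt.continuousWithinAt
    obtain ⟨M, hM⟩ := isCompact_Icc.exists_bound_of_continuousOn hc
    exact ⟨M, fun x hx => (le_abs_self _).trans (by simpa [Real.norm_eq_abs] using hM x hx)⟩
  have hMΓ0 : 0 ≤ MΓ := (Real.Gamma_pos_of_pos hv₀).le.trans (hMΓ v₀.re ⟨by rw [hxl]; linarith, by rw [hxu]; linarith⟩)
  -- `‖Γ(1+v−h_i)⁻¹‖` on the closed ball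
  have hMj : ∀ i : ℕ, ∃ M : ℝ, 0 ≤ M ∧ ∀ v ∈ closedBall v₀ δ, ‖(Complex.Gamma (1 + v - h i))⁻¹‖ ≤ M := by
    intro i
    have hc : Continuous fun v : ℂ => (Complex.Gamma (1 + v - h i))⁻¹ :=
      (Complex.differentiable_one_div_Gamma.comp (by fun_prop : Differentiable ℂ fun v : ℂ => 1 + v - h i)).continuous
    obtain ⟨M, hM⟩ := (isCompact_closedBall v₀ δ).exists_bound_of_continuousOn hc.continuousOn
    exact ⟨M, (norm_nonneg _).trans (hM v₀ (mem_closedBall_self hδpos.le)), hM⟩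
  choose M hM0 hM using hMj
  -- the majorant
  set K : ℝ := MΓ / Real.Gamma xu * ∏ i ∈ Finset.Icc 1 m, (M i * Real.Gamma (bl i)) with hK
  set u : ℕ → ℝ := fun μ => K * ((R + 2 * μ) * (Real.Gamma (xu + μ) / μ.factorial) *
    ∏ i ∈ Finset.Icc 1 m, (Real.Gamma ((h i).re + μ) / Real.Gamma (bl i + μ))) with hu
  have hxu0 : 0 < xu := by rw [hxu]; linarith
  have hK0 : 0 ≤ K := by
    rw [hK]
    exact mul_nonneg (div_nonneg hMΓ0 (Real.Gamma_pos_of_pos hxu0).le)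
      (Finset.prod_nonneg fun i hi => mul_nonneg (hM0 i) (Real.Gamma_pos_of_pos (hbl0 i hi)).le)
  -- summability of the majorant
  have hsum : Summable u := by
    -- the Gamma ratios as norms of complex ratios at real points
    obtain ⟨C, hC, hP⟩ := norm_prod_Gamma_ratio_le (insert 0 (Finset.Icc 1 m)) (fun i => if i = 0 then (xu : ℂ) else ((h i).re : ℂ))
      (fun i => if i = 0 then (1 : ℂ) else (bl i : ℂ))
      (fun i hi => by
        rcases Finset.mem_insert.1 hi with rfl | hi
        · simpa using hxu0
        · have : i ≠ 0 := by have := (Finset.mem_Icc.1 hi).1; omega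
          simpa [this] using hpos i hi)
      (fun i hi => by
        rcases Finset.mem_insert.1 hi with rfl | hi
        · simp
        · have : i ≠ 0 := by have := (Finset.mem_Icc.1 hi).1; omega
          simpa [this] using hbl0 i hi)
    set E : ℝ := 1 + ((xu - 1) + ∑ i ∈ Finset.Icc 1 m, ((h i).re - bl i)) with hE
    have hE1 : E < -1 := by
      have hs : ∑ i ∈ Finset.Icc 1 m, ((h i).re - bl i) = 2 * (∑ i ∈ Finset.Icc 1 m, (h i).re) - (m : ℝ) * (1 + xl) := by
        simp only [hbl, Finset.sum_sub_distrib, Finset.sum_const, Nat.card_Icc, nsmul_eq_mul]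
        push_cast
        ring
      rw [hE, hs, hxu, hxl]
      have hm : (0 : ℝ) ≤ m := m.cast_nonneg
      have h3 : ((m : ℝ) + 2) * δ ≤ G / 2 := by
        have := hδ2; rw [le_div_iff₀ (by positivity)] at this; linarith
      nlinarith
    have hg : Summable fun μ : ℕ => K * ((R + 2) * C) * (μ : ℝ) ^ E := (Real.summable_nat_rpow.2 hE1).mul_left _
    refine Summable.of_norm_bounded_eventually_nat hg ?_
    rw [Filter.eventually_atTop]
    refine ⟨⌈1 + xu + ∑ i ∈ Finset.Icc 1 m, (h i).re⌉₊, fun μ hμ => ?_⟩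
    have hμR : 1 + xu + ∑ i ∈ Finset.Icc 1 m, (h i).re ≤ (μ : ℝ) := le_trans (Nat.le_ceil _) (by exact_mod_cast hμ)
    have hsum0 : 0 ≤ ∑ i ∈ Finset.Icc 1 m, (h i).re := Finset.sum_nonneg fun i hi => (hpos i hi).le
    have hμ1 : 1 ≤ (μ : ℝ) := by linarith
    have hμ0 : 0 < (μ : ℝ) := by linarith
    have hζ : ∀ j ∈ insert 0 (Finset.Icc 1 m), ((fun i => if i = 0 then (xu : ℂ) else ((h i).re : ℂ)) j).re ≤ (μ : ℝ) := by
      intro j hj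
      rcases Finset.mem_insert.1 hj with rfl | hj
      · simp; linarith
      · have hj0 : j ≠ 0 := by have := (Finset.mem_Icc.1 hj).1; omega
        have := Finset.single_le_sum (f := fun i => (h i).re) (fun i hi => (hpos i hi).le) hj
        simp [hj0]; linarith
    have hPμ := hP μ hμ1 hζ
    rw [Finset.prod_insert (by simp), Finset.sum_insert (by simp)] at hPμ
    simp only [↓reduceIte] at hPμ
    -- identify the real ratios
    have r0 : ‖Complex.Gamma ((xu : ℂ) + μ) / Complex.Gamma (1 + μ)‖ = Real.Gamma (xu + μ) / μ.factorial := by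
      rw [norm_div, show (xu : ℂ) + μ = ((xu + μ : ℝ) : ℂ) by push_cast; ring, Complex.Gamma_ofReal, Complex.norm_real,
        Real.norm_of_nonneg (Real.Gamma_pos_of_pos (by positivity)).le,
        show (1 : ℂ) + μ = (μ : ℂ) + 1 by ring, Complex.Gamma_nat_eq_factorial, Complex.norm_natCast]
    have rj : ∀ i ∈ Finset.Icc 1 m, ‖Complex.Gamma ((((h i).re : ℝ) : ℂ) + μ) / Complex.Gamma (((bl i : ℝ) : ℂ) + μ)‖ =
        Real.Gamma ((h i).re + μ) / Real.Gamma (bl i + μ) := by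
      intro i hi
      rw [norm_div, show (((h i).re : ℝ) : ℂ) + μ = (((h i).re + μ : ℝ) : ℂ) by push_cast; ring,
        show ((bl i : ℝ) : ℂ) + μ = ((bl i + μ : ℝ) : ℂ) by push_cast; ring, Complex.Gamma_ofReal, Complex.Gamma_ofReal,
        Complex.norm_real, Complex.norm_real, Real.norm_of_nonneg (Real.Gamma_pos_of_pos (by linarith [hpos i hi])).le,
        Real.norm_of_nonneg (Real.Gamma_pos_of_pos (by linarith [hbl0 i hi])).le]
    have hprod : ∏ i ∈ Finset.Icc 1 m, ‖Complex.Gamma ((fun i => if i = 0 then (xu : ℂ) else ((h i).re : ℂ)) i + μ) /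
        Complex.Gamma ((fun i => if i = 0 then (1 : ℂ) else (bl i : ℂ)) i + μ)‖ =
        ∏ i ∈ Finset.Icc 1 m, (Real.Gamma ((h i).re + μ) / Real.Gamma (bl i + μ)) := by
      refine Finset.prod_congr rfl fun i hi => ?_
      have hi0 : i ≠ 0 := by have := (Finset.mem_Icc.1 hi).1; omega
      simp only [hi0, ↓reduceIte]
      exact rj i hi
    have hexp : (∑ x ∈ Finset.Icc 1 m, (((if x = 0 then (xu : ℂ) else (((h x).re : ℝ) : ℂ))).re -
        ((if x = 0 then (1 : ℂ) else ((bl x : ℝ) : ℂ))).re)) = ∑ i ∈ Finset.Icc 1 m, ((h i).re - bl i) := by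
      refine Finset.sum_congr rfl fun i hi => ?_
      have hi0 : i ≠ 0 := by have := (Finset.mem_Icc.1 hi).1; omega
      simp [hi0]
    rw [hprod, r0, hexp] at hPμ
    simp only [Complex.ofReal_re, Complex.one_re] at hPμ
    have hR0 : 0 ≤ R := by rw [hR]; positivity
    have hu0 : 0 ≤ u μ := by
      simp only [hu]
      refine mul_nonneg hK0 (mul_nonneg (mul_nonneg (by positivity) ?_) (Finset.prod_nonneg fun i hi => ?_))
      · exact div_nonneg (Real.Gamma_pos_of_pos (by positivity)).le (by positivity)
      · exact div_nonneg (Real.Gamma_pos_of_pos (by linarith [hpos i hi])).le (Real.Gamma_pos_of_pos (by linarith [hbl0 i hi])).le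
    rw [Real.norm_of_nonneg hu0, hu]
    simp only
    have hlin : R + 2 * (μ : ℝ) ≤ (R + 2) * (μ : ℝ) ^ (1 : ℝ) := by
      rw [Real.rpow_one]; nlinarith
    have hP0 : 0 ≤ Real.Gamma (xu + μ) / μ.factorial * ∏ i ∈ Finset.Icc 1 m, (Real.Gamma ((h i).re + μ) / Real.Gamma (bl i + μ)) :=
      mul_nonneg (div_nonneg (Real.Gamma_pos_of_pos (by positivity)).le (by positivity))
        (Finset.prod_nonneg fun i hi => div_nonneg (Real.Gamma_pos_of_pos (by linarith [hpos i hi])).le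
          (Real.Gamma_pos_of_pos (by linarith [hbl0 i hi])).le)
    have hsplit : (μ : ℝ) ^ E = (μ : ℝ) ^ (1 : ℝ) * (μ : ℝ) ^ ((xu - 1) + ∑ i ∈ Finset.Icc 1 m, ((h i).re - bl i)) := by
      rw [hE, Real.rpow_add hμ0]
    calc K * ((R + 2 * μ) * (Real.Gamma (xu + μ) / μ.factorial) * ∏ i ∈ Finset.Icc 1 m, (Real.Gamma ((h i).re + μ) / Real.Gamma (bl i + μ)))
        = K * ((R + 2 * μ) * ((Real.Gamma (xu + μ) / μ.factorial) *
            ∏ i ∈ Finset.Icc 1 m, (Real.Gamma ((h i).re + μ) / Real.Gamma (bl i + μ)))) := by ring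
      _ ≤ K * (((R + 2) * (μ : ℝ) ^ (1 : ℝ)) * (C * (μ : ℝ) ^ ((xu - 1) + ∑ i ∈ Finset.Icc 1 m, ((h i).re - bl i)))) :=
          mul_le_mul_of_nonneg_left (mul_le_mul hlin hPμ hP0 (by positivity)) hK0
      _ = K * ((R + 2) * C) * (μ : ℝ) ^ E := by rw [hsplit]; ring
  -- the M-test on the ball
  have hdiff : DifferentiableOn ℂ (fun v : ℂ => ∑' μ : ℕ, (v + 2 * μ) * (Complex.Gamma (v + μ) / Complex.Gamma (1 + μ) *
        ∏ i ∈ Finset.Icc 1 m, Complex.Gamma (h i + μ) / Complex.Gamma (1 + v - h i + μ)) * (-1 : ℂ) ^ ((m + 1) * μ)) (ball v₀ δ) := by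
    refine Complex.differentiableOn_tsum_of_summable_norm hsum (fun μ v hv => ?_) isOpen_ball (fun μ v hv => ?_)
    · obtain ⟨h1, h2⟩ := hre v hv
      exact (differentiableAt_term m h μ (by linarith) fun i hi => by
        have := hbl0 i hi; simp only [hbl] at this; simp; linarith).differentiableWithinAt
    · obtain ⟨h1, h2⟩ := hre v hv
      have hvpos : 0 < v.re := by linarith
      have hbv : ∀ i ∈ Finset.Icc 1 m, 0 < (1 + v - h i).re := fun i hi => by
        have := hbl0 i hi; simp only [hbl] at this; simp; linarith
      refine (norm_term_le m h hpos hvpos hbv μ).trans ?_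
      -- compare factor by factor
      have f1 : ‖v‖ + 2 * μ ≤ R + 2 * μ := by linarith [hnorm v hv]
      have f2 : Real.Gamma v.re * (∏ j ∈ Finset.range μ, (v.re + j)) / μ.factorial ≤ MΓ / Real.Gamma xu * (Real.Gamma (xu + μ) / μ.factorial) := by
        rw [Gamma_add_nat_eq xu hxu0 μ]
        have hp : ∏ j ∈ Finset.range μ, (v.re + j) ≤ ∏ j ∈ Finset.range μ, (xu + j) :=
          Finset.prod_le_prod (fun j _ => by positivity) fun j _ => by linarith
        have hΓxu : 0 < Real.Gamma xu := Real.Gamma_pos_of_pos hxu0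
        calc Real.Gamma v.re * (∏ j ∈ Finset.range μ, (v.re + j)) / μ.factorial
            ≤ MΓ * (∏ j ∈ Finset.range μ, (xu + j)) / μ.factorial :=
              div_le_div_of_nonneg_right (mul_le_mul (hMΓ v.re ⟨h1.le, h2.le⟩) hp
                (Finset.prod_nonneg fun j _ => by positivity) hMΓ0) (by positivity)
          _ = MΓ / Real.Gamma xu * (Real.Gamma xu * (∏ j ∈ Finset.range μ, (xu + j)) / μ.factorial) := by field_simp
      have f3 : ∀ i ∈ Finset.Icc 1 m, Real.Gamma (h i).re * (∏ j ∈ Finset.range μ, ((h i).re + j)) *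
          (‖(Complex.Gamma (1 + v - h i))⁻¹‖ / ∏ j ∈ Finset.range μ, ((1 + v - h i).re + j)) ≤
          (M i * Real.Gamma (bl i)) * (Real.Gamma ((h i).re + μ) / Real.Gamma (bl i + μ)) := by
        intro i hi
        have hb0 := hbl0 i hi
        rw [← Gamma_add_nat_eq (h i).re (hpos i hi) μ, Gamma_add_nat_eq (bl i) hb0 μ]
        have hP : ∏ j ∈ Finset.range μ, (bl i + j) ≤ ∏ j ∈ Finset.range μ, ((1 + v - h i).re + j) :=
          Finset.prod_le_prod (fun j _ => by linarith [j.cast_nonneg (α := ℝ)]) fun j _ => by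
            simp only [hbl] ; simp; linarith
        have hP0 : 0 < ∏ j ∈ Finset.range μ, (bl i + j) := Finset.prod_pos fun j _ => by linarith [j.cast_nonneg (α := ℝ)]
        have hΓb : 0 < Real.Gamma (bl i) := Real.Gamma_pos_of_pos hb0
        have hΓh : 0 ≤ Real.Gamma ((h i).re + μ) := (Real.Gamma_pos_of_pos (by linarith [hpos i hi])).le
        calc Real.Gamma ((h i).re + μ) * (‖(Complex.Gamma (1 + v - h i))⁻¹‖ / ∏ j ∈ Finset.range μ, ((1 + v - h i).re + j))
            ≤ Real.Gamma ((h i).re + μ) * (M i / ∏ j ∈ Finset.range μ, (bl i + j)) :=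
              mul_le_mul_of_nonneg_left (div_le_div₀ (hM0 i) (hM i v (ball_subset_closedBall hv)) hP0 hP) hΓh
          _ = M i * Real.Gamma (bl i) * (Real.Gamma ((h i).re + μ) / (Real.Gamma (bl i) * ∏ j ∈ Finset.range μ, (bl i + j))) := by
              field_simp
      have hfac0 : ∀ i ∈ Finset.Icc 1 m, 0 ≤ Real.Gamma (h i).re * (∏ j ∈ Finset.range μ, ((h i).re + j)) *
          (‖(Complex.Gamma (1 + v - h i))⁻¹‖ / ∏ j ∈ Finset.range μ, ((1 + v - h i).re + j)) := by
        intro i hi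
        have hb' := hbv i hi
        have hp' := hpos i hi
        refine mul_nonneg (mul_nonneg (Real.Gamma_pos_of_pos hp').le (Finset.prod_nonneg fun j _ => by positivity))
          (div_nonneg (norm_nonneg _) (Finset.prod_nonneg fun j _ => by positivity))
      have f3' := (Finset.prod_le_prod hfac0 f3).trans (le_of_eq Finset.prod_mul_distrib)
      have hR0' : 0 ≤ R := by rw [hR]; positivity
      have hA0 : 0 ≤ R + 2 * (μ : ℝ) := by positivity
      have hB0 : 0 ≤ Real.Gamma v.re * (∏ j ∈ Finset.range μ, (v.re + j)) / μ.factorial := by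
        have := Real.Gamma_pos_of_pos hvpos; positivity
      have hB'0 : 0 ≤ MΓ / Real.Gamma xu * (Real.Gamma (xu + μ) / μ.factorial) := by
        have := Real.Gamma_pos_of_pos hxu0; have := Real.Gamma_pos_of_pos (show 0 < xu + μ by positivity); positivity
      calc (‖v‖ + 2 * μ) * (Real.Gamma v.re * (∏ j ∈ Finset.range μ, (v.re + j)) / μ.factorial) *
            ∏ i ∈ Finset.Icc 1 m, (Real.Gamma (h i).re * (∏ j ∈ Finset.range μ, ((h i).re + j)) *
              (‖(Complex.Gamma (1 + v - h i))⁻¹‖ / ∏ j ∈ Finset.range μ, ((1 + v - h i).re + j)))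
          ≤ (R + 2 * μ) * (MΓ / Real.Gamma xu * (Real.Gamma (xu + μ) / μ.factorial)) *
            ((∏ i ∈ Finset.Icc 1 m, (M i * Real.Gamma (bl i))) * ∏ i ∈ Finset.Icc 1 m, (Real.Gamma ((h i).re + μ) / Real.Gamma (bl i + μ))) :=
            mul_le_mul (mul_le_mul f1 f2 hB0 hA0) f3' (Finset.prod_nonneg hfac0) (mul_nonneg hA0 hB'0)
        _ = u μ := by simp only [hu, hK]; ring
  exact hdiff.differentiableAt (isOpen_ball.mem_nhds (mem_ball_self hδpos))

end Literature.NumberTheory.Irrationality.Zudilin2004.VWPSeriesHolomorphyH0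

end Part12

/-!
## Part 13 — port of `Summits/KontsevichZagierPeriods/Zeta5Search/VWPContinuationH0.lean` (2 declarations kept)

# Continuation in `h₀` of Zudilin's identity (4): from a sub-ray to the whole admissible half-plane

Declarations of this Part (verbatim port; each keeps its own docstring and citation): `differentiableAt_lhs`, `continuation`.

Reference keys (see `references.bib` and the declarations' citations): [Zudilin2004].
-/

section Part13

namespace Literature.NumberTheory.Irrationality.Zudilin2004.VWPContinuationH0

open _root_.MeasureTheory _root_.Set _root_.Filter
open scoped _root_.Topology
open Literature.NumberTheory.Irrationality.Zudilin2002 (nestedQ)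
open Literature.NumberTheory.Irrationality.Zudilin2004.SorokinHolomorphyH0 (differentiableAt_shift)
open Literature.NumberTheory.Irrationality.Zudilin2004.VWPSeriesHolomorphyH0 (differentiableAt_series_h0 prod_update_zero)
open Literature.NumberTheory.Irrationality.Zudilin2004.SorokinConvergenceVWP (chain_lt sum_Icc_odd)
open Literature.NumberTheory.Irrationality.BrownZudilin2022.BarnesMellin (ne_neg_nat_of_re_pos)

/-- **The F-side**: `v ↦ P_n(h_v)·F_{n+2}(h_v)` (typed shapes, `h_v = Function.update h 0 v`) is holomorphic at every `v` with `Re v > 0`,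
`Re h_i < 1 + Re v` (`i ∈ Icc 1 (n+2)`), `Re h₁ + Re h₂ < 1 + Re v`, `Re h_j + Re h_{j+1} < 1 + Re v` (`j ∈ Icc 2 (n+1)`) and (5).
[cite: Zudilin2004, §4 (supporting lemma)] -/
theorem differentiableAt_lhs (n : ℕ) (h : ℕ → ℂ) (v : ℂ) (hv : 0 < v.re) (hpos : ∀ i ∈ Finset.Icc 1 (n + 2), 0 < (h i).re)
    (hden : ∀ i ∈ Finset.Icc 1 (n + 2), (h i).re < 1 + v.re)
    (hpair : ∀ j ∈ Finset.Icc 1 (n + 1), (h j).re + (h (j + 1)).re < 1 + v.re)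
    (h5 : 2 * (∑ i ∈ Finset.Icc 1 (n + 2), (h i).re) < ((n : ℝ) + 1) * (1 + v.re)) :
    DifferentiableAt ℂ (fun w : ℂ =>
      (∏ i ∈ Finset.Icc 1 (n + 1), Complex.Gamma (1 + Function.update h 0 w 0 - Function.update h 0 w i - Function.update h 0 w (i + 1))) /
          (Complex.Gamma (Function.update h 0 w 1) * Complex.Gamma (Function.update h 0 w (n + 2))) *
        (∑' μ : ℕ, (Function.update h 0 w 0 + 2 * (μ : ℂ)) *
          (∏ i ∈ Finset.range (n + 3), Complex.Gamma (Function.update h 0 w i + μ) /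
            Complex.Gamma (1 + Function.update h 0 w 0 - Function.update h 0 w i + μ)) * (-1 : ℂ) ^ ((n + 3) * μ))) v := by
  -- rewrite the function without `Function.update`
  have hfun : (fun w : ℂ =>
      (∏ i ∈ Finset.Icc 1 (n + 1), Complex.Gamma (1 + Function.update h 0 w 0 - Function.update h 0 w i - Function.update h 0 w (i + 1))) /
          (Complex.Gamma (Function.update h 0 w 1) * Complex.Gamma (Function.update h 0 w (n + 2))) *
        (∑' μ : ℕ, (Function.update h 0 w 0 + 2 * (μ : ℂ)) *
          (∏ i ∈ Finset.range (n + 3), Complex.Gamma (Function.update h 0 w i + μ) /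
            Complex.Gamma (1 + Function.update h 0 w 0 - Function.update h 0 w i + μ)) * (-1 : ℂ) ^ ((n + 3) * μ))) =
      fun w : ℂ => (∏ i ∈ Finset.Icc 1 (n + 1), Complex.Gamma (1 + w - h i - h (i + 1))) / (Complex.Gamma (h 1) * Complex.Gamma (h (n + 2))) *
        (∑' μ : ℕ, (w + 2 * (μ : ℂ)) * (Complex.Gamma (w + μ) / Complex.Gamma (1 + μ) *
          ∏ i ∈ Finset.Icc 1 (n + 2), Complex.Gamma (h i + μ) / Complex.Gamma (1 + w - h i + μ)) * (-1 : ℂ) ^ ((n + 2 + 1) * μ)) := by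
    funext w
    have ht : ∀ μ : ℕ, (Function.update h 0 w 0 + 2 * (μ : ℂ)) *
          (∏ i ∈ Finset.range (n + 3), Complex.Gamma (Function.update h 0 w i + μ) /
            Complex.Gamma (1 + Function.update h 0 w 0 - Function.update h 0 w i + μ)) * (-1 : ℂ) ^ ((n + 3) * μ) =
        (w + 2 * (μ : ℂ)) * (Complex.Gamma (w + μ) / Complex.Gamma (1 + μ) *
          ∏ i ∈ Finset.Icc 1 (n + 2), Complex.Gamma (h i + μ) / Complex.Gamma (1 + w - h i + μ)) * (-1 : ℂ) ^ ((n + 2 + 1) * μ) := by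
      intro μ
      rw [show n + 3 = n + 2 + 1 by ring, prod_update_zero (n + 2) h w μ, Function.update_self]
    simp_rw [ht]
    have hne : ∀ i ∈ Finset.Icc 1 (n + 1), Function.update h 0 w i = h i ∧ Function.update h 0 w (i + 1) = h (i + 1) := fun i hi => by
      have := (Finset.mem_Icc.1 hi).1
      exact ⟨Function.update_of_ne (by omega) _ _, Function.update_of_ne (by omega) _ _⟩
    rw [Finset.prod_congr rfl (fun i hi => by rw [(hne i hi).1, (hne i hi).2]), Function.update_of_ne (by omega : (1 : ℕ) ≠ 0),
      Function.update_of_ne (by omega : n + 2 ≠ 0), Function.update_self]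
  rw [hfun]
  refine DifferentiableAt.mul (DifferentiableAt.div_const ?_ _) ?_
  · refine DifferentiableAt.fun_finsetProd (f := fun i w => Complex.Gamma (1 + w - h i - h (i + 1))) fun i hi => ?_
    exact (Complex.differentiableAt_Gamma _ (ne_neg_nat_of_re_pos (by simp; linarith [hpair i hi]))).comp v
      ((((differentiableAt_const _).add differentiableAt_id).sub_const _).sub_const _)
  · have := differentiableAt_series_h0 (n + 2) h (fun i hi => hpos i hi) hv (fun i hi => hden i hi)
      (by push_cast; linarith)
    exact this

/-- **Continuation in `h₀`**: fix `n ≥ 1` and complex `h₁, …, h_{n+2}` with `Re h₁ > 0`, `Re h_i > 0`; let `M ≥ 0`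
dominate the lower bounds on `h₀` of the typed hypotheses (`Re h₁+Re h₂−1 ≤ M`, `Re h_j+Re h_{j+1}−1 ≤ M` for `j ∈ Icc 2 (n+1)`,
`(2/(n+1))Σ Re h_j − 1 ≤ M`).  If `S(n)(h_t)` holds for every REAL `t > L'` with `M ≤ L'`, then `S(n)(h_v)` holds for every complex
`v` with `Re v > M` (`h_v = Function.update h 0 v`). [cite: Zudilin2004, §4 (supporting lemma)] -/
theorem continuation {n : ℕ} (hn : 1 ≤ n) (h : ℕ → ℂ) (hpos : ∀ i ∈ Finset.Icc 1 (n + 2), 0 < (h i).re) {M L' : ℝ} (hM0 : 0 ≤ M)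
    (hM12 : (h 1).re + (h 2).re - 1 ≤ M) (hM6 : ∀ j ∈ Finset.Icc 2 (n + 1), (h j).re + (h (j + 1)).re - 1 ≤ M)
    (hM5 : (2 / ((n : ℝ) + 1)) * (∑ j ∈ Finset.Icc 1 (n + 2), (h j).re) - 1 ≤ M) (hML : M ≤ L')
    (hreal : ∀ t : ℝ, L' < t →
      (∏ i ∈ Finset.Icc 1 (n + 1), Complex.Gamma (1 + Function.update h 0 (t : ℂ) 0 - Function.update h 0 (t : ℂ) i -
            Function.update h 0 (t : ℂ) (i + 1))) /
          (Complex.Gamma (Function.update h 0 (t : ℂ) 1) * Complex.Gamma (Function.update h 0 (t : ℂ) (n + 2))) *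
        (∑' μ : ℕ, (Function.update h 0 (t : ℂ) 0 + 2 * (μ : ℂ)) *
          (∏ i ∈ Finset.range (n + 3), Complex.Gamma (Function.update h 0 (t : ℂ) i + μ) /
            Complex.Gamma (1 + Function.update h 0 (t : ℂ) 0 - Function.update h 0 (t : ℂ) i + μ)) * (-1 : ℂ) ^ ((n + 3) * μ)) =
      ∫ x in Set.pi univ (fun _ : Fin n => Icc (0 : ℝ) 1),
        (∏ j : Fin n, ((x j : ℝ) : ℂ) ^ (Function.update h 0 (t : ℂ) (j + 2) - 1) *
            (1 - ((x j : ℝ) : ℂ)) ^ ((1 + Function.update h 0 (t : ℂ) 0 - Function.update h 0 (t : ℂ) (j + 3)) -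
              Function.update h 0 (t : ℂ) (j + 2) - 1)) *
          ((nestedQ (List.ofFn x) : ℝ) : ℂ) ^ (-Function.update h 0 (t : ℂ) 1))
    {v : ℂ} (hv : M < v.re) :
    (∏ i ∈ Finset.Icc 1 (n + 1), Complex.Gamma (1 + Function.update h 0 v 0 - Function.update h 0 v i - Function.update h 0 v (i + 1))) /
          (Complex.Gamma (Function.update h 0 v 1) * Complex.Gamma (Function.update h 0 v (n + 2))) *
        (∑' μ : ℕ, (Function.update h 0 v 0 + 2 * (μ : ℂ)) *
          (∏ i ∈ Finset.range (n + 3), Complex.Gamma (Function.update h 0 v i + μ) /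
            Complex.Gamma (1 + Function.update h 0 v 0 - Function.update h 0 v i + μ)) * (-1 : ℂ) ^ ((n + 3) * μ)) =
      ∫ x in Set.pi univ (fun _ : Fin n => Icc (0 : ℝ) 1),
        (∏ j : Fin n, ((x j : ℝ) : ℂ) ^ (Function.update h 0 v (j + 2) - 1) *
            (1 - ((x j : ℝ) : ℂ)) ^ ((1 + Function.update h 0 v 0 - Function.update h 0 v (j + 3)) - Function.update h 0 v (j + 2) - 1)) *
          ((nestedQ (List.ofFn x) : ℝ) : ℂ) ^ (-Function.update h 0 v 1) := by
  set U : Set ℂ := {w : ℂ | M < w.re} with hU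
  have hUo : IsOpen U := isOpen_lt continuous_const Complex.continuous_re
  have hUc : IsPreconnected U := (convex_halfSpace_re_gt M).isPreconnected
  -- the J-side written without `Function.update`
  have hJfun : ∀ w : ℂ, (∫ x in Set.pi univ (fun _ : Fin n => Icc (0 : ℝ) 1),
        (∏ j : Fin n, ((x j : ℝ) : ℂ) ^ (Function.update h 0 w (j + 2) - 1) *
            (1 - ((x j : ℝ) : ℂ)) ^ ((1 + Function.update h 0 w 0 - Function.update h 0 w (j + 3)) - Function.update h 0 w (j + 2) - 1)) *
          ((nestedQ (List.ofFn x) : ℝ) : ℂ) ^ (-Function.update h 0 w 1)) =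
      ∫ x in Set.pi univ (fun _ : Fin n => Icc (0 : ℝ) 1),
        (∏ j : Fin n, ((x j : ℝ) : ℂ) ^ (h (j + 2) - 1) * (1 - ((x j : ℝ) : ℂ)) ^ ((1 + w - h (j + 3)) - h (j + 2) - 1)) *
          ((nestedQ (List.ofFn x) : ℝ) : ℂ) ^ (-h 1) := by
    intro w
    simp only [Function.update_self, Function.update_of_ne (Nat.succ_ne_zero _)]
  -- typed hypotheses at every point of `U`
  have hsum0 : 0 ≤ ∑ j ∈ Finset.Icc 1 (n + 2), (h j).re := Finset.sum_nonneg fun j hj => (hpos j hj).le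
  have hyp : ∀ w ∈ U, 0 < w.re ∧ (h 1).re + (h 2).re < 1 + w.re ∧
      (∀ j ∈ Finset.Icc 2 (n + 1), 0 < (h j).re ∧ (h j).re < 1 + w.re - (h (j + 1)).re) ∧
      (2 / ((n : ℝ) + 1)) * (∑ j ∈ Finset.Icc 1 (n + 2), (h j).re) < 1 + w.re := by
    intro w hw
    have hw' : M < w.re := hw
    refine ⟨by linarith, by linarith, fun j hj => ⟨hpos j (Finset.mem_Icc.2 ⟨by have := (Finset.mem_Icc.1 hj).1; omega,
      by have := (Finset.mem_Icc.1 hj).2; omega⟩), by linarith [hM6 j hj]⟩, by linarith⟩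
  have hg : DifferentiableOn ℂ (fun w : ℂ => ∫ x in Set.pi univ (fun _ : Fin n => Icc (0 : ℝ) 1),
      (∏ j : Fin n, ((x j : ℝ) : ℂ) ^ (h (j + 2) - 1) * (1 - ((x j : ℝ) : ℂ)) ^ ((1 + w - h (j + 3)) - h (j + 2) - 1)) *
        ((nestedQ (List.ofFn x) : ℝ) : ℂ) ^ (-h 1)) U := fun w hw => by
    obtain ⟨hw0, hw12, hw6, hw5⟩ := hyp w hw
    exact (differentiableAt_rhs hn h w (hpos 1 (by simp)).le hw5 hw6 hw12).differentiableWithinAt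
  have hf : DifferentiableOn ℂ (fun w : ℂ =>
      (∏ i ∈ Finset.Icc 1 (n + 1), Complex.Gamma (1 + Function.update h 0 w 0 - Function.update h 0 w i - Function.update h 0 w (i + 1))) /
          (Complex.Gamma (Function.update h 0 w 1) * Complex.Gamma (Function.update h 0 w (n + 2))) *
        (∑' μ : ℕ, (Function.update h 0 w 0 + 2 * (μ : ℂ)) *
          (∏ i ∈ Finset.range (n + 3), Complex.Gamma (Function.update h 0 w i + μ) /
            Complex.Gamma (1 + Function.update h 0 w 0 - Function.update h 0 w i + μ)) * (-1 : ℂ) ^ ((n + 3) * μ))) U := fun w hw => by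
    obtain ⟨hw0, hw12, hw6, hw5⟩ := hyp w hw
    have hpair : ∀ j ∈ Finset.Icc 1 (n + 1), (h j).re + (h (j + 1)).re < 1 + w.re := by
      intro j hj
      rcases Nat.lt_or_ge j 2 with hj2 | hj2
      · have : j = 1 := by have := (Finset.mem_Icc.1 hj).1; omega
        subst this; exact hw12
      · have := hw6 j (Finset.mem_Icc.2 ⟨hj2, (Finset.mem_Icc.1 hj).2⟩); linarith
    have hden : ∀ i ∈ Finset.Icc 1 (n + 2), (h i).re < 1 + w.re := by
      intro i hi
      have hi1 := (Finset.mem_Icc.1 hi).1; have hi2 := (Finset.mem_Icc.1 hi).2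
      rcases Nat.lt_or_ge i (n + 2) with hlt | hge
      · have := hpair i (Finset.mem_Icc.2 ⟨hi1, by omega⟩); linarith [hpos (i + 1) (Finset.mem_Icc.2 ⟨by omega, by omega⟩)]
      · have : i = n + 2 := by omega
        subst this
        have := hpair (n + 1) (Finset.mem_Icc.2 ⟨by omega, le_rfl⟩); linarith [hpos (n + 1) (Finset.mem_Icc.2 ⟨by omega, by omega⟩)]
    have h5' : 2 * (∑ i ∈ Finset.Icc 1 (n + 2), (h i).re) < ((n : ℝ) + 1) * (1 + w.re) := by
      have hn0 : (0 : ℝ) < (n : ℝ) + 1 := by positivity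
      rw [div_mul_eq_mul_div, div_lt_iff₀ hn0] at hw5; linarith
    exact (differentiableAt_lhs n h w hw0 hpos hden hpair h5').differentiableWithinAt
  -- apply the identity theorem at `x₀ = L' + 1`
  have hx₀ : ((L' + 1 : ℝ) : ℂ) ∈ U := by simp only [hU, Set.mem_setOf_eq, Complex.ofReal_re]; linarith
  have hev : ∀ᶠ t : ℝ in 𝓝 (L' + 1), (fun w : ℂ =>
      (∏ i ∈ Finset.Icc 1 (n + 1), Complex.Gamma (1 + Function.update h 0 w 0 - Function.update h 0 w i - Function.update h 0 w (i + 1))) /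
          (Complex.Gamma (Function.update h 0 w 1) * Complex.Gamma (Function.update h 0 w (n + 2))) *
        (∑' μ : ℕ, (Function.update h 0 w 0 + 2 * (μ : ℂ)) *
          (∏ i ∈ Finset.range (n + 3), Complex.Gamma (Function.update h 0 w i + μ) /
            Complex.Gamma (1 + Function.update h 0 w 0 - Function.update h 0 w i + μ)) * (-1 : ℂ) ^ ((n + 3) * μ))) t =
      (fun w : ℂ => ∫ x in Set.pi univ (fun _ : Fin n => Icc (0 : ℝ) 1),
        (∏ j : Fin n, ((x j : ℝ) : ℂ) ^ (h (j + 2) - 1) * (1 - ((x j : ℝ) : ℂ)) ^ ((1 + w - h (j + 3)) - h (j + 2) - 1)) *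
          ((nestedQ (List.ofFn x) : ℝ) : ℂ) ^ (-h 1)) t := by
    filter_upwards [Ioi_mem_nhds (by linarith : L' < L' + 1)] with t ht
    rw [hreal t ht, hJfun]
  have hEq := eqOn_of_eventually_eq_ofReal hUo hUc hx₀ hf hg hev hv
  rw [hJfun v]
  simpa using hEq

end Literature.NumberTheory.Irrationality.Zudilin2004.VWPContinuationH0

end Part13

/-!
## Part 14 — port of `Summits/KontsevichZagierPeriods/Zeta5Search/DougallComplexSlices.lean` (2 declarations kept)

# Zudilin's (9) for complex `h₁, h₂, h₃` (real `h₀`), by slicing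

Declarations of this Part (verbatim port; each keeps its own docstring and citation): `slice`, `zudilin_nine_complex`.

Reference keys (see `references.bib` and the declarations' citations): [Bailey1935].
-/

section Part14

namespace Literature.NumberTheory.Irrationality.Zudilin2004.DougallComplexSlices

open _root_.Finset _root_.Filter _root_.Set _root_.Metric
open Literature.NumberTheory.Irrationality.Zudilin2004.DougallFullRange (zudilin_nine')
open Literature.NumberTheory.Irrationality.Zudilin2004.DougallComplexParameters (differentiableOn_series_cparam
  differentiableOn_gammaSide_cparam)

/-- **One-slot continuation.**  For complex co-parameters `h₀, h₂, h₃` with positive real parts: if (9) (in the slot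
`h₁`) holds at every REAL `h₁ = t` with `0 < t < 1 + Re h₀ − Re h₂ − Re h₃`, then it holds at every complex `h₁ = w` with
`0 < Re w < 1 + Re h₀ − Re h₂ − Re h₃` (both sides are holomorphic in `w` there; identity theorem from the real points).
[cite: Bailey1935, §4.4 (1)] -/
theorem slice (h₀ h₂ h₃ : ℂ) (hx₀ : 0 < h₀.re) (hx₂ : 0 < h₂.re) (hx₃ : 0 < h₃.re)
    (hreal : ∀ t : ℝ, 0 < t → t < 1 + h₀.re - h₂.re - h₃.re →
      ∑' μ : ℕ, (h₀ + 2 * μ) *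
          (Complex.Gamma (h₀ + μ) * Complex.Gamma ((t : ℂ) + μ) * Complex.Gamma (h₂ + μ) * Complex.Gamma (h₃ + μ)) /
          (Complex.Gamma ((μ : ℂ) + 1) * Complex.Gamma (h₀ - t + 1 + μ) * Complex.Gamma (h₀ - h₂ + 1 + μ) *
            Complex.Gamma (h₀ - h₃ + 1 + μ)) =
        Complex.Gamma t * Complex.Gamma h₂ * Complex.Gamma h₃ * Complex.Gamma (h₀ - t - h₂ - h₃ + 1) /
          (Complex.Gamma (h₀ - t - h₂ + 1) * Complex.Gamma (h₀ - t - h₃ + 1) * Complex.Gamma (h₀ - h₂ - h₃ + 1)))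
    {w : ℂ} (hw : 0 < w.re) (hw' : w.re < 1 + h₀.re - h₂.re - h₃.re) :
    ∑' μ : ℕ, (h₀ + 2 * μ) *
        (Complex.Gamma (h₀ + μ) * Complex.Gamma (w + μ) * Complex.Gamma (h₂ + μ) * Complex.Gamma (h₃ + μ)) /
        (Complex.Gamma ((μ : ℂ) + 1) * Complex.Gamma (h₀ - w + 1 + μ) * Complex.Gamma (h₀ - h₂ + 1 + μ) *
          Complex.Gamma (h₀ - h₃ + 1 + μ)) =
      Complex.Gamma w * Complex.Gamma h₂ * Complex.Gamma h₃ * Complex.Gamma (h₀ - w - h₂ - h₃ + 1) /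
        (Complex.Gamma (h₀ - w - h₂ + 1) * Complex.Gamma (h₀ - w - h₃ + 1) * Complex.Gamma (h₀ - h₂ - h₃ + 1)) := by
  set S : ℂ → ℂ := fun w : ℂ => ∑' μ : ℕ, (h₀ + 2 * μ) *
        (Complex.Gamma (h₀ + μ) * Complex.Gamma (w + μ) * Complex.Gamma (h₂ + μ) * Complex.Gamma (h₃ + μ)) /
        (Complex.Gamma ((μ : ℂ) + 1) * Complex.Gamma (h₀ - w + 1 + μ) * Complex.Gamma (h₀ - h₂ + 1 + μ) *
          Complex.Gamma (h₀ - h₃ + 1 + μ)) with hS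
  set G : ℂ → ℂ := fun w : ℂ => Complex.Gamma w * Complex.Gamma h₂ * Complex.Gamma h₃ *
        Complex.Gamma (h₀ - w - h₂ - h₃ + 1) /
        (Complex.Gamma (h₀ - w - h₂ + 1) * Complex.Gamma (h₀ - w - h₃ + 1) * Complex.Gamma (h₀ - h₂ - h₃ + 1)) with hG
  set D : Set ℂ := {w : ℂ | 0 < w.re ∧ w.re < 1 + h₀.re - h₂.re - h₃.re} with hD
  have hSD : DifferentiableOn ℂ S D := differentiableOn_series_cparam h₀ h₂ h₃ hx₀ hx₂ hx₃
  have hGD : DifferentiableOn ℂ G D := differentiableOn_gammaSide_cparam h₀ h₂ h₃ hx₂ hx₃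
  have hDo : IsOpen D :=
    (isOpen_lt continuous_const Complex.continuous_re).inter (isOpen_lt Complex.continuous_re continuous_const)
  have hDc : IsPreconnected D := ((convex_halfSpace_re_gt 0).inter (convex_halfSpace_re_lt _)).isPreconnected
  have hx : (((1 + h₀.re - h₂.re - h₃.re) / 2 : ℝ) : ℂ) ∈ D := ⟨by simp; linarith, by simp; linarith⟩
  have hEq : EqOn S G D := by
    refine Literature.Analysis.Complex.eqOn_of_isPreconnected_of_eq_ofReal hDo hDc hx hSD hGD fun t ht => ?_
    obtain ⟨ht0, ht1⟩ := ht
    simp only [Complex.ofReal_re] at ht0 ht1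
    exact hreal t ht0 ht1
  exact hEq (show w ∈ D from ⟨hw, hw'⟩)

/-- **Zudilin's (9) for complex `h₁, h₂, h₃`** (real `h₀ > 0`, `Re hⱼ > 0`, `Re h₁ + Re h₂ + Re h₃ < 1 + h₀`):
`Σ_μ (h₀+2μ)Γ(h₀+μ)Γ(h₁+μ)Γ(h₂+μ)Γ(h₃+μ)/(Γ(μ+1)Γ(h₀−h₁+1+μ)Γ(h₀−h₂+1+μ)Γ(h₀−h₃+1+μ))
 = Γ(h₁)Γ(h₂)Γ(h₃)Γ(h₀−h₁−h₂−h₃+1)/(Γ(h₀−h₁−h₂+1)Γ(h₀−h₁−h₃+1)Γ(h₀−h₂−h₃+1))` — three slices (`h₁`, `h₂`, `h₃`) of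
`slice`, anchored at `zudilin_nine'`, using the symmetry of both sides in `(h₁, h₂, h₃)`. [cite: Bailey1935, §4.4 (1)] -/
theorem zudilin_nine_complex (h₀ : ℝ) (h₁ h₂ h₃ : ℂ) (hh₀ : 0 < h₀) (hx₁ : 0 < h₁.re) (hx₂ : 0 < h₂.re)
    (hx₃ : 0 < h₃.re) (hs : h₁.re + h₂.re + h₃.re < 1 + h₀) :
    ∑' μ : ℕ, ((h₀ : ℂ) + 2 * μ) *
        (Complex.Gamma ((h₀ : ℂ) + μ) * Complex.Gamma (h₁ + μ) * Complex.Gamma (h₂ + μ) * Complex.Gamma (h₃ + μ)) /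
        (Complex.Gamma ((μ : ℂ) + 1) * Complex.Gamma ((h₀ : ℂ) - h₁ + 1 + μ) * Complex.Gamma ((h₀ : ℂ) - h₂ + 1 + μ) *
          Complex.Gamma ((h₀ : ℂ) - h₃ + 1 + μ)) =
      Complex.Gamma h₁ * Complex.Gamma h₂ * Complex.Gamma h₃ * Complex.Gamma ((h₀ : ℂ) - h₁ - h₂ - h₃ + 1) /
        (Complex.Gamma ((h₀ : ℂ) - h₁ - h₂ + 1) * Complex.Gamma ((h₀ : ℂ) - h₁ - h₃ + 1) *
          Complex.Gamma ((h₀ : ℂ) - h₂ - h₃ + 1)) := by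
  have hx₀ : 0 < ((h₀ : ℂ)).re := by simpa using hh₀
  -- slice 1: complex `h₁`, real `h₂ = a`, `h₃ = b`
  have stepA : ∀ (a b : ℝ), 0 < a → 0 < b → ∀ w : ℂ, 0 < w.re → w.re < 1 + h₀ - a - b →
      ∑' μ : ℕ, ((h₀ : ℂ) + 2 * μ) *
          (Complex.Gamma ((h₀ : ℂ) + μ) * Complex.Gamma (w + μ) * Complex.Gamma ((a : ℂ) + μ) *
            Complex.Gamma ((b : ℂ) + μ)) /
          (Complex.Gamma ((μ : ℂ) + 1) * Complex.Gamma ((h₀ : ℂ) - w + 1 + μ) * Complex.Gamma ((h₀ : ℂ) - a + 1 + μ) *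
            Complex.Gamma ((h₀ : ℂ) - b + 1 + μ)) =
        Complex.Gamma w * Complex.Gamma a * Complex.Gamma b * Complex.Gamma ((h₀ : ℂ) - w - a - b + 1) /
          (Complex.Gamma ((h₀ : ℂ) - w - a + 1) * Complex.Gamma ((h₀ : ℂ) - w - b + 1) *
            Complex.Gamma ((h₀ : ℂ) - a - b + 1)) := by
    intro a b ha hb w hw hw'
    refine slice (h₀ : ℂ) (a : ℂ) (b : ℂ) hx₀ (by simpa using ha) (by simpa using hb) (fun t ht ht' => ?_) hw
      (by simpa using hw')
    simp only [Complex.ofReal_re] at ht'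
    exact zudilin_nine' h₀ t a b hh₀ ht ha hb (by linarith)
  -- slice 2: complex `h₂ = p` (slot 1 real anchor from slice 1 by the symmetry `h₁ ↔ h₂`), real `h₃ = b`
  have stepB : ∀ (p : ℂ) (b : ℝ), 0 < p.re → 0 < b → ∀ w : ℂ, 0 < w.re → w.re < 1 + h₀ - p.re - b →
      ∑' μ : ℕ, ((h₀ : ℂ) + 2 * μ) *
          (Complex.Gamma ((h₀ : ℂ) + μ) * Complex.Gamma (w + μ) * Complex.Gamma (p + μ) *
            Complex.Gamma ((b : ℂ) + μ)) /
          (Complex.Gamma ((μ : ℂ) + 1) * Complex.Gamma ((h₀ : ℂ) - w + 1 + μ) * Complex.Gamma ((h₀ : ℂ) - p + 1 + μ) *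
            Complex.Gamma ((h₀ : ℂ) - b + 1 + μ)) =
        Complex.Gamma w * Complex.Gamma p * Complex.Gamma b * Complex.Gamma ((h₀ : ℂ) - w - p - b + 1) /
          (Complex.Gamma ((h₀ : ℂ) - w - p + 1) * Complex.Gamma ((h₀ : ℂ) - w - b + 1) *
            Complex.Gamma ((h₀ : ℂ) - p - b + 1)) := by
    intro p b hp hb w hw hw'
    refine slice (h₀ : ℂ) p (b : ℂ) hx₀ hp (by simpa using hb) (fun t ht ht' => ?_) hw (by simpa using hw')
    simp only [Complex.ofReal_re] at ht'
    have key := stepA t b ht hb p hp (by linarith)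
    convert key using 1
    · exact tsum_congr fun μ => by ring
    · ring_nf
  -- slice 3: complex `h₃ = q` (anchor from slice 2 by the symmetry `h₁ ↔ h₃`)
  have stepC : ∀ (p q : ℂ), 0 < p.re → 0 < q.re → ∀ w : ℂ, 0 < w.re → w.re < 1 + h₀ - p.re - q.re →
      ∑' μ : ℕ, ((h₀ : ℂ) + 2 * μ) *
          (Complex.Gamma ((h₀ : ℂ) + μ) * Complex.Gamma (w + μ) * Complex.Gamma (p + μ) * Complex.Gamma (q + μ)) /
          (Complex.Gamma ((μ : ℂ) + 1) * Complex.Gamma ((h₀ : ℂ) - w + 1 + μ) * Complex.Gamma ((h₀ : ℂ) - p + 1 + μ) *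
            Complex.Gamma ((h₀ : ℂ) - q + 1 + μ)) =
        Complex.Gamma w * Complex.Gamma p * Complex.Gamma q * Complex.Gamma ((h₀ : ℂ) - w - p - q + 1) /
          (Complex.Gamma ((h₀ : ℂ) - w - p + 1) * Complex.Gamma ((h₀ : ℂ) - w - q + 1) *
            Complex.Gamma ((h₀ : ℂ) - p - q + 1)) := by
    intro p q hp hq w hw hw'
    refine slice (h₀ : ℂ) p q hx₀ hp hq (fun t ht ht' => ?_) hw (by simpa using hw')
    simp only [Complex.ofReal_re] at ht'
    have key := stepB p t hp ht q hq (by linarith)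
    convert key using 1
    · exact tsum_congr fun μ => by ring
    · ring_nf
  exact stepC h₂ h₃ hx₂ hx₃ h₁ hx₁ (by linarith)

end Literature.NumberTheory.Irrationality.Zudilin2004.DougallComplexSlices

end Part14

/-!
## Part 15 — port of `Summits/KontsevichZagierPeriods/Zeta5Search/DougallComplexH0.lean` (2 declarations kept)

# Zudilin's (9) with all four parameters complex: the slot `h₀`

Declarations of this Part (verbatim port; each keeps its own docstring and citation): `differentiableOn_series_h0`, `zudilin_nine_complex'`.

Reference keys (see `references.bib` and the declarations' citations): [Zudilin2004].
-/

section Part15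

namespace Literature.NumberTheory.Irrationality.Zudilin2004.DougallComplexH0

open _root_.Finset _root_.Filter _root_.Set _root_.Metric
open Literature.NumberTheory.Irrationality.Zudilin2004.HypergeometricWhipple (rf rf_zero rf_succ)
open Literature.NumberTheory.Irrationality.Zudilin2004.DougallCoefficientBounds (Gamma_add_nat_eq Gamma_ratio_le)
open Literature.NumberTheory.Irrationality.Zudilin2004.DougallParameterHolomorphy (prod_re_le_norm_rf norm_Gamma_add_nat_le)
open Literature.NumberTheory.Irrationality.Zudilin2004.DougallComplexParameters (norm_inv_Gamma_add_nat_le)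
open Literature.NumberTheory.Irrationality.Zudilin2004.DougallComplexSlices (zudilin_nine_complex)
open Literature.NumberTheory.Irrationality.BrownZudilin2022.BarnesMellin (ne_neg_nat_of_re_pos)
open Literature.NumberTheory.LFunctions (norm_Gamma_le_Gamma_re)

/-- **Holomorphy of the series of (9) in `v = h₀`** (complex `h₁, h₂, h₃` with positive real parts) on
`E = {Re(h₁+h₂+h₃) − 1 < Re v, 0 < Re v}`: Weierstrass M-test on small balls against `summable_gammaRatios`.
[cite: Zudilin2004, §4 (supporting lemma)] -/
theorem differentiableOn_series_h0 (h₁ h₂ h₃ : ℂ) (hx₁ : 0 < h₁.re) (hx₂ : 0 < h₂.re) (hx₃ : 0 < h₃.re) :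
    DifferentiableOn ℂ (fun v : ℂ => ∑' μ : ℕ, (v + 2 * μ) *
        (Complex.Gamma (v + μ) * Complex.Gamma (h₁ + μ) * Complex.Gamma (h₂ + μ) * Complex.Gamma (h₃ + μ)) /
        (Complex.Gamma ((μ : ℂ) + 1) * Complex.Gamma (v - h₁ + 1 + μ) * Complex.Gamma (v - h₂ + 1 + μ) *
          Complex.Gamma (v - h₃ + 1 + μ)))
      {v : ℂ | h₁.re + h₂.re + h₃.re - 1 < v.re ∧ 0 < v.re} := by
  intro v₀ hv₀
  obtain ⟨hs₀, hp₀⟩ := hv₀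
  set g : ℝ := 1 + v₀.re - (h₁.re + h₂.re + h₃.re) with hg
  have hgpos : 0 < g := by rw [hg]; linarith
  set δ : ℝ := min (v₀.re / 2) (g / 4) with hδ
  have hδpos : 0 < δ := lt_min (by linarith) (by linarith)
  have hδ1 : δ ≤ v₀.re / 2 := min_le_left _ _
  have hδ2 : δ ≤ g / 4 := min_le_right _ _
  set xl : ℝ := v₀.re - δ with hxl
  set xu : ℝ := v₀.re + δ with hxu
  have hxl0 : 0 < xl := by rw [hxl]; linarith
  have hb₁ : 0 < xl - h₁.re + 1 := by rw [hxl]; linarith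
  have hb₂ : 0 < xl - h₂.re + 1 := by rw [hxl]; linarith
  have hb₃ : 0 < xl - h₃.re + 1 := by rw [hxl]; linarith
  have hexp : xu + (h₁.re - (xl - h₁.re + 1)) + (h₂.re - (xl - h₂.re + 1)) + (h₃.re - (xl - h₃.re + 1)) < -1 := by
    rw [hxu, hxl]; linarith
  have hre : ∀ v ∈ ball v₀ δ, xl < v.re ∧ v.re < xu := by
    intro v hv
    rw [mem_ball, dist_eq_norm] at hv
    have h1 := Complex.abs_re_le_norm (v - v₀)
    simp only [Complex.sub_re] at h1
    have h2 := abs_lt.1 (lt_of_le_of_lt h1 hv)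
    constructor
    · rw [hxl]; linarith [h2.1]
    · rw [hxu]; linarith [h2.2]
  set R : ℝ := ‖v₀‖ + δ with hR
  have hRnn : 0 ≤ R := by positivity
  have hnorm : ∀ v ∈ ball v₀ δ, ‖v‖ ≤ R := by
    intro v hv
    rw [mem_ball, dist_eq_norm] at hv
    have := norm_le_norm_add_norm_sub' v v₀  -- ‖v‖ ≤ ‖v₀‖ + ‖v - v₀‖
    rw [hR]; linarith
  obtain ⟨MΓ, hMΓ⟩ : ∃ M : ℝ, ∀ x ∈ Icc xl xu, Real.Gamma x ≤ M := by
    have hc : ContinuousOn Real.Gamma (Icc xl xu) := fun x hx =>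
      (Real.differentiableAt_Gamma fun m => by
        have : 0 < x := lt_of_lt_of_le hxl0 hx.1
        intro h; rw [h] at this
        have := m.cast_nonneg (α := ℝ); linarith).continuousAt.continuousWithinAt
    obtain ⟨M, hM⟩ := isCompact_Icc.exists_bound_of_continuousOn hc
    exact ⟨M, fun x hx => (le_abs_self _).trans (by simpa [Real.norm_eq_abs] using hM x hx)⟩
  have hMΓ0 : 0 ≤ MΓ :=
    (Real.Gamma_pos_of_pos hp₀).le.trans (hMΓ v₀.re ⟨by rw [hxl]; linarith, by rw [hxu]; linarith⟩)
  -- bounds `Mⱼ` for `‖Γ(v−hⱼ+1)⁻¹‖` on the closed ball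
  have hMj : ∀ h : ℂ, ∃ M : ℝ, 0 ≤ M ∧ ∀ v ∈ closedBall v₀ δ, ‖(Complex.Gamma (v - h + 1))⁻¹‖ ≤ M := by
    intro h
    have hd : Differentiable ℂ fun v : ℂ => v - h + 1 := by fun_prop
    have hc : Continuous fun v : ℂ => (Complex.Gamma (v - h + 1))⁻¹ :=
      (Complex.differentiable_one_div_Gamma.comp hd).continuous
    obtain ⟨M, hM⟩ := (isCompact_closedBall v₀ δ).exists_bound_of_continuousOn hc.continuousOn
    exact ⟨M, (norm_nonneg _).trans (hM v₀ (mem_closedBall_self hδpos.le)), hM⟩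
  obtain ⟨M₁, hM₁0, hM₁⟩ := hMj h₁
  obtain ⟨M₂, hM₂0, hM₂⟩ := hMj h₂
  obtain ⟨M₃, hM₃0, hM₃⟩ := hMj h₃
  -- the majorant
  set u : ℕ → ℝ := fun μ => ((R + 2 * μ) * ((MΓ * ∏ i ∈ range μ, (xu + i)) * Real.Gamma (h₁.re + μ) *
      Real.Gamma (h₂.re + μ) * Real.Gamma (h₃.re + μ))) *
    ((Real.Gamma ((μ : ℝ) + 1))⁻¹ * (M₁ / ∏ i ∈ range μ, (xl - h₁.re + 1 + i)) *
      (M₂ / ∏ i ∈ range μ, (xl - h₂.re + 1 + i)) * (M₃ / ∏ i ∈ range μ, (xl - h₃.re + 1 + i))) with hu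
  have hsum : Summable u := by
    have h4 := (summable_gammaRatios R xu h₁.re h₂.re h₃.re (xl - h₁.re + 1) (xl - h₂.re + 1) (xl - h₃.re + 1)
      hRnn (by linarith) hx₁ hx₂ hx₃ hb₁ hb₂ hb₃ hexp).mul_left
      (MΓ * M₁ * M₂ * M₃ * Real.Gamma (xl - h₁.re + 1) * Real.Gamma (xl - h₂.re + 1) * Real.Gamma (xl - h₃.re + 1) /
        Real.Gamma xu)
    refine h4.congr fun μ => ?_
    have hΓxu : Real.Gamma xu ≠ 0 := (Real.Gamma_pos_of_pos (by linarith)).ne'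
    have hΓ1 : Real.Gamma (xl - h₁.re + 1) ≠ 0 := (Real.Gamma_pos_of_pos hb₁).ne'
    have hΓ2 : Real.Gamma (xl - h₂.re + 1) ≠ 0 := (Real.Gamma_pos_of_pos hb₂).ne'
    have hΓ3 : Real.Gamma (xl - h₃.re + 1) ≠ 0 := (Real.Gamma_pos_of_pos hb₃).ne'
    have hΓμ : Real.Gamma ((μ : ℝ) + 1) ≠ 0 := (Real.Gamma_pos_of_pos (by positivity)).ne'
    have P1 : ∏ i ∈ range μ, (xl - h₁.re + 1 + i) ≠ 0 :=
      (Finset.prod_pos fun i _ => by linarith [i.cast_nonneg (α := ℝ)]).ne'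
    have P2 : ∏ i ∈ range μ, (xl - h₂.re + 1 + i) ≠ 0 :=
      (Finset.prod_pos fun i _ => by linarith [i.cast_nonneg (α := ℝ)]).ne'
    have P3 : ∏ i ∈ range μ, (xl - h₃.re + 1 + i) ≠ 0 :=
      (Finset.prod_pos fun i _ => by linarith [i.cast_nonneg (α := ℝ)]).ne'
    rw [hu]
    simp only
    rw [Gamma_add_nat_eq xu (by linarith) μ, Gamma_add_nat_eq (xl - h₁.re + 1) hb₁ μ,
      Gamma_add_nat_eq (xl - h₂.re + 1) hb₂ μ, Gamma_add_nat_eq (xl - h₃.re + 1) hb₃ μ]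
    field_simp
  have hdiff : DifferentiableOn ℂ (fun v : ℂ => ∑' μ : ℕ, (v + 2 * μ) *
        (Complex.Gamma (v + μ) * Complex.Gamma (h₁ + μ) * Complex.Gamma (h₂ + μ) * Complex.Gamma (h₃ + μ)) /
        (Complex.Gamma ((μ : ℂ) + 1) * Complex.Gamma (v - h₁ + 1 + μ) * Complex.Gamma (v - h₂ + 1 + μ) *
          Complex.Gamma (v - h₃ + 1 + μ))) (ball v₀ δ) := by
    refine Complex.differentiableOn_tsum_of_summable_norm hsum (fun μ v hv => ?_) isOpen_ball (fun μ v hv => ?_)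
    · obtain ⟨h1, h2⟩ := hre v hv
      exact (differentiableAt_term_h0 h₁ h₂ h₃ μ (by linarith) (by linarith) (by linarith)
        (by linarith)).differentiableWithinAt
    · obtain ⟨h1, h2⟩ := hre v hv
      have hvpos : 0 < v.re := by linarith
      -- numerator and denominator
      have nv : ‖v + 2 * μ‖ ≤ R + 2 * μ := by
        calc ‖v + 2 * μ‖ ≤ ‖v‖ + ‖(2 * μ : ℂ)‖ := norm_add_le _ _
          _ = ‖v‖ + 2 * μ := by
              rw [show (2 * μ : ℂ) = ((2 * μ : ℝ) : ℂ) by push_cast; ring, Complex.norm_real,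
                Real.norm_of_nonneg (by positivity)]
          _ ≤ R + 2 * μ := by linarith [hnorm v hv]
      have n0 : ‖Complex.Gamma (v + μ)‖ ≤ MΓ * ∏ i ∈ range μ, (xu + i) := by
        refine (norm_Gamma_add_nat_le hvpos μ).trans ?_
        exact mul_le_mul (hMΓ v.re ⟨h1.le, h2.le⟩) (Finset.prod_le_prod (fun i _ => by positivity)
          fun i _ => by linarith) (Finset.prod_nonneg fun i _ => by positivity) hMΓ0
      have nj : ∀ {h : ℂ}, 0 < h.re → ‖Complex.Gamma (h + μ)‖ ≤ Real.Gamma (h.re + μ) := by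
        intro h hh
        simpa using norm_Gamma_le_Gamma_re (s := h + μ) (by simp; positivity)
      have hN : ‖(v + 2 * μ) *
          (Complex.Gamma (v + μ) * Complex.Gamma (h₁ + μ) * Complex.Gamma (h₂ + μ) * Complex.Gamma (h₃ + μ))‖ ≤
          (R + 2 * μ) * ((MΓ * ∏ i ∈ range μ, (xu + i)) * Real.Gamma (h₁.re + μ) *
            Real.Gamma (h₂.re + μ) * Real.Gamma (h₃.re + μ)) := by
        rw [norm_mul, norm_mul, norm_mul, norm_mul]
        have G1 := Real.Gamma_pos_of_pos (show 0 < h₁.re + μ by positivity)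
        have G2 := Real.Gamma_pos_of_pos (show 0 < h₂.re + μ by positivity)
        have hP : 0 ≤ MΓ * ∏ i ∈ range μ, (xu + i) := mul_nonneg hMΓ0 (Finset.prod_nonneg fun i _ => by positivity)
        refine mul_le_mul nv ?_ (by positivity) (by positivity)
        exact mul_le_mul (mul_le_mul (mul_le_mul n0 (nj hx₁) (norm_nonneg _) hP) (nj hx₂) (norm_nonneg _)
          (by positivity)) (nj hx₃) (norm_nonneg _) (by positivity)
      have dμ : ‖(Complex.Gamma ((μ : ℂ) + 1))⁻¹‖ = (Real.Gamma ((μ : ℝ) + 1))⁻¹ := by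
        rw [norm_inv, Complex.Gamma_nat_eq_factorial, Real.Gamma_nat_eq_factorial, Complex.norm_natCast]
      have dj : ∀ {h : ℂ} {M : ℝ}, 0 ≤ M → (∀ v ∈ closedBall v₀ δ, ‖(Complex.Gamma (v - h + 1))⁻¹‖ ≤ M) →
          0 < xl - h.re + 1 →
          ‖(Complex.Gamma (v - h + 1 + μ))⁻¹‖ ≤ M / ∏ i ∈ range μ, (xl - h.re + 1 + i) := by
        intro h M hM0 hM hb
        have hζ : 0 < (v - h + 1).re := by simp; linarith
        refine (norm_inv_Gamma_add_nat_le hζ μ).trans ?_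
        simp only [Complex.add_re, Complex.sub_re, Complex.one_re]
        exact div_le_div₀ hM0 (hM v (ball_subset_closedBall hv))
          (Finset.prod_pos fun i _ => by linarith [i.cast_nonneg (α := ℝ)])
          (Finset.prod_le_prod (fun i _ => by linarith [i.cast_nonneg (α := ℝ)]) fun i _ => by linarith)
      have b1 := dj hM₁0 hM₁ hb₁
      have b2 := dj hM₂0 hM₂ hb₂
      have b3 := dj hM₃0 hM₃ hb₃
      have Q1 : 0 ≤ M₁ / ∏ i ∈ range μ, (xl - h₁.re + 1 + i) :=
        div_nonneg hM₁0 (Finset.prod_nonneg fun i _ => by linarith [i.cast_nonneg (α := ℝ)])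
      have Q2 : 0 ≤ M₂ / ∏ i ∈ range μ, (xl - h₂.re + 1 + i) :=
        div_nonneg hM₂0 (Finset.prod_nonneg fun i _ => by linarith [i.cast_nonneg (α := ℝ)])
      have hD : ‖(Complex.Gamma ((μ : ℂ) + 1) * Complex.Gamma (v - h₁ + 1 + μ) * Complex.Gamma (v - h₂ + 1 + μ) *
          Complex.Gamma (v - h₃ + 1 + μ))⁻¹‖ ≤
          (Real.Gamma ((μ : ℝ) + 1))⁻¹ * (M₁ / ∏ i ∈ range μ, (xl - h₁.re + 1 + i)) *
            (M₂ / ∏ i ∈ range μ, (xl - h₂.re + 1 + i)) * (M₃ / ∏ i ∈ range μ, (xl - h₃.re + 1 + i)) := by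
        rw [mul_inv, mul_inv, mul_inv, norm_mul, norm_mul, norm_mul, dμ]
        have G0 : 0 ≤ (Real.Gamma ((μ : ℝ) + 1))⁻¹ := (inv_pos.2 (Real.Gamma_pos_of_pos (by positivity))).le
        exact mul_le_mul (mul_le_mul (mul_le_mul_of_nonneg_left b1 G0) b2 (norm_nonneg _) (mul_nonneg G0 Q1)) b3
          (norm_nonneg _) (mul_nonneg (mul_nonneg G0 Q1) Q2)
      rw [div_eq_mul_inv, norm_mul, hu]
      exact mul_le_mul hN hD (norm_nonneg _) (by positivity)
  exact (hdiff.differentiableAt (isOpen_ball.mem_nhds (mem_ball_self hδpos))).differentiableWithinAt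

/-- **Zudilin's (9) = Dougall's `₅F₄` sum in Gamma form for COMPLEX parameters**: for `h₀, h₁, h₂, h₃ ∈ ℂ` with
`Re hⱼ > 0` (`j = 0,…,3`) and `Re h₁ + Re h₂ + Re h₃ < 1 + Re h₀`,
`Σ_μ (h₀+2μ)Γ(h₀+μ)Γ(h₁+μ)Γ(h₂+μ)Γ(h₃+μ)/(Γ(μ+1)Γ(h₀−h₁+1+μ)Γ(h₀−h₂+1+μ)Γ(h₀−h₃+1+μ))
 = Γ(h₁)Γ(h₂)Γ(h₃)Γ(h₀−h₁−h₂−h₃+1)/(Γ(h₀−h₁−h₂+1)Γ(h₀−h₁−h₃+1)Γ(h₀−h₂−h₃+1))` — the slice in `h₀` of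
`DougallComplexSlices.zudilin_nine_complex` (identity theorem from the real points of the half-strip
`{Re v > max(0, Re(h₁+h₂+h₃) − 1)}`). [cite: Bailey1935, §4.4 (1)] -/
theorem zudilin_nine_complex' (h₀ h₁ h₂ h₃ : ℂ) (hx₀ : 0 < h₀.re) (hx₁ : 0 < h₁.re) (hx₂ : 0 < h₂.re)
    (hx₃ : 0 < h₃.re) (hs : h₁.re + h₂.re + h₃.re < 1 + h₀.re) :
    ∑' μ : ℕ, (h₀ + 2 * μ) *
        (Complex.Gamma (h₀ + μ) * Complex.Gamma (h₁ + μ) * Complex.Gamma (h₂ + μ) * Complex.Gamma (h₃ + μ)) /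
        (Complex.Gamma ((μ : ℂ) + 1) * Complex.Gamma (h₀ - h₁ + 1 + μ) * Complex.Gamma (h₀ - h₂ + 1 + μ) *
          Complex.Gamma (h₀ - h₃ + 1 + μ)) =
      Complex.Gamma h₁ * Complex.Gamma h₂ * Complex.Gamma h₃ * Complex.Gamma (h₀ - h₁ - h₂ - h₃ + 1) /
        (Complex.Gamma (h₀ - h₁ - h₂ + 1) * Complex.Gamma (h₀ - h₁ - h₃ + 1) * Complex.Gamma (h₀ - h₂ - h₃ + 1)) := by
  set S : ℂ → ℂ := fun v : ℂ => ∑' μ : ℕ, (v + 2 * μ) *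
        (Complex.Gamma (v + μ) * Complex.Gamma (h₁ + μ) * Complex.Gamma (h₂ + μ) * Complex.Gamma (h₃ + μ)) /
        (Complex.Gamma ((μ : ℂ) + 1) * Complex.Gamma (v - h₁ + 1 + μ) * Complex.Gamma (v - h₂ + 1 + μ) *
          Complex.Gamma (v - h₃ + 1 + μ)) with hS
  set G : ℂ → ℂ := fun v : ℂ => Complex.Gamma h₁ * Complex.Gamma h₂ * Complex.Gamma h₃ *
        Complex.Gamma (v - h₁ - h₂ - h₃ + 1) /
        (Complex.Gamma (v - h₁ - h₂ + 1) * Complex.Gamma (v - h₁ - h₃ + 1) * Complex.Gamma (v - h₂ - h₃ + 1)) with hG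
  set E : Set ℂ := {v : ℂ | h₁.re + h₂.re + h₃.re - 1 < v.re ∧ 0 < v.re} with hE
  have hSE : DifferentiableOn ℂ S E := differentiableOn_series_h0 h₁ h₂ h₃ hx₁ hx₂ hx₃
  have hGE : DifferentiableOn ℂ G E := differentiableOn_gammaSide_h0 h₁ h₂ h₃ hx₁ hx₂ hx₃
  have hEo : IsOpen E :=
    (isOpen_lt continuous_const Complex.continuous_re).inter (isOpen_lt continuous_const Complex.continuous_re)
  have hEc : IsPreconnected E := ((convex_halfSpace_re_gt _).inter (convex_halfSpace_re_gt 0)).isPreconnected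
  have hx : (((h₁.re + h₂.re + h₃.re + 1 : ℝ)) : ℂ) ∈ E := ⟨by simp; linarith, by simp; linarith⟩
  have hEq : EqOn S G E := by
    refine Literature.Analysis.Complex.eqOn_of_isPreconnected_of_eq_ofReal hEo hEc hx hSE hGE fun t ht => ?_
    obtain ⟨ht0, ht1⟩ := ht
    simp only [Complex.ofReal_re] at ht0 ht1
    exact zudilin_nine_complex t h₁ h₂ h₃ ht1 hx₁ hx₂ hx₃ (by linarith)
  exact hEq (show h₀ ∈ E from ⟨by linarith, hx₀⟩)

end Literature.NumberTheory.Irrationality.Zudilin2004.DougallComplexH0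

end Part15

/-!
## Part 16 — port of `Summits/KontsevichZagierPeriods/Zeta5Search/VWPBaseCase.lean` (2 declarations kept)

# The base case `S(1)` of Zudilin's identity (4) at complex parameters

Declarations of this Part (verbatim port; each keeps its own docstring and citation): `F_three_eq`, `S_one`.

Reference keys (see `references.bib` and the declarations' citations): [Zudilin2004].
-/

section Part16

namespace Literature.NumberTheory.Irrationality.Zudilin2004.VWPBaseCase

open _root_.MeasureTheory _root_.Set
open Literature.NumberTheory.Irrationality.Zudilin2002 (nestedQ)
open Literature.NumberTheory.Irrationality.Zudilin2004.DougallComplexH0 (zudilin_nine_complex')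
open Literature.NumberTheory.Irrationality.BrownZudilin2022.BarnesCube (integral_beta_Ioo)

/-- **`F₃` in the typed shape, complex parameters** (Dougall): for `Re g_i > 0` (`i ≤ 3`) and `Re(g₁+g₂+g₃) < 1 + Re g₀`,
`Σ_μ (g₀+2μ)∏_{i<4}Γ(g_i+μ)/Γ(1+g₀−g_i+μ)·(−1)^{4μ} = Γ(g₁)Γ(g₂)Γ(g₃)Γ(g₀−g₁−g₂−g₃+1)/(Γ(g₀−g₁−g₂+1)Γ(g₀−g₁−g₃+1)Γ(g₀−g₂−g₃+1))`.
[cite: Zudilin2004, §4 (supporting lemma)] -/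
theorem F_three_eq (g : ℕ → ℂ) (h0 : 0 < (g 0).re) (h1 : 0 < (g 1).re) (h2 : 0 < (g 2).re) (h3 : 0 < (g 3).re)
    (hs : (g 1).re + (g 2).re + (g 3).re < 1 + (g 0).re) :
    ∑' μ : ℕ, (g 0 + 2 * (μ : ℂ)) * (∏ i ∈ Finset.range 4, Complex.Gamma (g i + μ) / Complex.Gamma (1 + g 0 - g i + μ)) *
        (-1 : ℂ) ^ ((1 + 3) * μ) =
      Complex.Gamma (g 1) * Complex.Gamma (g 2) * Complex.Gamma (g 3) * Complex.Gamma (g 0 - g 1 - g 2 - g 3 + 1) /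
        (Complex.Gamma (g 0 - g 1 - g 2 + 1) * Complex.Gamma (g 0 - g 1 - g 3 + 1) * Complex.Gamma (g 0 - g 2 - g 3 + 1)) := by
  rw [← zudilin_nine_complex' (g 0) (g 1) (g 2) (g 3) h0 h1 h2 h3 hs]
  refine tsum_congr fun μ => ?_
  have hpow : (-1 : ℂ) ^ ((1 + 3) * μ) = 1 := by
    rw [show (1 + 3) * μ = 2 * (2 * μ) by ring, pow_mul]; norm_num
  rw [hpow, mul_one]
  simp only [Finset.prod_range_succ, Finset.prod_range_zero, one_mul]
  rw [show (1 : ℂ) + g 0 - g 0 + μ = (μ : ℂ) + 1 by ring, show (1 : ℂ) + g 0 - g 1 + μ = g 0 - g 1 + 1 + μ by ring,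
    show (1 : ℂ) + g 0 - g 2 + μ = g 0 - g 2 + 1 + μ by ring, show (1 : ℂ) + g 0 - g 3 + μ = g 0 - g 3 + 1 + μ by ring]
  ring

/-- **The base case `S(1)(g)` at complex parameters** [Zudilin math/0206177, Lemma 1 = Dougall + Beta]: for `g : ℕ → ℂ` with
`Re g_i > 0` (`i ≤ 3`) and `Re(g₁+g₂+g₃) < 1 + Re g₀`, in the typed shapes,
`(∏_{i∈Icc 1 2}Γ(1+g₀−g_i−g_{i+1}))/(Γ(g₁)Γ(g₃)) · Σ_μ (g₀+2μ)∏_{i<4}Γ(g_i+μ)/Γ(1+g₀−g_i+μ)(−1)^{4μ}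
   = ∫_{[0,1]^1} ∏_{j:Fin 1} x_j^{g_{j+2}−1}(1−x_j)^{(1+g₀−g_{j+3})−g_{j+2}−1} Q₁^{−g₁}`.
[cite: Zudilin2004, §4 (supporting lemma)] -/
theorem S_one (g : ℕ → ℂ) (h0 : 0 < (g 0).re) (h1 : 0 < (g 1).re) (h2 : 0 < (g 2).re) (h3 : 0 < (g 3).re)
    (hs : (g 1).re + (g 2).re + (g 3).re < 1 + (g 0).re) :
    (∏ i ∈ Finset.Icc 1 (1 + 1), Complex.Gamma (1 + g 0 - g i - g (i + 1))) / (Complex.Gamma (g 1) * Complex.Gamma (g (1 + 2))) *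
        (∑' μ : ℕ, (g 0 + 2 * (μ : ℂ)) * (∏ i ∈ Finset.range (1 + 3), Complex.Gamma (g i + μ) / Complex.Gamma (1 + g 0 - g i + μ)) *
          (-1 : ℂ) ^ ((1 + 3) * μ)) =
      ∫ x in Set.pi univ (fun _ : Fin 1 => Icc (0 : ℝ) 1),
        (∏ j : Fin 1, ((x j : ℝ) : ℂ) ^ (g (j + 2) - 1) * (1 - ((x j : ℝ) : ℂ)) ^ ((1 + g 0 - g (j + 3)) - g (j + 2) - 1)) *
          ((nestedQ (List.ofFn x) : ℝ) : ℂ) ^ (-g 1) := by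
  have hJ := J_one_eq (g 1) (g 2) (1 + g 0 - g 3) h2 (by simp; linarith)
  have hJ' : (∫ x in Set.pi univ (fun _ : Fin 1 => Icc (0 : ℝ) 1),
        (∏ j : Fin 1, ((x j : ℝ) : ℂ) ^ (g (j + 2) - 1) * (1 - ((x j : ℝ) : ℂ)) ^ ((1 + g 0 - g (j + 3)) - g (j + 2) - 1)) *
          ((nestedQ (List.ofFn x) : ℝ) : ℂ) ^ (-g 1)) =
      Complex.Gamma (g 2) * Complex.Gamma (1 + g 0 - g 3 - g 2 - g 1) / Complex.Gamma (1 + g 0 - g 3 - g 1) := by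
    rw [← hJ]
    refine setIntegral_congr_fun (MeasurableSet.univ_pi fun _ => measurableSet_Icc) fun x _ => ?_
    simp
  rw [hJ', show 1 + 3 = 4 by rfl, F_three_eq g h0 h1 h2 h3 hs]
  have hI : Finset.Icc 1 (1 + 1) = {1, 2} := by decide
  rw [hI, Finset.prod_insert (by decide), Finset.prod_singleton]
  have hΓ1 : Complex.Gamma (g 1) ≠ 0 := Complex.Gamma_ne_zero_of_re_pos h1
  have hΓ3 : Complex.Gamma (g (1 + 2)) ≠ 0 := Complex.Gamma_ne_zero_of_re_pos (by simpa using h3)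
  have hΓ12 : Complex.Gamma (g 0 - g 1 - g 2 + 1) ≠ 0 := Complex.Gamma_ne_zero_of_re_pos (by simp; linarith)
  have hΓ13 : Complex.Gamma (g 0 - g 1 - g 3 + 1) ≠ 0 := Complex.Gamma_ne_zero_of_re_pos (by simp; linarith)
  have hΓ23 : Complex.Gamma (g 0 - g 2 - g 3 + 1) ≠ 0 := Complex.Gamma_ne_zero_of_re_pos (by simp; linarith)
  rw [show (1 : ℂ) + g 0 - g 1 - g (1 + 1) = g 0 - g 1 - g 2 + 1 by norm_num; ring,
    show (1 : ℂ) + g 0 - g 2 - g (2 + 1) = g 0 - g 2 - g 3 + 1 by norm_num; ring,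
    show (1 : ℂ) + g 0 - g 3 - g 2 - g 1 = g 0 - g 1 - g 2 - g 3 + 1 by ring,
    show (1 : ℂ) + g 0 - g 3 - g 1 = g 0 - g 1 - g 3 + 1 by ring,
    show g (1 + 2) = g 3 by norm_num] at *
  field_simp

end Literature.NumberTheory.Irrationality.Zudilin2004.VWPBaseCase

end Part16

/-!
## Part 17 — port of `Summits/KontsevichZagierPeriods/Zeta5Search/VWPInduction.lean` (2 declarations kept)

# Zudilin's identity (4) at complex parameters, by induction on `k`

Declarations of this Part (verbatim port; each keeps its own docstring and citation): `summable_norm_gap`, `identity`.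

Reference keys (see `references.bib` and the declarations' citations): [Zudilin2004].
-/

section Part17

namespace Literature.NumberTheory.Irrationality.Zudilin2004.VWPInduction

open _root_.MeasureTheory _root_.Set
open Literature.NumberTheory.Irrationality.Zudilin2002 (nestedQ sorokinIntegrand)
open Literature.NumberTheory.Irrationality.Zudilin2004.VWPStepAlgebra (step)
open Literature.NumberTheory.Irrationality.Zudilin2004.VWPContinuationH0 (continuation)
open Literature.NumberTheory.Irrationality.Zudilin2004.VWPBaseCase (S_one)
open Literature.NumberTheory.Irrationality.Zudilin2004.SorokinIntegrableVWP (integrableOn_integrand_vwp)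
open Literature.NumberTheory.Irrationality.Zudilin2004.SorokinConvergence (integrableOn_sorokinIntegrand)
open Literature.NumberTheory.Irrationality.Zudilin2004.VWPSeriesSummable (norm_prod_Gamma_ratio_le)

/-! ### 1. Absolute convergence of the reduced series (the `hD` input of `step`, weight exponent `θ = 0`) -/

/-- **Summability of the reduced series**: for `Re g₀ > 0`, `Re g_i > 0` and `Re(1+g₀−g_i) > 0` (`i ∈ Icc 3 (n+3)`) and
`Re g₀ + 2Σ_{i=3}^{n+3} Re g_i − (n+1)(1 + Re g₀) < −1`, the norms of
`(g₀+2μ)·(Γ(g₀+μ)/Γ(1+g₀−g₀+μ))·∏_{i=3}^{n+3}Γ(g_i+μ)/Γ(1+g₀−g_i+μ)·(−1)^{(n+3)μ}` are summable (polynomial comparison, as in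
`VWPSeriesSummable.summable_vwpTerm`). [cite: Zudilin2004, §4 (supporting lemma)] -/
theorem summable_norm_gap (n : ℕ) (g : ℕ → ℂ) (h0 : 0 < (g 0).re) (hpos : ∀ i ∈ Finset.Icc 3 (n + 3), 0 < (g i).re)
    (hden : ∀ i ∈ Finset.Icc 3 (n + 3), 0 < (1 + g 0 - g i).re)
    (hE : (g 0).re + 2 * (∑ i ∈ Finset.Icc 3 (n + 3), (g i).re) - ((n : ℝ) + 1) * (1 + (g 0).re) < -1) :
    Summable fun μ : ℕ => ‖(g 0 + 2 * (μ : ℂ)) * (Complex.Gamma (g 0 + μ) / Complex.Gamma (1 + g 0 - g 0 + μ) *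
        ∏ i ∈ Finset.Icc 3 (n + 3), Complex.Gamma (g i + μ) / Complex.Gamma (1 + g 0 - g i + μ)) * (-1 : ℂ) ^ ((n + 3) * μ)‖ := by
  set S : Finset ℕ := insert 0 (Finset.Icc 3 (n + 3)) with hSdef
  have h0S : (0 : ℕ) ∉ Finset.Icc 3 (n + 3) := by simp
  have hζ : ∀ j ∈ S, 0 < (g j).re := by
    intro j hj
    rcases Finset.mem_insert.1 hj with rfl | hj
    · exact h0
    · exact hpos j hj
  have hξ : ∀ j ∈ S, 0 < ((fun j => 1 + g 0 - g j) j).re := by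
    intro j hj
    rcases Finset.mem_insert.1 hj with rfl | hj
    · simp
    · exact hden j hj
  obtain ⟨C, hC, hprod⟩ := norm_prod_Gamma_ratio_le S g (fun j => 1 + g 0 - g j) hζ hξ
  set E : ℝ := 1 + (∑ j ∈ S, ((g j).re - (1 + g 0 - g j).re)) with hEdef
  have hcard : ((Finset.Icc 3 (n + 3)).card : ℝ) = n + 1 := by
    rw [Nat.card_Icc, show n + 3 + 1 - 3 = n + 1 by omega]; push_cast; ring
  have hE1 : E < -1 := by
    have : E = (g 0).re + 2 * (∑ i ∈ Finset.Icc 3 (n + 3), (g i).re) - ((n : ℝ) + 1) * (1 + (g 0).re) := by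
      rw [hEdef, hSdef, Finset.sum_insert h0S]
      simp only [Complex.add_re, Complex.sub_re, Complex.one_re, Finset.sum_sub_distrib, Finset.sum_const, nsmul_eq_mul, hcard]
      ring
    rw [this]; exact hE
  have hg : Summable fun μ : ℕ => (‖g 0‖ + 2) * C * (μ : ℝ) ^ E := (Real.summable_nat_rpow.2 hE1).mul_left _
  refine Summable.of_norm_bounded_eventually_nat hg ?_
  rw [Filter.eventually_atTop]
  refine ⟨⌈1 + ∑ j ∈ S, (g j).re⌉₊, fun μ hμ => ?_⟩
  have hμR : 1 + ∑ j ∈ S, (g j).re ≤ (μ : ℝ) := le_trans (Nat.le_ceil _) (by exact_mod_cast hμ)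
  have hsum0 : 0 ≤ ∑ j ∈ S, (g j).re := Finset.sum_nonneg fun j hj => (hζ j hj).le
  have hμ1 : 1 ≤ (μ : ℝ) := by linarith
  have hμ0 : 0 < (μ : ℝ) := by linarith
  have hμj : ∀ j ∈ S, (g j).re ≤ (μ : ℝ) := fun j hj => by
    have := Finset.single_le_sum (f := fun j => (g j).re) (fun i hi => (hζ i hi).le) hj
    linarith
  have hP := hprod μ hμ1 hμj
  rw [hSdef, Finset.prod_insert h0S] at hP
  have hlin : ‖g 0 + 2 * (μ : ℂ)‖ ≤ (‖g 0‖ + 2) * (μ : ℝ) ^ (1 : ℝ) := by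
    rw [Real.rpow_one]
    calc ‖g 0 + 2 * (μ : ℂ)‖ ≤ ‖g 0‖ + ‖(2 : ℂ) * (μ : ℂ)‖ := norm_add_le _ _
      _ = ‖g 0‖ + 2 * μ := by rw [norm_mul, Complex.norm_two, Complex.norm_natCast]
      _ ≤ (‖g 0‖ + 2) * μ := by nlinarith [norm_nonneg (g 0)]
  rw [norm_norm, norm_mul, norm_mul, norm_pow, norm_neg, norm_one, one_pow, mul_one, norm_mul, norm_prod]
  calc ‖g 0 + 2 * (μ : ℂ)‖ * (‖Complex.Gamma (g 0 + μ) / Complex.Gamma (1 + g 0 - g 0 + μ)‖ *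
        ∏ i ∈ Finset.Icc 3 (n + 3), ‖Complex.Gamma (g i + μ) / Complex.Gamma (1 + g 0 - g i + μ)‖)
      ≤ ((‖g 0‖ + 2) * (μ : ℝ) ^ (1 : ℝ)) * (C * (μ : ℝ) ^ (∑ j ∈ S, ((g j).re - (1 + g 0 - g j).re))) :=
        mul_le_mul hlin hP (mul_nonneg (norm_nonneg _) (Finset.prod_nonneg fun _ _ => norm_nonneg _)) (by positivity)
    _ = (‖g 0‖ + 2) * C * (μ : ℝ) ^ E := by rw [hEdef, Real.rpow_add hμ0]; ring

/-! ### 2. The identity for all `n ≥ 1` -/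

/-- **Zudilin's identity (4) at complex parameters** [Zudilin math/0206177, Theorem, eq. (4) with (5)–(6)]: for `n ≥ 1` and `h : ℕ → ℂ` with `(2/(n+1))Σ_{j=1}^{n+2}Re h_j < 1 + Re h₀`,
`0 < Re h_j < 1 + Re h₀ − Re h_{j+1}` (`2 ≤ j ≤ n+1`), `Re h₀, Re h₁, Re h_{n+2} > 0`, `Re h₁ + Re h₂ < 1 + Re h₀`, the identity `S(n)(h)` holds.
[cite: Zudilin2004, §4 (supporting lemma)] -/
theorem identity {n : ℕ} (hn : 1 ≤ n) (h : ℕ → ℂ)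
    (h5 : (2 / ((n : ℝ) + 1)) * (∑ j ∈ Finset.Icc 1 (n + 2), (h j).re) < 1 + (h 0).re)
    (h6 : ∀ j ∈ Finset.Icc 2 (n + 1), 0 < (h j).re ∧ (h j).re < 1 + (h 0).re - (h (j + 1)).re)
    (h0 : 0 < (h 0).re) (h1 : 0 < (h 1).re) (hn2 : 0 < (h (n + 2)).re) (h12 : (h 1).re + (h 2).re < 1 + (h 0).re) :
    (∏ i ∈ Finset.Icc 1 (n + 1), Complex.Gamma (1 + h 0 - h i - h (i + 1))) / (Complex.Gamma (h 1) * Complex.Gamma (h (n + 2))) *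
        (∑' μ : ℕ, (h 0 + 2 * (μ : ℂ)) * (∏ i ∈ Finset.range (n + 3), Complex.Gamma (h i + μ) / Complex.Gamma (1 + h 0 - h i + μ)) *
          (-1 : ℂ) ^ ((n + 3) * μ)) =
      ∫ x in Set.pi univ (fun _ : Fin n => Icc (0 : ℝ) 1),
        (∏ j : Fin n, ((x j : ℝ) : ℂ) ^ (h (j + 2) - 1) * (1 - ((x j : ℝ) : ℂ)) ^ ((1 + h 0 - h (j + 3)) - h (j + 2) - 1)) *
          ((nestedQ (List.ofFn x) : ℝ) : ℂ) ^ (-h 1) := by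
  induction n, hn using Nat.le_induction generalizing h with
  | base =>
    have hI : Finset.Icc 1 (1 + 2) = {1, 2, 3} := by decide
    rw [hI, Finset.sum_insert (by decide), Finset.sum_insert (by decide), Finset.sum_singleton] at h5
    norm_num at h5
    exact S_one h h0 h1 (h6 2 (by simp)).1 (by simpa using hn2) (by linarith)
  | succ n hn IH =>
    -- positivity of all `Re h_i`, `1 ≤ i ≤ n+3`, and the crude bound `B`
    have hpos : ∀ i ∈ Finset.Icc 1 (n + 1 + 2), 0 < (h i).re := by
      intro i hi
      rw [Finset.mem_Icc] at hi
      rcases Nat.lt_or_ge i 2 with hi1 | hi2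
      · obtain rfl : i = 1 := by omega
        exact h1
      rcases Nat.lt_or_ge i (n + 1 + 2) with hi3 | hi4
      · exact (h6 i (Finset.mem_Icc.2 ⟨hi2, by omega⟩)).1
      · obtain rfl : i = n + 1 + 2 := by omega
        exact hn2
    set B : ℝ := ∑ j ∈ Finset.Icc 1 (n + 1 + 2), (h j).re with hB
    have hB0 : 0 ≤ B := Finset.sum_nonneg fun j hj => (hpos j hj).le
    have hle1 : ∀ i ∈ Finset.Icc 1 (n + 1 + 2), (h i).re ≤ B := fun i hi =>
      Finset.single_le_sum (f := fun j => (h j).re) (fun j hj => (hpos j hj).le) hi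
    have hle2 : ∀ i i' : ℕ, 1 ≤ i → i' ≤ n + 1 + 2 → i < i' → (h i).re + (h i').re ≤ B := by
      intro i i' hi hi' hlt
      have hsub : ({i, i'} : Finset ℕ) ⊆ Finset.Icc 1 (n + 1 + 2) := by
        intro j hj
        simp only [Finset.mem_insert, Finset.mem_singleton] at hj
        rcases hj with rfl | rfl <;> exact Finset.mem_Icc.2 ⟨by omega, by omega⟩
      have := Finset.sum_le_sum_of_subset_of_nonneg hsub (f := fun j => (h j).re) (fun j hj _ => (hpos j hj).le)
      rw [Finset.sum_pair (by omega)] at this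
      exact this
    have hle3 : (h 1).re + (h 2).re + (h 3).re ≤ B := by
      have hsub : ({1, 2, 3} : Finset ℕ) ⊆ Finset.Icc 1 (n + 1 + 2) := by
        intro j hj
        simp only [Finset.mem_insert, Finset.mem_singleton] at hj
        rcases hj with rfl | rfl | rfl <;> exact Finset.mem_Icc.2 ⟨by omega, by omega⟩
      have := Finset.sum_le_sum_of_subset_of_nonneg hsub (f := fun j => (h j).re) (fun j hj _ => (hpos j hj).le)
      rw [Finset.sum_insert (by decide), Finset.sum_insert (by decide), Finset.sum_singleton] at this
      linarith
    have h2 : 0 < (h 2).re := (h6 2 (Finset.mem_Icc.2 ⟨le_rfl, by omega⟩)).1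
    -- the small positive `t₀` and the typed lower bounds `M < Re h₀`
    set t₀ : ℝ := min (h 1).re (h 2).re / 2 with ht₀def
    have ht₀ : 0 < t₀ := by rw [ht₀def]; exact div_pos (lt_min h1 h2) two_pos
    have ht1 : t₀ < (h 1).re := by
      rw [ht₀def]; have := min_le_left (h 1).re (h 2).re; linarith
    have ht2 : t₀ < (h 2).re := by
      rw [ht₀def]; have := min_le_right (h 1).re (h 2).re; linarith
    have hne6 : (Finset.Icc 2 (n + 1 + 1)).Nonempty := ⟨2, Finset.mem_Icc.2 ⟨le_rfl, by omega⟩⟩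
    set m6 : ℝ := (Finset.Icc 2 (n + 1 + 1)).sup' hne6 (fun j => (h j).re + (h (j + 1)).re - 1) with hm6
    set M : ℝ := max (max (max 0 ((h 1).re + (h 2).re - 1)) m6)
      ((2 / (((n + 1 : ℕ) : ℝ) + 1)) * (∑ j ∈ Finset.Icc 1 (n + 1 + 2), (h j).re) - 1) with hMdef
    have hM0 : 0 ≤ M := le_max_of_le_left (le_max_of_le_left (le_max_left _ _))
    have hM12 : (h 1).re + (h 2).re - 1 ≤ M := le_max_of_le_left (le_max_of_le_left (le_max_right _ _))
    have hM6 : ∀ j ∈ Finset.Icc 2 (n + 1 + 1), (h j).re + (h (j + 1)).re - 1 ≤ M := fun j hj =>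
      le_max_of_le_left (le_max_of_le_right (Finset.le_sup' (fun j => (h j).re + (h (j + 1)).re - 1) hj))
    have hM5 : (2 / (((n + 1 : ℕ) : ℝ) + 1)) * (∑ j ∈ Finset.Icc 1 (n + 1 + 2), (h j).re) - 1 ≤ M := le_max_right _ _
    have hv : M < (h 0).re := by
      refine max_lt (max_lt (max_lt h0 (by linarith)) ?_) (by linarith)
      rw [hm6, Finset.sup'_lt_iff]
      intro j hj
      linarith [(h6 j hj).2]
    -- the largeness threshold
    set L' : ℝ := max M (2 * B + t₀ + 2) with hL'
    have hML : M ≤ L' := le_max_left _ _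
    have hn1 : (1 : ℝ) ≤ n := by exact_mod_cast hn
    -- the identity at every real `h₀ = t > L'`
    have hreal : ∀ t : ℝ, L' < t →
        (∏ i ∈ Finset.Icc 1 (n + 1 + 1), Complex.Gamma (1 + Function.update h 0 (t : ℂ) 0 - Function.update h 0 (t : ℂ) i -
              Function.update h 0 (t : ℂ) (i + 1))) /
            (Complex.Gamma (Function.update h 0 (t : ℂ) 1) * Complex.Gamma (Function.update h 0 (t : ℂ) (n + 1 + 2))) *
          (∑' μ : ℕ, (Function.update h 0 (t : ℂ) 0 + 2 * (μ : ℂ)) *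
            (∏ i ∈ Finset.range (n + 1 + 3), Complex.Gamma (Function.update h 0 (t : ℂ) i + μ) /
              Complex.Gamma (1 + Function.update h 0 (t : ℂ) 0 - Function.update h 0 (t : ℂ) i + μ)) * (-1 : ℂ) ^ ((n + 1 + 3) * μ)) =
        ∫ x in Set.pi univ (fun _ : Fin (n + 1) => Icc (0 : ℝ) 1),
          (∏ j : Fin (n + 1), ((x j : ℝ) : ℂ) ^ (Function.update h 0 (t : ℂ) (j + 2) - 1) *
              (1 - ((x j : ℝ) : ℂ)) ^ ((1 + Function.update h 0 (t : ℂ) 0 - Function.update h 0 (t : ℂ) (j + 3)) -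
                Function.update h 0 (t : ℂ) (j + 2) - 1)) *
            ((nestedQ (List.ofFn x) : ℝ) : ℂ) ^ (-Function.update h 0 (t : ℂ) 1) := by
      intro t ht
      have htM : M < t := lt_of_le_of_lt hML ht
      have htL : 2 * B + t₀ + 2 < t := lt_of_le_of_lt (le_max_right _ _) ht
      have ht0 : 0 < t := lt_of_le_of_lt hM0 htM
      -- the parameters with `h₀` replaced by `t`
      have hg0 : Function.update h 0 (t : ℂ) 0 = t := Function.update_self _ _ _
      have hgi : ∀ i, i ≠ 0 → Function.update h 0 (t : ℂ) i = h i := fun i hi => Function.update_of_ne hi _ _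
      have hg0re : (Function.update h 0 (t : ℂ) 0).re = t := by rw [hg0, Complex.ofReal_re]
      have hg0im : (Function.update h 0 (t : ℂ) 0).im = 0 := by rw [hg0, Complex.ofReal_im]
      have hg1 := hgi 1 one_ne_zero
      have hg2 := hgi 2 two_ne_zero
      have hg3 := hgi 3 (by norm_num)
      -- pairs of parameters are bounded by `B < t`
      have hpair : ∀ m, m + 4 ≤ n + 1 + 2 →
          1 + t - B ≤ (1 + Function.update h 0 (t : ℂ) 0 - Function.update h 0 (t : ℂ) (m + 4)).re -
            (Function.update h 0 (t : ℂ) (m + 3)).re := by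
        intro m hm
        rw [hgi (m + 4) (by omega), hgi (m + 3) (by omega), hg0]
        simp only [Complex.add_re, Complex.sub_re, Complex.one_re, Complex.ofReal_re]
        linarith [hle2 (m + 3) (m + 4) (by omega) hm (by omega)]
      refine step (ε := 1) (θ := 0) (t₀ := t₀) hn (Function.update h 0 (t : ℂ)) hg0im ht₀ (by rw [hg1]; exact ht1)
        (by rw [hg2]; exact ht2) ?_ ?_ ?_ (Or.inl rfl) le_rfl ?_ ?_ ?_ ?_ ?_
      · -- (C)
        rw [hg1, hg2, hg3, hg0]
        simp only [Complex.add_re, Complex.sub_re, Complex.one_re, Complex.ofReal_re]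
        linarith
      · rw [hg1, hg2, hg0re]; linarith
      · rw [hg0re]; linarith
      · -- (J) with `θ = 0`
        rw [hg1, hg2, hg0re]; linarith
      · -- integrability of the `(n+1)`-fold integrand
        refine integrableOn_integrand_vwp (k := n + 1) (by omega) (Function.update h 0 (t : ℂ)) ?_ ?_ (by rw [hg1]; exact h1.le)
          (by rw [hg1, hg2, hg0re]; linarith)
        · have hs : ∑ j ∈ Finset.Icc 1 (n + 1 + 2), (Function.update h 0 (t : ℂ) j).re = B :=
            Finset.sum_congr rfl fun j hj => by rw [hgi j (by have := (Finset.mem_Icc.1 hj).1; omega)]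
          rw [hs, hg0re]
          have hq : 2 / (((n + 1 : ℕ) : ℝ) + 1) ≤ 1 := by
            rw [div_le_one (by positivity)]; push_cast; linarith
          nlinarith
        · intro j hj
          have hj' := Finset.mem_Icc.1 hj
          rw [hgi j (by omega), hgi (j + 1) (by omega), hg0re]
          exact ⟨(h6 j hj).1, by linarith [hle2 j (j + 1) (by omega) (by omega) (by omega)]⟩
      · -- integrability of the real `n`-fold integrand at `a₀ = t₀`
        refine integrableOn_sorokinIntegrand hn ht₀.le ?_ ?_ ?_
        · intro j hj
          rw [hgi (j + 1 + 2) (by omega), hgi (j + 1 + 3) (by omega), hg0]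
          simp only [Complex.add_re, Complex.sub_re, Complex.one_re, Complex.ofReal_re]
          exact ⟨(h6 (j + 1 + 2) (Finset.mem_Icc.2 ⟨by omega, by omega⟩)).1,
            by linarith [hle2 (j + 1 + 2) (j + 1 + 3) (by omega) (by omega) (by omega)]⟩
        · intro i hi
          have hsum : 1 + t - B ≤ ∑ m ∈ Finset.range (i + 1),
              ((1 + Function.update h 0 (t : ℂ) 0 - Function.update h 0 (t : ℂ) (2 * m + 1 + 3)).re -
                (Function.update h 0 (t : ℂ) (2 * m + 1 + 2)).re) := by
            calc 1 + t - B ≤ (1 + Function.update h 0 (t : ℂ) 0 - Function.update h 0 (t : ℂ) (2 * 0 + 1 + 3)).re -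
                  (Function.update h 0 (t : ℂ) (2 * 0 + 1 + 2)).re := hpair 0 (by omega)
              _ ≤ _ := Finset.single_le_sum (f := fun m => (1 + Function.update h 0 (t : ℂ) 0 -
                    Function.update h 0 (t : ℂ) (2 * m + 1 + 3)).re - (Function.update h 0 (t : ℂ) (2 * m + 1 + 2)).re)
                  (fun m hm => by
                    have hm' := Finset.mem_range.1 hm
                    have := hpair (2 * m) (by omega)
                    rw [show 2 * m + 1 + 3 = 2 * m + 4 by ring, show 2 * m + 1 + 2 = 2 * m + 3 by ring]
                    linarith) (Finset.mem_range.2 (Nat.succ_pos i))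
          have hlast : 0 < (Function.update h 0 (t : ℂ) (2 * i + 1 + 1 + 2)).re := by
            rw [hgi (2 * i + 1 + 1 + 2) (by omega)]
            exact (h6 (2 * i + 1 + 1 + 2) (Finset.mem_Icc.2 ⟨by omega, by omega⟩)).1
          linarith
        · intro hodd
          obtain ⟨r, hr⟩ := hodd
          have hsum : 1 + t - B ≤ ∑ m ∈ Finset.range ((n + 1) / 2),
              ((1 + Function.update h 0 (t : ℂ) 0 - Function.update h 0 (t : ℂ) (2 * m + 1 + 3)).re -
                (Function.update h 0 (t : ℂ) (2 * m + 1 + 2)).re) := by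
            calc 1 + t - B ≤ (1 + Function.update h 0 (t : ℂ) 0 - Function.update h 0 (t : ℂ) (2 * 0 + 1 + 3)).re -
                  (Function.update h 0 (t : ℂ) (2 * 0 + 1 + 2)).re := hpair 0 (by omega)
              _ ≤ _ := Finset.single_le_sum (f := fun m => (1 + Function.update h 0 (t : ℂ) 0 -
                    Function.update h 0 (t : ℂ) (2 * m + 1 + 3)).re - (Function.update h 0 (t : ℂ) (2 * m + 1 + 2)).re)
                  (fun m hm => by
                    have hm' := Finset.mem_range.1 hm
                    have := hpair (2 * m) (by omega)
                    rw [show 2 * m + 1 + 3 = 2 * m + 4 by ring, show 2 * m + 1 + 2 = 2 * m + 3 by ring]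
                    linarith) (Finset.mem_range.2 (by omega))
          linarith
      · -- absolute convergence of the reduced series (`θ = 0`: the weight is `1`)
        have hS := summable_norm_gap n (Function.update h 0 (t : ℂ)) (by rw [hg0re]; exact ht0)
          (fun i hi => by rw [hgi i (by have := (Finset.mem_Icc.1 hi).1; omega)]; exact hpos i (Finset.mem_Icc.2
            ⟨by have := (Finset.mem_Icc.1 hi).1; omega, (Finset.mem_Icc.1 hi).2⟩))
          (fun i hi => by
            have hi' := Finset.mem_Icc.1 hi
            rw [hgi i (by omega), hg0]
            simp only [Complex.add_re, Complex.sub_re, Complex.one_re, Complex.ofReal_re]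
            linarith [hle1 i (Finset.mem_Icc.2 ⟨by omega, hi'.2⟩)])
          (by
            have hs3 : ∑ i ∈ Finset.Icc 3 (n + 3), (Function.update h 0 (t : ℂ) i).re ≤ B := by
              rw [Finset.sum_congr rfl fun i hi => by rw [hgi i (by have := (Finset.mem_Icc.1 hi).1; omega)]]
              exact Finset.sum_le_sum_of_subset_of_nonneg (fun i hi => Finset.mem_Icc.2
                ⟨by have := (Finset.mem_Icc.1 hi).1; omega, by have := (Finset.mem_Icc.1 hi).2; omega⟩)
                (fun j hj _ => (hpos j hj).le)
            rw [hg0re]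
            nlinarith)
        refine hS.congr fun μ => ?_
        rw [mul_zero, neg_zero, Real.rpow_zero, mul_one]
      · -- the inductive hypothesis at the complex parameters `(t; t₀ − iy, h₃, …, h_{n+3})`
        intro y g hg0' hg1' hgi'
        have hg0re' : (g 0).re = t := by rw [hg0', hg0re]
        have hg1re' : (g 1).re = t₀ := by rw [hg1']; simp
        have hgi'' : ∀ i, 2 ≤ i → g i = h (i + 1) := fun i hi => by rw [hgi' i hi, hgi (i + 1) (by omega)]
        have hs2 : ∑ j ∈ Finset.Icc 2 (n + 2), (g j).re ≤ B := by
          have himg : Finset.image (fun j => j + 1) (Finset.Icc 2 (n + 2)) = Finset.Icc 3 (n + 3) := by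
            ext i
            simp only [Finset.mem_image, Finset.mem_Icc]
            constructor
            · rintro ⟨j, hj, rfl⟩; omega
            · intro hi; exact ⟨i - 1, by omega, by omega⟩
          have hre : ∑ j ∈ Finset.Icc 2 (n + 2), (g j).re = ∑ i ∈ Finset.Icc 3 (n + 3), (h i).re := by
            rw [← himg, Finset.sum_image fun a _ b _ hab => by simpa using hab]
            exact Finset.sum_congr rfl fun j hj => by rw [hgi'' j (Finset.mem_Icc.1 hj).1]
          rw [hre]
          exact Finset.sum_le_sum_of_subset_of_nonneg (fun i hi => Finset.mem_Icc.2
            ⟨by have := (Finset.mem_Icc.1 hi).1; omega, by have := (Finset.mem_Icc.1 hi).2; omega⟩)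
            (fun j hj _ => (hpos j hj).le)
        refine IH g ?_ ?_ (by rw [hg0re']; exact ht0) (by rw [hg1re']; exact ht₀)
          (by rw [hgi'' (n + 2) (by omega)]; exact hn2) ?_
        · have hI : Finset.Icc 1 (n + 2) = insert 1 (Finset.Icc 2 (n + 2)) := by
            ext i; simp only [Finset.mem_insert, Finset.mem_Icc]; omega
          rw [hI, Finset.sum_insert (by simp), hg1re', hg0re']
          have hq : 2 / ((n : ℝ) + 1) ≤ 1 := by rw [div_le_one (by positivity)]; linarith
          have hq0 : 0 ≤ 2 / ((n : ℝ) + 1) := by positivity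
          nlinarith
        · intro j hj
          have hj' := Finset.mem_Icc.1 hj
          rw [hgi'' j hj'.1, hgi'' (j + 1) (by omega), hg0re']
          exact ⟨(h6 (j + 1) (Finset.mem_Icc.2 ⟨by omega, by omega⟩)).1,
            by linarith [hle2 (j + 1) (j + 1 + 1) (by omega) (by omega) (by omega)]⟩
        · rw [hg1re', hgi'' 2 le_rfl, hg0re']
          linarith [hle1 3 (Finset.mem_Icc.2 ⟨by omega, by omega⟩)]
    -- continuation in `h₀` down to `v = h₀`
    have key := continuation (n := n + 1) (by omega) h hpos hM0 hM12 hM6 hM5 hML hreal hv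
    rw [Function.update_eq_self] at key
    exact key

end Literature.NumberTheory.Irrationality.Zudilin2004.VWPInduction

end Part17

/-!
## Part 18 — port of `Summits/KontsevichZagierPeriods/Zeta5Search/VWPOfPos.lean` (1 declarations kept)

# Zudilin's Theorem (4) for positive real parameters: the named fact `vwp_eq_integral_of_pos` proved

Declarations of this Part (verbatim port; each keeps its own docstring and citation): `vwp_eq_integral_of_pos_holds`.

Reference keys (see `references.bib` and the declarations' citations): [Zudilin2004].
-/

section Part18

namespace Literature.NumberTheory.Irrationality.Zudilin2004.VWPOfPos

open _root_.MeasureTheory _root_.Set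
open Literature.NumberTheory.Irrationality.Zudilin2002 (nestedQ sorokinIntegral vwpSeries vwp_eq_integral_of_pos)
open Literature.NumberTheory.Irrationality.Zudilin2004.VWPInduction (identity)
open Literature.NumberTheory.Irrationality.Zudilin2004.VWPOfReal (setIntegral_ofReal vwpSeries_ofReal)

/-- **Zudilin's Theorem [math/0206177, eq. (4) with (5)–(6)] for positive real parameters — the named fact
`vwp_eq_integral_of_pos` holds**: for `k ≥ 1` and real `h` with `(2/(k+1))Σ_{j=1}^{k+2}h_j < 1+h₀`, `0 < h_j < 1+h₀−h_{j+1}`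
(`2 ≤ j ≤ k+1`), `h₀, h₁, h_{k+2} > 0`, `h₁+h₂ < 1+h₀`,
`(∏_{j=1}^{k+1}Γ(1+h₀−h_j−h_{j+1}))/(Γ(h₁)Γ(h_{k+2})) · F_{k+2}(h) = J_k(h₁; h₂,…,h_{k+1} | 1+h₀−h₃,…,1+h₀−h_{k+2})`.
[cite: Zudilin2004, §4 (supporting lemma)] -/
theorem vwp_eq_integral_of_pos_holds : vwp_eq_integral_of_pos := by
  intro k h hk h5 h6 hh0 hh1 hk2 h12
  -- the complex-parameter identity at `g_n = (h_n : ℂ)`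
  have hid := identity hk (fun n => ((h n : ℝ) : ℂ)) (by simpa only [Complex.ofReal_re] using h5)
    (by simpa only [Complex.ofReal_re] using h6) (by simpa only [Complex.ofReal_re] using hh0)
    (by simpa only [Complex.ofReal_re] using hh1) (by simpa only [Complex.ofReal_re] using hk2)
    (by simpa only [Complex.ofReal_re] using h12)
  -- the integral side is the cast of the typed `J_k`
  have hR : (∫ x in Set.pi univ (fun _ : Fin k => Icc (0 : ℝ) 1),
      (∏ j : Fin k, ((x j : ℝ) : ℂ) ^ ((fun n => ((h n : ℝ) : ℂ)) (j + 2) - 1) *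
          (1 - ((x j : ℝ) : ℂ)) ^ ((1 + (fun n => ((h n : ℝ) : ℂ)) 0 - (fun n => ((h n : ℝ) : ℂ)) (j + 3)) -
            (fun n => ((h n : ℝ) : ℂ)) (j + 2) - 1)) *
        ((nestedQ (List.ofFn x) : ℝ) : ℂ) ^ (-(fun n => ((h n : ℝ) : ℂ)) 1)) =
      ((sorokinIntegral k (h 1) (fun i => h (i + 2)) (fun i => 1 + h 0 - h (i + 3)) : ℝ) : ℂ) := by
    rw [← setIntegral_ofReal]
    refine setIntegral_congr_fun (MeasurableSet.univ_pi fun _ => measurableSet_Icc) fun x _ => ?_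
    simp only [Complex.ofReal_add, Complex.ofReal_sub, Complex.ofReal_one]
  -- the series side is the cast of the typed `F_{k+2}`
  have hS : (∑' μ : ℕ, ((fun n => ((h n : ℝ) : ℂ)) 0 + 2 * (μ : ℂ)) *
      (∏ i ∈ Finset.range (k + 3), Complex.Gamma ((fun n => ((h n : ℝ) : ℂ)) i + μ) /
        Complex.Gamma (1 + (fun n => ((h n : ℝ) : ℂ)) 0 - (fun n => ((h n : ℝ) : ℂ)) i + μ)) * (-1 : ℂ) ^ ((k + 3) * μ)) =
      ((vwpSeries (k + 2) h : ℝ) : ℂ) := vwpSeries_ofReal (k + 2) h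
  -- the Gamma prefactor is the cast of the real one
  have hΓ : ∀ r : ℝ, ((Real.Gamma r : ℝ) : ℂ) = Complex.Gamma (r : ℂ) := fun r => (Complex.Gamma_ofReal r).symm
  have hP : (∏ i ∈ Finset.Icc 1 (k + 1), Complex.Gamma (1 + (fun n => ((h n : ℝ) : ℂ)) 0 - (fun n => ((h n : ℝ) : ℂ)) i -
        (fun n => ((h n : ℝ) : ℂ)) (i + 1))) /
      (Complex.Gamma ((fun n => ((h n : ℝ) : ℂ)) 1) * Complex.Gamma ((fun n => ((h n : ℝ) : ℂ)) (k + 2))) =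
      ((((∏ j ∈ Finset.Icc 1 (k + 1), Real.Gamma (1 + h 0 - h j - h (j + 1))) / (Real.Gamma (h 1) * Real.Gamma (h (k + 2))) : ℝ) : ℂ)) := by
    push_cast
    simp_rw [hΓ]
    push_cast
    rfl
  apply Complex.ofReal_injective
  rw [Complex.ofReal_mul, ← hP, ← hS, ← hR]
  exact hid

end Literature.NumberTheory.Irrationality.Zudilin2004.VWPOfPos

end Part18

/-!
## Part 19 — port of `Summits/KontsevichZagierPeriods/Zeta5Search/WedgeDictionaryDescent22Weak.lean` (1 declarations kept)

# Transport of Brown–Zudilin (22) to the dual side on the closed Bailey cone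

Declarations of this Part (verbatim port; each keeps its own docstring and citation): `vwpDual_five_eq_J_weak`.

Reference keys (see `references.bib` and the declarations' citations): [Zudilin2004].
-/

section Part19

open _root_.Finset

namespace Literature.NumberTheory.Irrationality.Zudilin2004.WedgeDictionary

open Literature.NumberTheory.Irrationality.BrownZudilin2022 (vwpDual hOfB bOfA pOf qOf Converges cellularIntegral QOf zchoose)
open Literature.NumberTheory.Irrationality.Zudilin2002 (vwpSeries sorokinIntegral sorokinIntegrand vwp_eq_integral_of_pos)
open Literature.NumberTheory.Irrationality.Zudilin2004
  (Admissible WeakAdmissible cParams piNorm tau134 baileyTransform baileyTransformClosed weakAdmissible_tau134)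
open Literature.NumberTheory.Transcendental (zetaValue)

/-- Zudilin 2002 (k = 3) in Brown–Zudilin's coordinates, for WEAKLY admissible integer `B` (the cited positive-parameter theorem needs
only `B_j ≥ 0`, `2B₀ − ΣB ≥ 0` and `c₁₂, c₂₃, c₃₄, c₄₅ ≥ 0`):
`λ(B) · F̃₅(B) = J₃(B₁+1; B₂+1, B₃+1, B₄+1 | B₀−B₃+2, B₀−B₄+2, B₀−B₅+2)`.
[cite: Zudilin2004, §4 (supporting lemma)] -/
theorem vwpDual_five_eq_J_weak (hZ : vwp_eq_integral_of_pos) (B : ℕ → ℤ) (hB : WeakAdmissible B) :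
    (lamOf B : ℝ) * vwpDual 5 B =
      sorokinIntegral 3 ((B 1 : ℝ) + 1) (fun i => (B (i + 2) : ℝ) + 1) (fun i => (B 0 : ℝ) - B (i + 3) + 2) := by
  have h16 := hB
  unfold WeakAdmissible cParams at h16
  simp only [List.mem_cons, List.not_mem_nil, or_false, forall_eq_or_imp, forall_eq] at h16
  obtain ⟨c1, c2, c3, c4, c5, cS, c12, c13, c14, c15, c23, c24, c25, c34, c35, c45⟩ := h16
  have r0 : (0 : ℝ) ≤ B 0 := by exact_mod_cast (show 0 ≤ B 0 by omega)
  have r1 : (0 : ℝ) ≤ B 1 := by exact_mod_cast c1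
  have r2 : (0 : ℝ) ≤ B 2 := by exact_mod_cast c2
  have r3 : (0 : ℝ) ≤ B 3 := by exact_mod_cast c3
  have r4 : (0 : ℝ) ≤ B 4 := by exact_mod_cast c4
  have r5 : (0 : ℝ) ≤ B 5 := by exact_mod_cast c5
  have rS : ((B 1 : ℤ) : ℝ) + B 2 + B 3 + B 4 + B 5 < 2 * B 0 + 1 := by
    exact_mod_cast (show B 1 + B 2 + B 3 + B 4 + B 5 < 2 * B 0 + 1 by omega)
  have r12 : ((B 1 : ℤ) : ℝ) + B 2 < B 0 + 1 := by exact_mod_cast (show B 1 + B 2 < B 0 + 1 by omega)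
  have r23 : ((B 2 : ℤ) : ℝ) + B 3 < B 0 + 1 := by exact_mod_cast (show B 2 + B 3 < B 0 + 1 by omega)
  have r34 : ((B 3 : ℤ) : ℝ) + B 4 < B 0 + 1 := by exact_mod_cast (show B 3 + B 4 < B 0 + 1 by omega)
  have r45 : ((B 4 : ℤ) : ℝ) + B 5 < B 0 + 1 := by exact_mod_cast (show B 4 + B 5 < B 0 + 1 by omega)
  have H := hZ 3 (hOfB B) (by norm_num)
    (by
      rw [show Finset.Icc 1 (3 + 2) = ({1, 2, 3, 4, 5} : Finset ℕ) by decide]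
      simp [hOfB]
      linarith)
    (by
      intro j hj
      rw [show Finset.Icc 2 (3 + 1) = ({2, 3, 4} : Finset ℕ) by decide] at hj
      simp only [Finset.mem_insert, Finset.mem_singleton] at hj
      rcases hj with rfl | rfl | rfl <;> simp [hOfB] <;> constructor <;> linarith)
    (by simp [hOfB]; linarith) (by simp [hOfB]; linarith) (by simp [hOfB]; linarith) (by simp [hOfB]; linarith)
  rw [show Finset.Icc 1 (3 + 1) = ({1, 2, 3, 4} : Finset ℕ) by decide, Finset.prod_insert (by decide),
    Finset.prod_insert (by decide), Finset.prod_insert (by decide), Finset.prod_singleton] at H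
  simp only [Nat.reduceAdd] at H
  rw [Gamma_pair B one_ne_zero two_ne_zero c12, Gamma_pair B two_ne_zero three_ne_zero c23,
    Gamma_pair B three_ne_zero four_ne_zero c34, Gamma_pair B four_ne_zero (by norm_num) c45,
    Gamma_slot B one_ne_zero c1, Gamma_slot B (by norm_num) c5] at H
  rw [sorokinIntegral_congr3 (a₀' := hOfB B 1) (f' := fun i => hOfB B (i + 2)) (g' := fun i => 1 + hOfB B 0 - hOfB B (i + 3))
    (by simp [hOfB]) (fun i _ => by simp [hOfB]) (fun i _ => by simp [hOfB]; ring), ← H]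
  unfold Literature.NumberTheory.Irrationality.BrownZudilin2022.vwpDual
  simp only [lamOf, facQ]
  push_cast
  ring

end Literature.NumberTheory.Irrationality.Zudilin2004.WedgeDictionary

end Part19

/-!
## Part 20 — port of `Summits/KontsevichZagierPeriods/Zeta5Search/BaileyFromSorokinReflection.lean` (2 declarations kept)

# Bailey's `₇F₆` involution from the reflection symmetry of Zudilin's triple integral

Declarations of this Part (verbatim port; each keeps its own docstring and citation): `baileyTransformClosed_of_vwp_eq_integral`, `baileyTransform_of_vwp_eq_integral`.

Reference keys (see `references.bib` and the declarations' citations): [Zudilin2004].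
-/

section Part20

open _root_.MeasureTheory _root_.Set _root_.Finset

namespace Literature.NumberTheory.Irrationality.Zudilin2004.BaileyFromSorokinReflection

open Literature.NumberTheory.Irrationality.Zudilin2002 (sorokinIntegral sorokinIntegrand nestedQ vwp_eq_integral_of_pos)
open Literature.NumberTheory.Irrationality.Zudilin2004 (Admissible WeakAdmissible cParams piNorm tau baileyTransform
  baileyTransformClosed baileyTransform_of_closed vwpDual_comp_swap piNorm_comp_swap weakAdmissible_tau)
open Literature.NumberTheory.Irrationality.BrownZudilin2022 (vwpDual hOfB)
open Literature.NumberTheory.Irrationality.Zudilin2004.WedgeDictionary (facQ lamOf sorokinIntegral_congr3 vwpDual_five_eq_J_weak)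

/-- **CONDITIONAL REDUCTION (no discharge; named-fact debt unchanged): Bailey's transformation on the closed cone (2.2),
`Zudilin2004.baileyTransformClosed`, from Zudilin's integral identity `Zudilin2002.vwp_eq_integral_of_pos` (used at `k = 3`).**
For weakly admissible `B`,
put `P = B∘(1 3)` and `S = 𝔱(B)∘(1 3)∘(4 5)`; then Zudilin's right-hand side at `S` is the reflection (`sorokinIntegral_three_reflect`)
of the one at `P`, so `λ(P)·F̃₅(P) = λ(S)·F̃₅(S)` (`vwpDual_five_eq_J_weak`), while `λ(P)Π(P) = λ(S)Π(S)` (the same eight factorials)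
and `F̃₅`, `Π` are `S₅`-symmetric; hence `F̃₅(B)/Π(B) = F̃₅(𝔱B)/Π(𝔱B)`.
[cite: Zudilin2004, Sect. 4, Lemma 7 with (4.4)–(4.6), on (2.2); Zudilin2002VWPIntegrals, Theorem (eq. (4))] -/
theorem baileyTransformClosed_of_vwp_eq_integral
    (hZ : Literature.NumberTheory.Irrationality.Zudilin2002.vwp_eq_integral_of_pos) :
    Literature.NumberTheory.Irrationality.Zudilin2004.baileyTransformClosed := by
  intro B hB
  have h1 : (1 : ℕ) ∈ Finset.Icc 1 5 := by simp
  have h3 : (3 : ℕ) ∈ Finset.Icc 1 5 := by simp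
  have h4 : (4 : ℕ) ∈ Finset.Icc 1 5 := by simp
  have h5 : (5 : ℕ) ∈ Finset.Icc 1 5 := by simp
  -- the two auxiliary vectors
  set P : ℕ → ℤ := B ∘ Equiv.swap 1 3 with hPdef
  set S : ℕ → ℤ := (tau B ∘ Equiv.swap 1 3) ∘ Equiv.swap 4 5 with hSdef
  have hP : WeakAdmissible P := weakAdmissible_comp_swap13 hB
  have hS : WeakAdmissible S := weakAdmissible_comp_swap45 (weakAdmissible_comp_swap13 (weakAdmissible_tau hB))
  -- their coordinates
  have s130 : Equiv.swap (1 : ℕ) 3 0 = 0 := Equiv.swap_apply_of_ne_of_ne (by norm_num) (by norm_num)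
  have s132 : Equiv.swap (1 : ℕ) 3 2 = 2 := Equiv.swap_apply_of_ne_of_ne (by norm_num) (by norm_num)
  have s134 : Equiv.swap (1 : ℕ) 3 4 = 4 := Equiv.swap_apply_of_ne_of_ne (by norm_num) (by norm_num)
  have s135 : Equiv.swap (1 : ℕ) 3 5 = 5 := Equiv.swap_apply_of_ne_of_ne (by norm_num) (by norm_num)
  have s131 : Equiv.swap (1 : ℕ) 3 1 = 3 := Equiv.swap_apply_left _ _
  have s133 : Equiv.swap (1 : ℕ) 3 3 = 1 := Equiv.swap_apply_right _ _
  have s450 : Equiv.swap (4 : ℕ) 5 0 = 0 := Equiv.swap_apply_of_ne_of_ne (by norm_num) (by norm_num)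
  have s451 : Equiv.swap (4 : ℕ) 5 1 = 1 := Equiv.swap_apply_of_ne_of_ne (by norm_num) (by norm_num)
  have s452 : Equiv.swap (4 : ℕ) 5 2 = 2 := Equiv.swap_apply_of_ne_of_ne (by norm_num) (by norm_num)
  have s453 : Equiv.swap (4 : ℕ) 5 3 = 3 := Equiv.swap_apply_of_ne_of_ne (by norm_num) (by norm_num)
  have s454 : Equiv.swap (4 : ℕ) 5 4 = 5 := Equiv.swap_apply_left _ _
  have s455 : Equiv.swap (4 : ℕ) 5 5 = 4 := Equiv.swap_apply_right _ _
  have tau0 : tau B 0 = B 0 + (B 0 - B 1 - B 4 - B 5) := if_pos (by decide)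
  have tau1 : tau B 1 = B 1 + (B 0 - B 1 - B 4 - B 5) := if_pos (by decide)
  have tau2 : tau B 2 = B 2 := if_neg (by decide)
  have tau3 : tau B 3 = B 3 := if_neg (by decide)
  have tau4 : tau B 4 = B 4 + (B 0 - B 1 - B 4 - B 5) := if_pos (by decide)
  have tau5 : tau B 5 = B 5 + (B 0 - B 1 - B 4 - B 5) := if_pos (by decide)
  have eP0 : P 0 = B 0 := by rw [hPdef]; simp only [Function.comp_apply, s130]
  have eP1 : P 1 = B 3 := by rw [hPdef]; simp only [Function.comp_apply, s131]
  have eP2 : P 2 = B 2 := by rw [hPdef]; simp only [Function.comp_apply, s132]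
  have eP3 : P 3 = B 1 := by rw [hPdef]; simp only [Function.comp_apply, s133]
  have eP4 : P 4 = B 4 := by rw [hPdef]; simp only [Function.comp_apply, s134]
  have eP5 : P 5 = B 5 := by rw [hPdef]; simp only [Function.comp_apply, s135]
  have eS0 : S 0 = 2 * B 0 - B 1 - B 4 - B 5 := by
    rw [hSdef]; simp only [Function.comp_apply, s450, s130]; rw [tau0]; ring
  have eS1 : S 1 = B 3 := by rw [hSdef]; simp only [Function.comp_apply, s451, s131, tau3]
  have eS2 : S 2 = B 2 := by rw [hSdef]; simp only [Function.comp_apply, s452, s132, tau2]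
  have eS3 : S 3 = B 0 - B 4 - B 5 := by
    rw [hSdef]; simp only [Function.comp_apply, s453, s133]; rw [tau1]; ring
  have eS4 : S 4 = B 0 - B 1 - B 4 := by
    rw [hSdef]; simp only [Function.comp_apply, s454, s135]; rw [tau5]; ring
  have eS5 : S 5 = B 0 - B 1 - B 5 := by
    rw [hSdef]; simp only [Function.comp_apply, s455, s134]; rw [tau4]; ring
  -- Zudilin at `P` and at `S`; the right-hand sides are reflections of each other
  have zP := vwpDual_five_eq_J_weak hZ P hP
  have zS := vwpDual_five_eq_J_weak hZ S hS
  have hrefl : sorokinIntegral 3 ((S 1 : ℝ) + 1) (fun i => (S (i + 2) : ℝ) + 1) (fun i => (S 0 : ℝ) - S (i + 3) + 2) =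
      sorokinIntegral 3 ((P 1 : ℝ) + 1) (fun i => (P (i + 2) : ℝ) + 1) (fun i => (P 0 : ℝ) - P (i + 3) + 2) := by
    rw [← sorokinIntegral_three_reflect ((P 1 : ℝ) + 1) (fun i => (P (i + 2) : ℝ) + 1) (fun i => (P 0 : ℝ) - P (i + 3) + 2)]
    refine sorokinIntegral_congr3 ?_ ?_ ?_
    · rw [eS1, eP1]
    · intro i hi
      interval_cases i <;> simp [eS2, eS3, eS4, eP0, eP2, eP3, eP4, eP5] <;> ring
    · intro i hi
      interval_cases i <;> simp [eS0, eS3, eS4, eS5, eP0, eP3, eP4, eP5] <;> ring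
  have hFF : (lamOf P : ℝ) * vwpDual 5 P = (lamOf S : ℝ) * vwpDual 5 S := by rw [zP, zS, hrefl]
  -- the factorial identity `λ(P)Π(P) = λ(S)Π(S)` and non-vanishing
  have hsumP : 2 * P 0 - ∑ j ∈ range 5, P (j + 1) = 2 * B 0 - (B 1 + B 2 + B 3 + B 4 + B 5) := by
    simp only [sum_range_succ, sum_range_zero, zero_add, eP1, eP2, eP3, eP4, eP5, eP0]; ring
  have hsumS : 2 * S 0 - ∑ j ∈ range 5, S (j + 1) = B 0 - B 2 - B 3 := by
    simp only [sum_range_succ, sum_range_zero, zero_add, eS1, eS2, eS3, eS4, eS5, eS0]; ring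
  have hPiP : (piNorm P : ℚ) = facQ (B 3) * facQ (B 2) * facQ (B 1) * facQ (B 4) * facQ (B 5) *
      facQ (2 * B 0 - (B 1 + B 2 + B 3 + B 4 + B 5)) := by
    unfold piNorm; rw [hsumP]; simp [prod_range_succ, facQ, eP1, eP2, eP3, eP4, eP5]
  have hPiS : (piNorm S : ℚ) = facQ (B 3) * facQ (B 2) * facQ (B 0 - B 4 - B 5) * facQ (B 0 - B 1 - B 4) * facQ (B 0 - B 1 - B 5) *
      facQ (B 0 - B 2 - B 3) := by
    unfold piNorm; rw [hsumS]; simp [prod_range_succ, facQ, eS1, eS2, eS3, eS4, eS5]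
  have hLamP : lamOf P = facQ (B 0 - B 3 - B 2) * facQ (B 0 - B 2 - B 1) * facQ (B 0 - B 1 - B 4) * facQ (B 0 - B 4 - B 5) /
      (facQ (B 3) * facQ (B 5)) := by
    simp only [lamOf, eP0, eP1, eP2, eP3, eP4, eP5]
  have hLamS : lamOf S = facQ (2 * B 0 - (B 1 + B 2 + B 3 + B 4 + B 5)) * facQ (B 0 - B 2 - B 1) * facQ (B 4) * facQ (B 1) /
      (facQ (B 3) * facQ (B 0 - B 1 - B 5)) := by
    simp only [lamOf, eS0, eS1, eS2, eS3, eS4, eS5]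
    congr 1
    · rw [show 2 * B 0 - B 1 - B 4 - B 5 - B 3 - B 2 = 2 * B 0 - (B 1 + B 2 + B 3 + B 4 + B 5) by ring,
        show 2 * B 0 - B 1 - B 4 - B 5 - B 2 - (B 0 - B 4 - B 5) = B 0 - B 2 - B 1 by ring,
        show 2 * B 0 - B 1 - B 4 - B 5 - (B 0 - B 4 - B 5) - (B 0 - B 1 - B 4) = B 4 by ring,
        show 2 * B 0 - B 1 - B 4 - B 5 - (B 0 - B 1 - B 4) - (B 0 - B 1 - B 5) = B 1 by ring]
  have fac_pos : ∀ z : ℤ, (0 : ℚ) < facQ z := fun z => by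
    unfold facQ; exact_mod_cast Nat.factorial_pos _
  have hLamPi : lamOf P * (piNorm P : ℚ) = lamOf S * (piNorm S : ℚ) := by
    rw [hLamP, hLamS, hPiP, hPiS]
    rw [show B 0 - B 3 - B 2 = B 0 - B 2 - B 3 by ring]
    have hDP : facQ (B 3) * facQ (B 5) ≠ 0 := (mul_pos (fac_pos _) (fac_pos _)).ne'
    have hDS : facQ (B 3) * facQ (B 0 - B 1 - B 5) ≠ 0 := (mul_pos (fac_pos _) (fac_pos _)).ne'
    rw [div_mul_eq_mul_div, div_mul_eq_mul_div, div_eq_div_iff hDP hDS]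
    ring
  have hLamP0 : (lamOf P : ℝ) ≠ 0 := by
    rw [hLamP]; push_cast
    have := fac_pos (B 0 - B 3 - B 2); have := fac_pos (B 0 - B 2 - B 1); have := fac_pos (B 0 - B 1 - B 4)
    have := fac_pos (B 0 - B 4 - B 5); have := fac_pos (B 3); have := fac_pos (B 5)
    positivity
  have hLamS0 : (lamOf S : ℝ) ≠ 0 := by
    rw [hLamS]; push_cast
    have := fac_pos (2 * B 0 - (B 1 + B 2 + B 3 + B 4 + B 5)); have := fac_pos (B 0 - B 2 - B 1); have := fac_pos (B 4)
    have := fac_pos (B 1); have := fac_pos (B 3); have := fac_pos (B 0 - B 1 - B 5)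
    positivity
  have hPiP0 : (piNorm P : ℝ) ≠ 0 := by
    unfold piNorm; exact_mod_cast Nat.mul_ne_zero (prod_ne_zero_iff.2 fun _ _ => Nat.factorial_ne_zero _) (Nat.factorial_ne_zero _)
  have hPiS0 : (piNorm S : ℝ) ≠ 0 := by
    unfold piNorm; exact_mod_cast Nat.mul_ne_zero (prod_ne_zero_iff.2 fun _ _ => Nat.factorial_ne_zero _) (Nat.factorial_ne_zero _)
  have hLamPiR : (lamOf P : ℝ) * (piNorm P : ℝ) = (lamOf S : ℝ) * (piNorm S : ℝ) := by
    have := congrArg (fun q : ℚ => (q : ℝ)) hLamPi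
    push_cast at this
    exact this
  -- assemble: `F̃(P)/Π(P) = F̃(S)/Π(S)`
  have main : vwpDual 5 P / (piNorm P : ℝ) = vwpDual 5 S / (piNorm S : ℝ) := by
    rw [div_eq_div_iff hPiP0 hPiS0]
    have e1 : vwpDual 5 P = (lamOf S : ℝ) * vwpDual 5 S / (lamOf P : ℝ) := by
      rw [eq_div_iff hLamP0, mul_comm]; exact hFF
    rw [e1, div_mul_eq_mul_div, div_eq_iff hLamP0]
    calc (lamOf S : ℝ) * vwpDual 5 S * (piNorm S : ℝ)
        = vwpDual 5 S * ((lamOf S : ℝ) * (piNorm S : ℝ)) := by ring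
      _ = vwpDual 5 S * ((lamOf P : ℝ) * (piNorm P : ℝ)) := by rw [hLamPiR]
      _ = vwpDual 5 S * (piNorm P : ℝ) * (lamOf P : ℝ) := by ring
  -- transport back to `B` and `𝔱 B` by the `S₅`-symmetry
  have eFP : vwpDual 5 P = vwpDual 5 B := by rw [hPdef]; exact vwpDual_comp_swap 5 B h1 h3
  have ePiP : piNorm P = piNorm B := by rw [hPdef]; exact piNorm_comp_swap B h1 h3
  have eFS : vwpDual 5 S = vwpDual 5 (tau B) := by
    rw [hSdef, vwpDual_comp_swap 5 _ h4 h5, vwpDual_comp_swap 5 _ h1 h3]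
  have ePiS : piNorm S = piNorm (tau B) := by
    rw [hSdef, piNorm_comp_swap _ h4 h5, piNorm_comp_swap _ h1 h3]
  rw [← eFP, ← ePiP, ← eFS, ← ePiS]
  exact main

/-- **CONDITIONAL REDUCTION (no discharge; named-fact debt unchanged): Bailey's transformation on the admissible cone (4.12),
`Zudilin2004.baileyTransform`, from Zudilin's integral identity `Zudilin2002.vwp_eq_integral_of_pos`** (the closed-cone reduction
restricted by the tree's `baileyTransform_of_closed`). [cite: Zudilin2004, Sect. 4, Lemma 7 with (4.4)–(4.6); Zudilin2002VWPIntegrals, Theorem (eq. (4))] -/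
theorem baileyTransform_of_vwp_eq_integral
    (hZ : Literature.NumberTheory.Irrationality.Zudilin2002.vwp_eq_integral_of_pos) :
    Literature.NumberTheory.Irrationality.Zudilin2004.baileyTransform :=
  baileyTransform_of_closed (baileyTransformClosed_of_vwp_eq_integral hZ)

end Literature.NumberTheory.Irrationality.Zudilin2004.BaileyFromSorokinReflection

end Part20

/-!
## Part 21 — port of `Summits/KontsevichZagierPeriods/Zeta5Search/VWPOfPosConsequences.lean` (2 declarations kept)

# Bailey's transformation unconditionally: `baileyTransformClosed` and `baileyTransform` hold (via `vwp_eq_integral_of_pos`)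

Declarations of this Part (verbatim port; each keeps its own docstring and citation): `baileyTransformClosed_holds`, `baileyTransform_holds`.

Reference keys (see `references.bib` and the declarations' citations): [Zudilin2004].
-/

section Part21

namespace Literature.NumberTheory.Irrationality.Zudilin2004.VWPOfPosConsequences

open _root_.Finset
open Literature.NumberTheory.Irrationality.Zudilin2004.VWPOfPos (vwp_eq_integral_of_pos_holds)
open Literature.NumberTheory.Irrationality.Zudilin2004.WedgeDictionary
open Literature.NumberTheory.Irrationality.BrownZudilin2022 (vwpDual bOfA pOf qOf Converges cellularIntegral QOf)
open Literature.NumberTheory.Irrationality.Zudilin2002 (sorokinIntegral)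
open Literature.NumberTheory.Irrationality.Zudilin2004 (Admissible WeakAdmissible baileyTransform baileyTransformClosed)
open Literature.NumberTheory.Transcendental (zetaValue)

/-- **Bailey's transformation of `F̃₅` on the CLOSED admissible cone [Zudilin2004, Sect. 4, Lemma 7 with (4.4)–(4.6), on (2.2)] — the
named fact `Zudilin2004.baileyTransformClosed` HOLDS** (g25's reduction to Zudilin 2002 + `vwp_eq_integral_of_pos_holds`).
[cite: Zudilin2004, §4 (supporting lemma)] -/
theorem _root_.Literature.NumberTheory.Irrationality.Zudilin2004.baileyTransformClosed_holds : baileyTransformClosed :=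
  BaileyFromSorokinReflection.baileyTransformClosed_of_vwp_eq_integral vwp_eq_integral_of_pos_holds

/-- **Bailey's transformation of `F̃₅` on the admissible cone [Zudilin2004, Sect. 4, Lemma 7 with (4.4)–(4.6); Prop. 2] — the named fact
`Zudilin2004.baileyTransform` HOLDS.** [cite: Zudilin2004, §4 (supporting lemma)] -/
theorem _root_.Literature.NumberTheory.Irrationality.Zudilin2004.baileyTransform_holds : baileyTransform :=
  BaileyFromSorokinReflection.baileyTransform_of_vwp_eq_integral vwp_eq_integral_of_pos_holds

end Literature.NumberTheory.Irrationality.Zudilin2004.VWPOfPosConsequences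

end Part21

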